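import Mathlib.Topology.LocallyConstant.Basic
import Mathlib.Analysis.Real.Cardinality
import Mathlib.Data.Int.Interval
import Mathlib.MeasureTheory.Function.Floor
import Mathlib.MeasureTheory.Measure.Typeclasses.NullSingletonClass
import Mathlib.Algebra.Polynomial.Degree.SmallDegree
import Literature.NumberTheory.DiophantineApproximation.GeneralizedPolynomialsUD
import Literature.NumberTheory.DiophantineApproximation.FloorMultipleSequenceUD
import Literature.NumberTheory.DiophantineApproximation.FloorMultiples
import Literature.NumberTheory.UniformDistribution.VanDerCorputDifferenceTheorem
import HarnessLib

/-!
# Håland 1994, Proposition 1.2 — the sufficiency direction (`α, β > 0`)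

Topic `Literature/NumberTheory/DiophantineApproximation`, companion of `GeneralizedPolynomialsUD.lean`
(the vendored statements of I. J. Håland, *Uniform distribution of generalized polynomials of the
product type*, Acta Arith. 67 (1994) 13–27) and of `GeneralizedPolynomialsUDPropOneTwo.lean`
(the NECESSITY half of the corrected Proposition 1.2). Everything in this file is PROVED; there is no
new definition and no named fact.

**Main result.** `Haland1994_prop_1_2_sufficiency`: for `α, β > 0`, if either
(i) `α/β ≠ √c` for every positive rational `c` and `γ` is irrational, or (ii) `α/β = √c` for some
positive rational `c` and `γ ∉ span_ℚ{1, √c}`, then `(⌊αn⌋⌊βn⌋γ)_{n ≥ 1}` is uniformly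
distributed mod 1 (`IsUDModOne`, Håland's Definition 2.1). Together with
`Haland1994_prop_1_2_necessity` this is Proposition 1.2 of the paper (= Håland 1993, Prop. 5.3) in
the regime `α, β > 0` of the printed dichotomy; the literal vendoring over all non-zero `α, β` is
refuted in the statement file (`not_Haland1994_prop_1_2`).

**The proof.** The printed source gives no proof (it refers to Håland's 1993 paper, whose §5 rests
on van der Corput's difference theorem and on the theory of the degree-two generalized polynomials
`[αn]βn`, Prop. 2.2 there). We follow the van der Corput route of Håland 1994, §2, with one
essential refinement. By the identity `⌊α(n+h)⌋ = ⌊αn⌋ + ⌊αh⌋ + 𝟙[{αh}+{αn} ≥ 1]` the correlation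
`e(q(n+h) − q(n))`, `q(n) = γ⌊αn⌋⌊βn⌋`, is a sum of four terms `e(λn)·f¹({αn})·f²({βn})` with
`λ = γ(m₁α + m₂β)`, `m₁ = ⌊βh⌋ + δ`, `m₂ = ⌊αh⌋ + ε`, and piecewise-exponential weights `fⁱ`
(`e_corr_eq_sum_pieces`). Such twisted Weyl sums have Cesàro limit `0` unless the frequency
RESONATES (`λ + kα + lβ ∈ ℤ`), in which case the limit is a Fourier coefficient of the weights
(`twisted_sum_eventually_le`); in the configurations allowed by (i)/(ii) resonances DO occur
(e.g. `(α, β, γ) = (φ, 1, φ − 1)`, `(∛2, 1 + ∛4, ∛4)`, `(√2, √2, 1/√2)`), so the plain difference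
theorem does not apply — but the resonant Fourier coefficient is an oscillatory integral of size
`O(1/h)` (`norm_integral_le_of_locally_e`, `key_indep`, `key_dep`), and the STRENGTHENED difference
theorem (`isLittleO_sum_of_corr_eventually_small`: correlations eventually small for large lags
suffice, from the tree's van der Corput inequality `norm_sum_sq_le_vdC`) concludes. The decay of
the resonant coefficient fails exactly in the excluded configuration `(α/β)² ∈ ℚ`, `γ ∈ ℚ + ℚ(α/β)`
(`key_indep`, `no_degenerate_dep` — a conjugation argument in the quadratic field generated by
the ratio). The three arithmetic regimes `dim_ℚ span{1, α, β} = 3, 2, 1` are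
`isLittleO_floor_mul_floor_indep` (Kronecker sequence `({αn}, {βn})` on `𝕋²`),
`isLittleO_floor_mul_floor_dep` (along residue classes both fractional parts are functions of one
rotation `{Dξ·m}`; Håland's Remark p. 19) and `isLittleO_floor_mul_floor_rat` (quadratic
polynomials along residue classes, Weyl). Tools from the tree: `|e(x)| = 1` (`FloorMulEquidist.norm_e`), Weyl's criterion and Theorem 1.1
for `EquidistributedModOne` and `IsUniformlyDistributedModOne`, `(nθ)` u.d., geometric sums,
density of trigonometric polynomials on the circle (`WeylCircle.exists_trigPoly_approx`), the
van der Corput inequality and Weyl's theorem for polynomials (`VanDerCorputDifferenceTheorem.lean`).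

## References

* [Haland1994] I. J. Håland, *Uniform distribution of generalized polynomials of the product type*,
  Acta Arith. 67 (1994) 13–27: Prop. 1.2 (p. 13), Thm 1.3 (p. 14), §2 (pp. 14–19, the van der
  Corput method and the Remark on rationally dependent coefficients). doi:10.4064/aa-67-1-13-27
* [KuipersNiederreiter1974] L. Kuipers, H. Niederreiter, *Uniform distribution of sequences*, Wiley
  1974: Ch. 1, Lemma 3.1 and Thm 3.1 (van der Corput), Thm 3.2 (Weyl), Thm 1.1 and Thm 2.1;
  Ch. 5, Thm 1.8 (the twisted-sum pattern for `[αn]β`).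
-/

noncomputable section

open Filter Topology Asymptotics Finset Complex MeasureTheory Polynomial
open scoped Real ComplexConjugate

namespace Literature.NumberTheory.DiophantineApproximation

namespace HalandUD

open Literature.NumberTheory.UniformDistribution
open Literature.NumberTheory.DiophantineApproximation.FloorMulEquidist (norm_e)

/-! ### A. The character `e(x) = exp(2πix)` -/

/-- `e(x + y) = e(x) e(y)`. [folklore] -/
theorem e_add (x y : ℂ) : cexp (2 * π * I * (x + y)) = cexp (2 * π * I * x) * cexp (2 * π * I * y) := by
  rw [mul_add, Complex.exp_add]

/-- `e(z) = 1` for an integer `z`. [folklore] -/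
theorem e_int (z : ℤ) : cexp (2 * π * I * (z : ℂ)) = 1 := by
  rw [show (2 * π * I * (z : ℂ)) = (z : ℂ) * (2 * π * I) by ring]
  exact Complex.exp_int_mul_two_pi_mul_I z

/-- `e(x + z) = e(x)` for an integer `z`. [folklore] -/
theorem e_add_int (x : ℂ) (z : ℤ) : cexp (2 * π * I * (x + z)) = cexp (2 * π * I * x) := by
  rw [e_add, e_int, mul_one]

/-- `|e(x)| ≤ 1` for real `x`. [folklore] -/
theorem norm_e_le (x : ℝ) : ‖cexp (2 * π * I * (x : ℂ))‖ ≤ 1 := (norm_e x).le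

/-- `e(k{x}) = e(kx)` for an integer `k`. [folklore] -/
theorem e_int_mul_fract (k : ℤ) (x : ℝ) :
    cexp (2 * π * I * ((k : ℝ) * Int.fract x : ℝ)) = cexp (2 * π * I * ((k : ℝ) * x : ℝ)) := by
  have hx : (k : ℝ) * x = (k : ℝ) * Int.fract x + ((k * ⌊x⌋ : ℤ) : ℝ) := by
    rw [Int.fract]; push_cast; ring
  rw [hx]; push_cast
  rw [show (↑k * ↑(Int.fract x) + ↑k * ↑⌊x⌋ : ℂ) = ↑k * ↑(Int.fract x) + ((k * ⌊x⌋ : ℤ) : ℂ) by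
    push_cast; ring, e_add_int]

/-- `e(-x) = conj e(x)` for real `x`. [folklore] -/
theorem e_neg_eq_conj (x : ℝ) :
    cexp (2 * π * I * ((-x : ℝ) : ℂ)) = (starRingEnd ℂ) (cexp (2 * π * I * (x : ℂ))) := by
  rw [← Complex.exp_conj]
  congr 1
  simp only [map_mul, Complex.conj_ofReal, Complex.conj_I, map_ofNat]
  push_cast; ring

/-- `e(x) conj e(y) = e(x - y)` for real `x, y`. [folklore] -/
theorem e_mul_conj_e (x y : ℝ) :
    cexp (2 * π * I * (x : ℂ)) * (starRingEnd ℂ) (cexp (2 * π * I * (y : ℂ))) =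
      cexp (2 * π * I * ((x - y : ℝ) : ℂ)) := by
  rw [← e_neg_eq_conj, ← e_add]; push_cast; ring_nf

/-- `e(x) ≠ 1`-criterion: `e(x) = 1` iff `x ∈ ℤ`, contrapositive form — verbatim duplicate of
`FloorMultipleUD.exp_ne_one_of_ne_int` (`FloorMultipleSequenceUD.lean`), kept as a deprecated alias
(librarian dedup-01576). [folklore] -/
@[deprecated FloorMultipleUD.exp_ne_one_of_ne_int (since := "2026-08-16")]
alias e_ne_one_of_forall_ne_int := FloorMultipleUD.exp_ne_one_of_ne_int

/-! ### B. Geometric sums over `range N` -/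

/-- **Geometric sums are bounded**: `‖∑_{n<N} e(θ n)‖ ≤ 2/‖e(θ) − 1‖` if `e(θ) ≠ 1`. [folklore] -/
theorem norm_sum_range_e_le (θ : ℝ) (h : cexp (2 * π * I * θ) ≠ 1) (N : ℕ) :
    ‖∑ n ∈ range N, cexp (2 * π * I * ((θ * n : ℝ) : ℂ))‖ ≤ 2 / ‖cexp (2 * π * I * θ) - 1‖ := by
  set r := cexp (2 * π * I * θ) with hr
  have hr1 : ‖r‖ = 1 := norm_e θ
  have hterm : ∀ n : ℕ, cexp (2 * π * I * ((θ * n : ℝ) : ℂ)) = r ^ n := by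
    intro n
    rw [hr, ← Complex.exp_nat_mul]; congr 1; push_cast; ring
  simp_rw [hterm]
  have hne : r - 1 ≠ 0 := sub_ne_zero.mpr h
  have hpos : 0 < ‖r - 1‖ := norm_pos_iff.mpr hne
  rw [le_div_iff₀ hpos, ← norm_mul, geom_sum_mul]
  calc ‖r ^ N - 1‖ ≤ ‖r ^ N‖ + ‖(1 : ℂ)‖ := norm_sub_le _ _
    _ = 2 := by rw [norm_pow, hr1, one_pow, norm_one]; norm_num

/-- **Weyl sums of `θn` over `n < N` are `o(N)`** when `e(θ) ≠ 1`. [folklore] -/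
theorem isLittleO_sum_range_e (θ : ℝ) (h : cexp (2 * π * I * θ) ≠ 1) :
    (fun N : ℕ => ∑ n ∈ range N, cexp (2 * π * I * ((θ * n : ℝ) : ℂ))) =o[atTop]
      fun N : ℕ => (N : ℝ) := by
  have h1 : (fun N : ℕ => ∑ n ∈ range N, cexp (2 * π * I * ((θ * n : ℝ) : ℂ))) =O[atTop]
      fun _ : ℕ => (1 : ℝ) :=
    IsBigO.of_bound (2 / ‖cexp (2 * π * I * θ) - 1‖) (Eventually.of_forall fun N => by
      rw [norm_one, mul_one]; exact norm_sum_range_e_le θ h N)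
  refine h1.trans_isLittleO ?_
  refine isLittleO_const_left.mpr (Or.inr ?_)
  exact tendsto_natCast_atTop_atTop.congr fun N => by simp

/-- From an `o(N)` statement to an eventual bound `≤ η N`. [folklore] -/
theorem eventually_norm_le_of_isLittleO {f : ℕ → ℂ} (hf : f =o[atTop] fun N : ℕ => (N : ℝ))
    {η : ℝ} (hη : 0 < η) : ∀ᶠ N : ℕ in atTop, ‖f N‖ ≤ η * N := by
  have := hf.def hη
  filter_upwards [this] with N hN
  simpa [Real.norm_natCast] using hN

/-! ### C. Floors of sums -/

/-- `⌊x + y⌋ = ⌊x⌋ + ⌊y⌋ + [1 ≤ {x} + {y}]`. [folklore] -/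
theorem floor_add_eq_ite (x y : ℝ) :
    ⌊x + y⌋ = ⌊x⌋ + ⌊y⌋ + (if 1 ≤ Int.fract x + Int.fract y then 1 else 0) := by
  have hx := Int.floor_add_fract x
  have hy := Int.floor_add_fract y
  have h0x := Int.fract_nonneg x
  have h1x := Int.fract_lt_one x
  have h0y := Int.fract_nonneg y
  have h1y := Int.fract_lt_one y
  split_ifs with h
  · have : x + y = ((⌊x⌋ + ⌊y⌋ + 1 : ℤ) : ℝ) + (Int.fract x + Int.fract y - 1) := by
      push_cast; linarith
    rw [this, Int.floor_intCast_add]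
    suffices h0 : ⌊Int.fract x + Int.fract y - 1⌋ = 0 by rw [h0]; simp
    rw [Int.floor_eq_zero_iff]
    constructor <;> linarith
  · push Not at h
    have : x + y = ((⌊x⌋ + ⌊y⌋ : ℤ) : ℝ) + (Int.fract x + Int.fract y) := by
      push_cast; linarith
    rw [this, Int.floor_intCast_add]
    suffices h0 : ⌊Int.fract x + Int.fract y⌋ = 0 by rw [h0]
    rw [Int.floor_eq_zero_iff]
    constructor <;> linarith

/-! ### D. Sums along arithmetic progressions -/

/-- `∑_{n < D M} g(n) = ∑_{r<D} ∑_{m<M} g(Dm + r)`. [folklore] -/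
theorem sum_range_mul_eq_sum_sum {M' : Type*} [AddCommMonoid M'] (g : ℕ → M') (D M : ℕ) :
    ∑ n ∈ range (D * M), g n = ∑ r ∈ range D, ∑ m ∈ range M, g (D * m + r) := by
  induction M with
  | zero => simp
  | succ M ih =>
    rw [Nat.mul_succ, Finset.sum_range_add, ih]
    have : ∀ r ∈ range D, ∑ m ∈ range (M + 1), g (D * m + r) =
        ∑ m ∈ range M, g (D * m + r) + g (D * M + r) := fun r _ => Finset.sum_range_succ _ _
    rw [Finset.sum_congr rfl this, Finset.sum_add_distrib]

/-- **Splitting a Cesàro estimate along residue classes.** If `‖g‖ ≤ 1` and, for each residue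
`r < D` (`D ≥ 1`), `∑_{m<M} g(Dm + r) = o(M)`, then `∑_{n<N} g(n) = o(N)`. [folklore] -/
theorem isLittleO_sum_range_of_residues {g : ℕ → ℂ} (hg : ∀ n, ‖g n‖ ≤ 1) {D : ℕ} (hD : 0 < D)
    (h : ∀ r, r < D → (fun M : ℕ => ∑ m ∈ range M, g (D * m + r)) =o[atTop] fun M : ℕ => (M : ℝ)) :
    (fun N : ℕ => ∑ n ∈ range N, g n) =o[atTop] fun N : ℕ => (N : ℝ) := by
  rw [isLittleO_iff]
  intro ε hε
  have hD' : (0 : ℝ) < D := by exact_mod_cast hD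
  -- each residue sum is eventually `≤ (ε/2) M`
  have hev : ∀ r ∈ range D, ∀ᶠ M : ℕ in atTop,
      ‖∑ m ∈ range M, g (D * m + r)‖ ≤ ε / 2 * M := by
    intro r hr
    exact eventually_norm_le_of_isLittleO (h r (mem_range.mp hr)) (by positivity)
  have hall := (Finset.eventually_all (range D)).mpr hev
  obtain ⟨M₀, hM₀⟩ := eventually_atTop.mp hall
  -- for `N ≥ D M₀` and `N ≥ 2D/ε`
  obtain ⟨N₁, hN₁⟩ := exists_nat_gt (2 * D / ε)
  refine eventually_atTop.mpr ⟨max (D * M₀) N₁, fun N hN => ?_⟩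
  have hNM : D * M₀ ≤ N := le_trans (le_max_left _ _) hN
  have hNN : N₁ ≤ N := le_trans (le_max_right _ _) hN
  set M := N / D with hM
  set s := N % D with hs
  have hNdecomp : N = D * M + s := (Nat.div_add_mod N D).symm
  have hsD : s < D := Nat.mod_lt N hD
  have hMM₀ : M₀ ≤ M := by
    rw [hM]; exact (Nat.le_div_iff_mul_le hD).mpr (by rw [mul_comm]; exact hNM)
  -- split the sum
  have hsplit : ∑ n ∈ range N, g n = ∑ r ∈ range D, ∑ m ∈ range M, g (D * m + r) +
      ∑ n ∈ Finset.Ico (D * M) N, g n := by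
    rw [← sum_range_mul_eq_sum_sum, Finset.sum_range_add_sum_Ico _ (by omega)]
  rw [hsplit]
  have h1 : ‖∑ r ∈ range D, ∑ m ∈ range M, g (D * m + r)‖ ≤ D * (ε / 2 * M) := by
    calc ‖∑ r ∈ range D, ∑ m ∈ range M, g (D * m + r)‖
        ≤ ∑ r ∈ range D, ‖∑ m ∈ range M, g (D * m + r)‖ := norm_sum_le _ _
      _ ≤ ∑ r ∈ range D, ε / 2 * M := Finset.sum_le_sum fun r hr => hM₀ M hMM₀ r hr
      _ = D * (ε / 2 * M) := by rw [Finset.sum_const, card_range, nsmul_eq_mul]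
  have h2 : ‖∑ n ∈ Finset.Ico (D * M) N, g n‖ ≤ D := by
    calc ‖∑ n ∈ Finset.Ico (D * M) N, g n‖ ≤ ∑ n ∈ Finset.Ico (D * M) N, ‖g n‖ := norm_sum_le _ _
      _ ≤ ∑ n ∈ Finset.Ico (D * M) N, (1 : ℝ) := Finset.sum_le_sum fun n _ => hg n
      _ = ((N - D * M : ℕ) : ℝ) := by simp
      _ = s := by congr 1; omega
      _ ≤ D := by exact_mod_cast hsD.le
  have hDM : (D : ℝ) * M ≤ N := by
    have : D * M ≤ N := by omega
    exact_mod_cast this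
  have hN0 : (2 * D / ε : ℝ) < N := lt_of_lt_of_le hN₁ (by exact_mod_cast hNN)
  have hDle : (D : ℝ) ≤ ε / 2 * N := by
    rw [div_lt_iff₀ hε] at hN0
    linarith
  rw [Real.norm_natCast]
  calc ‖∑ r ∈ range D, ∑ m ∈ range M, g (D * m + r) + ∑ n ∈ Finset.Ico (D * M) N, g n‖
      ≤ D * (ε / 2 * M) + D := (norm_add_le _ _).trans (add_le_add h1 h2)
    _ = ε / 2 * (D * M) + D := by ring
    _ ≤ ε / 2 * N + ε / 2 * N := by gcongr
    _ = ε * N := by ring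

/-! ### D'. Van der Corput's difference theorem in strengthened form -/

section VdC

variable {u : ℕ → ℂ}

/-- **Van der Corput's difference theorem, strengthened form** (the limit form of the fundamental
inequality, Kuipers–Niederreiter Ch. 1, Lemma 3.1 / Thm 3.1): let `‖uₙ‖ ≤ 1`. If for every `η > 0`
there is `h₀` such that for every `h ≥ h₀` the correlation sums satisfy
`‖Σ_{n<N} u_{n+h} \bar uₙ‖ ≤ η N` for all large `N`, then `Σ_{n<N} uₙ = o(N)`. (The tree's
`isLittleO_sum_of_isLittleO_corr` is the case where the correlations are `o(N)`; here they only need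
to be SMALL for large lags, which is what resonant generalized polynomials deliver.)
[cite: KuipersNiederreiter1974, Ch. 1, Lemma 3.1 and Thm 3.1] -/
theorem isLittleO_sum_of_corr_eventually_small (hu : ∀ n, ‖u n‖ ≤ 1)
    (hC : ∀ η : ℝ, 0 < η → ∃ h₀ : ℕ, ∀ h : ℕ, h₀ ≤ h →
      ∀ᶠ N : ℕ in atTop, ‖∑ n ∈ range N, u (n + h) * conj (u n)‖ ≤ η * N) :
    (fun N : ℕ => ∑ n ∈ range N, u n) =o[atTop] fun N : ℕ => (N : ℝ) := by
  rw [isLittleO_iff]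
  intro ε hε
  -- choose `H ≥ 1` with `2/H ≤ ε²/4`
  obtain ⟨H, hH⟩ := exists_nat_gt (8 / ε ^ 2)
  have hε2 : 0 < ε ^ 2 := by positivity
  have hH0 : (0 : ℝ) < H := lt_trans (by positivity) hH
  have hH1 : 1 ≤ H := by exact_mod_cast hH0
  have hHε : 2 / (H : ℝ) ≤ ε ^ 2 / 4 := by
    rw [div_le_iff₀ hH0]
    rw [div_lt_iff₀ hε2] at hH
    nlinarith
  -- choose `h₀` for `η = ε²/8`, and `L = h₀ + 1`
  obtain ⟨h₀, hh₀⟩ := hC (ε ^ 2 / 8) (by positivity)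
  set L : ℕ := h₀ + 1 with hL
  -- the off-diagonal error
  set E : ℕ → ℝ := fun N => ∑ h ∈ range H, ∑ h' ∈ (range H).filter (· ≠ h),
    ‖∑ n ∈ range N, u (n + (h - h' + (h' - h)) * L) * conj (u n)‖ with hE
  have hEev : ∀ᶠ N : ℕ in atTop, E N ≤ ε ^ 2 * H ^ 2 / 8 * N := by
    have hpair : ∀ h ∈ range H, ∀ᶠ N : ℕ in atTop, ∀ h' ∈ (range H).filter (· ≠ h),
        ‖∑ n ∈ range N, u (n + (h - h' + (h' - h)) * L) * conj (u n)‖ ≤ ε ^ 2 / 8 * N := by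
      intro h _
      refine (Finset.eventually_all _).mpr fun h' hh' => ?_
      have hne : h' ≠ h := (Finset.mem_filter.1 hh').2
      have hlag : h₀ ≤ (h - h' + (h' - h)) * L := by
        have hd : 1 ≤ h - h' + (h' - h) := by omega
        calc h₀ ≤ L := by omega
          _ = 1 * L := (one_mul L).symm
          _ ≤ (h - h' + (h' - h)) * L := Nat.mul_le_mul_right L hd
      exact hh₀ _ hlag
    have hall := (Finset.eventually_all _).mpr hpair
    filter_upwards [hall] with N hN
    calc E N ≤ ∑ h ∈ range H, ∑ h' ∈ (range H).filter (· ≠ h), ε ^ 2 / 8 * (N : ℝ) := by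
          refine Finset.sum_le_sum fun h hh => Finset.sum_le_sum fun h' hh' => hN h hh h' hh'
      _ ≤ ∑ h ∈ range H, ∑ h' ∈ range H, ε ^ 2 / 8 * (N : ℝ) := by
          refine Finset.sum_le_sum fun h hh => ?_
          exact Finset.sum_le_sum_of_subset_of_nonneg (Finset.filter_subset _ _)
            fun _ _ _ => by positivity
      _ = ε ^ 2 * H ^ 2 / 8 * N := by
          rw [Finset.sum_const, Finset.sum_const, card_range, nsmul_eq_mul, nsmul_eq_mul]; ring
  -- the remaining terms are `O(1)·(1/N)`-small
  have hsmall : ∀ᶠ N : ℕ in atTop, 8 * (H : ℝ) ^ 2 * L ^ 2 + 4 * H * L * N ≤ ε ^ 2 / 4 * N ^ 2 := by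
    have h1 : Tendsto (fun N : ℕ => (8 * (H : ℝ) ^ 2 * L ^ 2) / (N : ℝ) ^ 2 + (4 * H * L) / (N : ℝ))
        atTop (𝓝 (0 + 0)) := by
      refine Tendsto.add ?_ ?_
      · exact tendsto_const_nhds.div_atTop
          ((tendsto_pow_atTop two_ne_zero).comp tendsto_natCast_atTop_atTop)
      · exact tendsto_const_nhds.div_atTop tendsto_natCast_atTop_atTop
    rw [add_zero] at h1
    have h2 := (tendsto_order.1 h1).2 (ε ^ 2 / 4) (by positivity)
    filter_upwards [h2, eventually_gt_atTop 0] with N hN hN0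
    have hN0' : (0 : ℝ) < N := by exact_mod_cast hN0
    have hN2 : (0 : ℝ) < (N : ℝ) ^ 2 := by positivity
    have h' : (8 * (H : ℝ) ^ 2 * L ^ 2 + 4 * H * L * N) / (N : ℝ) ^ 2 < ε ^ 2 / 4 := by
      rw [add_div, show 4 * (H : ℝ) * L * N / (N : ℝ) ^ 2 = 4 * H * L / N by
        field_simp]
      exact hN
    rw [div_lt_iff₀ hN2] at h'
    exact h'.le
  filter_upwards [hEev, hsmall, eventually_gt_atTop 0] with N hEN hsN hN0
  have hN0' : (0 : ℝ) < N := by exact_mod_cast hN0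
  rw [Real.norm_natCast]
  have key := norm_sum_sq_le_vdC hu N L hH1
  have hsq : ‖∑ n ∈ range N, u n‖ ^ 2 ≤ (ε * N) ^ 2 := by
    have hmain : 2 * (N : ℝ) / H ^ 2 * (H * N + E N + 2 * H ^ 3 * L) =
        2 / H * N ^ 2 + 2 * N / H ^ 2 * E N + 4 * H * L * N := by
      field_simp
      ring
    rw [hmain] at key
    have hA : 2 / (H : ℝ) * N ^ 2 ≤ ε ^ 2 / 4 * N ^ 2 := by gcongr
    have hB : 2 * (N : ℝ) / H ^ 2 * E N ≤ ε ^ 2 / 4 * N ^ 2 := by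
      calc 2 * (N : ℝ) / H ^ 2 * E N ≤ 2 * (N : ℝ) / H ^ 2 * (ε ^ 2 * H ^ 2 / 8 * N) := by
            gcongr
        _ = ε ^ 2 / 4 * N ^ 2 := by field_simp; ring
    nlinarith
  exact (pow_le_pow_iff_left₀ (norm_nonneg _) (by positivity) two_ne_zero).1 hsq

/-- The strengthened difference theorem for phases: if `x : ℕ → ℝ` and for every `η > 0` there is
`h₀` with `‖Σ_{n<N} e(x_{n+h} − xₙ)‖ ≤ ηN` for all `h ≥ h₀` and all large `N`, then
`Σ_{n<N} e(xₙ) = o(N)`. [cite: KuipersNiederreiter1974, Ch. 1, Thm 3.1] -/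
theorem isLittleO_sum_e_of_corr_eventually_small {x : ℕ → ℝ}
    (hC : ∀ η : ℝ, 0 < η → ∃ h₀ : ℕ, ∀ h : ℕ, h₀ ≤ h →
      ∀ᶠ N : ℕ in atTop,
        ‖∑ n ∈ range N, Complex.exp (2 * Real.pi * Complex.I * ((x (n + h) - x n : ℝ) : ℂ))‖ ≤
          η * N) :
    (fun N : ℕ => ∑ n ∈ range N, Complex.exp (2 * Real.pi * Complex.I * ((x n : ℝ) : ℂ)))
      =o[atTop] fun N : ℕ => (N : ℝ) := by
  have hu1 : ∀ n, ‖Complex.exp (2 * Real.pi * Complex.I * ((x n : ℝ) : ℂ))‖ ≤ 1 := fun n => by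
    rw [Complex.norm_exp]; simp
  refine isLittleO_sum_of_corr_eventually_small hu1 fun η hη => ?_
  obtain ⟨h₀, hh₀⟩ := hC η hη
  refine ⟨h₀, fun h hh => ?_⟩
  refine (hh₀ h hh).congr (Eventually.of_forall fun N => ?_)
  -- pointwise identity `e(a) conj e(b) = e(a - b)`
  have : ∀ n, Complex.exp (2 * Real.pi * Complex.I * ((x (n + h) : ℝ) : ℂ)) *
      conj (Complex.exp (2 * Real.pi * Complex.I * ((x n : ℝ) : ℂ))) =
      Complex.exp (2 * Real.pi * Complex.I * ((x (n + h) - x n : ℝ) : ℂ)) := by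
    intro n
    rw [← Complex.exp_conj, ← Complex.exp_add]
    congr 1
    simp only [map_mul, map_ofNat, Complex.conj_ofReal, Complex.conj_I]
    push_cast
    ring
  simp only [this]

end VdC

/-! ### E. The correlation identity for `q(n) = γ⌊αn⌋⌊βn⌋` -/

/-- `⌊α(n+h)⌋ = ⌊αn⌋ + ⌊αh⌋ + εₙ` with `εₙ = [1 ≤ {αh} + {αn}] ∈ {0, 1}`. [folklore] -/
theorem floor_mul_add_eq (α : ℝ) (n h : ℕ) :
    ⌊α * (n + h : ℕ)⌋ = ⌊α * n⌋ + ⌊α * h⌋ +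
      ((if 1 ≤ Int.fract (α * h) + Int.fract (α * n) then 1 else 0 : ℕ) : ℤ) := by
  rw [show α * (n + h : ℕ) = α * n + α * h by push_cast; ring, floor_add_eq_ite]
  rw [add_comm (Int.fract (α * n))]
  split_ifs <;> simp

/-- **The correlation identity, core form.** With `a = ⌊αh⌋`, `b = ⌊βh⌋`, `εₙ, δₙ ∈ {0,1}` the carries
of `⌊α(n+h)⌋ = ⌊αn⌋ + a + εₙ`, `⌊β(n+h)⌋ = ⌊βn⌋ + b + δₙ`, one has, for `q(n) = γ⌊αn⌋⌊βn⌋`,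
`e(q(n+h) − q(n)) = e(γ(a+εₙ)(b+δₙ)) · e(γ((b+δₙ)α + (a+εₙ)β)·n) · e(−γ(b+δₙ){αn}) · e(−γ(a+εₙ){βn})`
(expand `(⌊αn⌋+a+ε)(⌊βn⌋+b+δ) − ⌊αn⌋⌊βn⌋` and write `⌊αn⌋ = αn − {αn}`). This is the computation
behind Håland's `q_h(n) = V_h q(n) + …` (Håland 1994, §2, p. 15). [cite: Haland1994, §2] -/
theorem e_corr_eq_of_carries (α β γ : ℝ) (n h : ℕ) (ε δ : ℕ)
    (hε : ⌊α * (n + h : ℕ)⌋ = ⌊α * n⌋ + ⌊α * h⌋ + ε)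
    (hδ : ⌊β * (n + h : ℕ)⌋ = ⌊β * n⌋ + ⌊β * h⌋ + δ) :
    cexp (2 * π * I * ((⌊α * (n + h : ℕ)⌋ * ⌊β * (n + h : ℕ)⌋ * γ - ⌊α * n⌋ * ⌊β * n⌋ * γ : ℝ) : ℂ)) =
      cexp (2 * π * I * ((γ * (⌊α * h⌋ + ε) * (⌊β * h⌋ + δ) : ℝ) : ℂ)) *
      cexp (2 * π * I * ((γ * ((⌊β * h⌋ + δ) * α + (⌊α * h⌋ + ε) * β) * n : ℝ) : ℂ)) *
      cexp (2 * π * I * ((-(γ * (⌊β * h⌋ + δ)) * Int.fract (α * n) : ℝ) : ℂ)) *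
      cexp (2 * π * I * ((-(γ * (⌊α * h⌋ + ε)) * Int.fract (β * n) : ℝ) : ℂ)) := by
  rw [← e_add, ← e_add, ← e_add]
  have hu : (⌊α * n⌋ : ℝ) = α * n - Int.fract (α * n) := by rw [Int.fract]; ring
  have hv : (⌊β * n⌋ : ℝ) = β * n - Int.fract (β * n) := by rw [Int.fract]; ring
  have hε' : (⌊α * (n + h : ℕ)⌋ : ℝ) = ⌊α * n⌋ + ⌊α * h⌋ + ε := by exact_mod_cast hε
  have hδ' : (⌊β * (n + h : ℕ)⌋ : ℝ) = ⌊β * n⌋ + ⌊β * h⌋ + δ := by exact_mod_cast hδ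
  have key : (⌊α * (n + h : ℕ)⌋ * ⌊β * (n + h : ℕ)⌋ * γ - ⌊α * n⌋ * ⌊β * n⌋ * γ : ℝ) =
      γ * (⌊α * h⌋ + ε) * (⌊β * h⌋ + δ) + γ * ((⌊β * h⌋ + δ) * α + (⌊α * h⌋ + ε) * β) * n +
      (-(γ * (⌊β * h⌋ + δ)) * Int.fract (α * n)) + (-(γ * (⌊α * h⌋ + ε)) * Int.fract (β * n)) := by
    rw [hε', hδ', hu, hv]; ring
  rw [key]
  push_cast
  ring_nf

/-- **The correlation identity, piece decomposition.** For `q(n) = γ⌊αn⌋⌊βn⌋` and a shift `h`,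
`e(q(n+h) − q(n))` is the sum over the four pieces `(i, j) ∈ {0,1}²` of
`C_{ij} · e(λ_{ij} n) · f¹_{ij}({αn}) · f²_{ij}({βn})`, where `λ_{ij} = γ((⌊βh⌋+j)α + (⌊αh⌋+i)β)`,
`f¹_{ij}(u) = 𝟙[(1 ≤ {αh}+u) ↔ i = 1]·e(−γ(⌊βh⌋+j)u)`, `f²_{ij}(v) = 𝟙[(1 ≤ {βh}+v) ↔ j = 1]·e(−γ(⌊αh⌋+i)v)`
and `|C_{ij}| = 1`. [cite: Haland1994, §2] -/
theorem e_corr_eq_sum_pieces (α β γ : ℝ) (n h : ℕ) :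
    cexp (2 * π * I * ((⌊α * (n + h : ℕ)⌋ * ⌊β * (n + h : ℕ)⌋ * γ - ⌊α * n⌋ * ⌊β * n⌋ * γ : ℝ) : ℂ)) =
      ∑ p ∈ ({0, 1} ×ˢ {0, 1} : Finset (ℕ × ℕ)),
        cexp (2 * π * I * ((γ * (⌊α * h⌋ + p.1) * (⌊β * h⌋ + p.2) : ℝ) : ℂ)) *
        cexp (2 * π * I * ((γ * ((⌊β * h⌋ + p.2) * α + (⌊α * h⌋ + p.1) * β) * n : ℝ) : ℂ)) *
        ((if (1 ≤ Int.fract (α * h) + Int.fract (α * n) ↔ p.1 = 1) then 1 else 0) *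
          cexp (2 * π * I * ((-(γ * (⌊β * h⌋ + p.2)) * Int.fract (α * n) : ℝ) : ℂ))) *
        ((if (1 ≤ Int.fract (β * h) + Int.fract (β * n) ↔ p.2 = 1) then 1 else 0) *
          cexp (2 * π * I * ((-(γ * (⌊α * h⌋ + p.1)) * Int.fract (β * n) : ℝ) : ℂ))) := by
  have hA := floor_mul_add_eq α n h
  have hB := floor_mul_add_eq β n h
  rw [Finset.sum_product]
  simp only [Finset.sum_pair (show (0 : ℕ) ≠ 1 by norm_num)]
  by_cases hP : 1 ≤ Int.fract (α * h) + Int.fract (α * n) <;>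
    by_cases hQ : 1 ≤ Int.fract (β * h) + Int.fract (β * n) <;>
    simp only [hP, hQ, if_true, if_false] at hA hB ⊢ <;>
    · rw [e_corr_eq_of_carries α β γ n h _ _ hA hB]
      push_cast
      simp

/-- **Norm form of the correlation identity**: summing over `n < N` and using `|C_{ij}| = 1`,
`‖Σ_{n<N} e(q(n+h) − q(n))‖ ≤ Σ_{(i,j) ∈ {0,1}²} ‖Σ_{n<N} e(λ_{ij} n) f¹_{ij}({αn}) f²_{ij}({βn})‖`.
[cite: Haland1994, §2] -/
theorem norm_sum_e_corr_le (α β γ : ℝ) (h N : ℕ) :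
    ‖∑ n ∈ range N, cexp (2 * π * I *
        ((⌊α * (n + h : ℕ)⌋ * ⌊β * (n + h : ℕ)⌋ * γ - ⌊α * n⌋ * ⌊β * n⌋ * γ : ℝ) : ℂ))‖ ≤
      ∑ p ∈ ({0, 1} ×ˢ {0, 1} : Finset (ℕ × ℕ)),
        ‖∑ n ∈ range N,
          cexp (2 * π * I * ((γ * ((⌊β * h⌋ + p.2) * α + (⌊α * h⌋ + p.1) * β) * n : ℝ) : ℂ)) *
          ((if (1 ≤ Int.fract (α * h) + Int.fract (α * n) ↔ p.1 = 1) then 1 else 0) *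
            cexp (2 * π * I * ((-(γ * (⌊β * h⌋ + p.2)) * Int.fract (α * n) : ℝ) : ℂ))) *
          ((if (1 ≤ Int.fract (β * h) + Int.fract (β * n) ↔ p.2 = 1) then 1 else 0) *
            cexp (2 * π * I * ((-(γ * (⌊α * h⌋ + p.1)) * Int.fract (β * n) : ℝ) : ℂ)))‖ := by
  simp_rw [e_corr_eq_sum_pieces α β γ _ h]
  rw [Finset.sum_comm]
  refine (norm_sum_le _ _).trans (Finset.sum_le_sum fun p _ => ?_)
  have hre : ∀ n : ℕ,
      cexp (2 * π * I * ((γ * (⌊α * h⌋ + p.1) * (⌊β * h⌋ + p.2) : ℝ) : ℂ)) *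
        cexp (2 * π * I * ((γ * ((⌊β * h⌋ + p.2) * α + (⌊α * h⌋ + p.1) * β) * n : ℝ) : ℂ)) *
        ((if (1 ≤ Int.fract (α * h) + Int.fract (α * n) ↔ p.1 = 1) then 1 else 0) *
          cexp (2 * π * I * ((-(γ * (⌊β * h⌋ + p.2)) * Int.fract (α * n) : ℝ) : ℂ))) *
        ((if (1 ≤ Int.fract (β * h) + Int.fract (β * n) ↔ p.2 = 1) then 1 else 0) *
          cexp (2 * π * I * ((-(γ * (⌊α * h⌋ + p.1)) * Int.fract (β * n) : ℝ) : ℂ))) =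
      cexp (2 * π * I * ((γ * (⌊α * h⌋ + p.1) * (⌊β * h⌋ + p.2) : ℝ) : ℂ)) *
        (cexp (2 * π * I * ((γ * ((⌊β * h⌋ + p.2) * α + (⌊α * h⌋ + p.1) * β) * n : ℝ) : ℂ)) *
        ((if (1 ≤ Int.fract (α * h) + Int.fract (α * n) ↔ p.1 = 1) then 1 else 0) *
          cexp (2 * π * I * ((-(γ * (⌊β * h⌋ + p.2)) * Int.fract (α * n) : ℝ) : ℂ))) *
        ((if (1 ≤ Int.fract (β * h) + Int.fract (β * n) ↔ p.2 = 1) then 1 else 0) *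
          cexp (2 * π * I * ((-(γ * (⌊α * h⌋ + p.1)) * Int.fract (β * n) : ℝ) : ℂ)))) :=
    fun n => by ring
  rw [Finset.sum_congr rfl fun n _ => hre n, ← Finset.mul_sum, norm_mul]
  have h1 : ‖cexp (2 * π * I * ((γ * (⌊α * h⌋ + p.1) * (⌊β * h⌋ + p.2) : ℝ) : ℂ))‖ = 1 := by
    rw [show (2 * π * I * ((γ * (⌊α * h⌋ + p.1) * (⌊β * h⌋ + p.2) : ℝ) : ℂ)) =
      ((2 * π * (γ * (⌊α * h⌋ + p.1) * (⌊β * h⌋ + p.2)) : ℝ) : ℂ) * I by push_cast; ring]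
    exact Complex.norm_exp_ofReal_mul_I _
  rw [h1, one_mul]

/-! ### F. Oscillatory integrals of piecewise-exponential functions -/

/-- `∫_a^b c·e(ωy) dy` has norm at most `1/(π|ω|)` when `‖c‖ ≤ 1`, `ω ≠ 0`. [folklore] -/
theorem norm_integral_const_mul_e_le {a b ω : ℝ} (hω : ω ≠ 0) {c : ℂ} (hc : ‖c‖ ≤ 1) :
    ‖∫ y in a..b, c * cexp (2 * π * I * ((ω * y : ℝ) : ℂ))‖ ≤ 1 / (π * |ω|) := by
  have hπ := Real.pi_pos
  set C : ℂ := 2 * π * I * ω with hC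
  have hC0 : C ≠ 0 := by
    rw [hC]
    refine mul_ne_zero (mul_ne_zero (mul_ne_zero two_ne_zero ?_) Complex.I_ne_zero) ?_
    · exact_mod_cast Real.pi_ne_zero
    · exact_mod_cast hω
  have hrw : (fun y : ℝ => c * cexp (2 * π * I * ((ω * y : ℝ) : ℂ))) =
      fun y : ℝ => c * cexp (C * y) := by
    funext y; rw [hC]; push_cast; ring_nf
  rw [hrw, intervalIntegral.integral_const_mul, integral_exp_mul_complex hC0, norm_mul]
  have hnC : ‖C‖ = 2 * π * |ω| := by
    rw [hC, norm_mul, norm_mul, norm_mul, Complex.norm_I, Complex.norm_real, Complex.norm_two,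
      Complex.norm_real, Real.norm_of_nonneg hπ.le, Real.norm_eq_abs]
    ring
  have he : ∀ t : ℝ, ‖cexp (C * t)‖ = 1 := fun t => by
    rw [hC, show (2 * π * I * ω * t : ℂ) = ((2 * π * ω * t : ℝ) : ℂ) * I by push_cast; ring]
    exact Complex.norm_exp_ofReal_mul_I _
  have hnum : ‖cexp (C * b) - cexp (C * a)‖ ≤ 2 := by
    calc ‖cexp (C * b) - cexp (C * a)‖ ≤ ‖cexp (C * b)‖ + ‖cexp (C * a)‖ := norm_sub_le _ _
      _ = 2 := by rw [he, he]; norm_num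
  rw [norm_div, hnC]
  have hden : 0 < 2 * π * |ω| := by positivity
  calc ‖c‖ * (‖cexp (C * b) - cexp (C * a)‖ / (2 * π * |ω|))
      ≤ 1 * (2 / (2 * π * |ω|)) := by gcongr
    _ = 1 / (π * |ω|) := by field_simp

/-- **Oscillatory integral of a piecewise exponential.** Let `F : ℝ → ℂ`, `‖F‖ ≤ 1`, be interval
integrable on `[0, 1]`, and suppose that off a finite set `T` the function `F·e(−ω·)` is locally
constant on `[0, 1]` (i.e. `F` is, piece by piece, a constant multiple of `e(ωy)`). Then for
`ω ≠ 0`, `‖∫₀¹ F‖ ≤ (|T| + 1)/(π|ω|)`: sort `T ∪ {0, 1}`, on each of the at most `|T| + 1` gaps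
`F = c·e(ω·)` with `|c| ≤ 1`, and `|∫ c·e(ωy) dy| ≤ 1/(π|ω|)`. [folklore] -/
theorem norm_integral_le_of_locally_e {F : ℝ → ℂ} {ω : ℝ} (hω : ω ≠ 0) (T : Finset ℝ)
    (hF1 : ∀ x, ‖F x‖ ≤ 1) (hFi : IntervalIntegrable F volume 0 1)
    (hloc : ∀ x ∈ Set.Icc (0 : ℝ) 1, x ∉ T →
      ∀ᶠ y in 𝓝 x, F y * cexp (2 * π * I * ((-(ω * y) : ℝ) : ℂ)) =
        F x * cexp (2 * π * I * ((-(ω * x) : ℝ) : ℂ))) :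
    ‖∫ x in (0 : ℝ)..1, F x‖ ≤ (T.card + 1) / (π * |ω|) := by
  have hπ := Real.pi_pos
  classical
  -- the partition points
  set S : Finset ℝ := insert 0 (insert 1 (T.filter fun x => 0 < x ∧ x < 1)) with hSdef
  have hS0 : (0 : ℝ) ∈ S := by simp [hSdef]
  have hS1 : (1 : ℝ) ∈ S := by simp [hSdef]
  have hSmem : ∀ x ∈ S, 0 ≤ x ∧ x ≤ 1 := by
    intro x hx
    simp only [hSdef, Finset.mem_insert, Finset.mem_filter] at hx
    rcases hx with rfl | rfl | ⟨_, h1, h2⟩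
    · exact ⟨le_rfl, zero_le_one⟩
    · exact ⟨zero_le_one, le_rfl⟩
    · exact ⟨h1.le, h2.le⟩
  have hScard : S.card ≤ T.card + 2 := by
    calc S.card ≤ (insert 1 (T.filter fun x => 0 < x ∧ x < 1)).card + 1 := Finset.card_insert_le _ _
      _ ≤ (T.filter fun x => 0 < x ∧ x < 1).card + 1 + 1 := by
          gcongr; exact Finset.card_insert_le _ _
      _ ≤ T.card + 2 := by
          have := Finset.card_filter_le T (fun x => 0 < x ∧ x < 1); omega
  have hSne : S.Nonempty := ⟨0, hS0⟩
  set m : ℕ := S.card with hm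
  have hm2 : 2 ≤ m := by
    rw [hm]
    have : ({0, 1} : Finset ℝ) ⊆ S := by
      intro x hx; simp only [Finset.mem_insert, Finset.mem_singleton] at hx
      rcases hx with rfl | rfl
      · exact hS0
      · exact hS1
    have h2 : ({0, 1} : Finset ℝ).card = 2 := by simp
    rw [← h2]; exact Finset.card_le_card this
  have hmin : S.min' hSne = 0 :=
    le_antisymm (Finset.min'_le S 0 hS0) (Finset.le_min' S hSne 0 fun x hx => (hSmem x hx).1)
  have hmax : S.max' hSne = 1 :=
    le_antisymm (Finset.max'_le S hSne 1 fun x hx => (hSmem x hx).2) (Finset.le_max' S 1 hS1)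
  set p : Fin m ≃o (S : Set ℝ) := S.orderIsoOfFin hm.symm with hp
  -- the sequence of points `a i`
  set a : ℕ → ℝ := fun i => if hi : i < m then (p ⟨i, hi⟩ : ℝ) else 1 with ha
  have ha_mem : ∀ i (hi : i < m), a i ∈ S := by
    intro i hi; simp only [ha, hi, dif_pos]; exact (p ⟨i, hi⟩).2
  have ha0 : a 0 = 0 := by
    have h0 : 0 < m := by omega
    simp only [ha, h0, dif_pos]
    rw [hp, Finset.coe_orderIsoOfFin_apply, Finset.orderEmbOfFin_zero _ h0, hmin]
  have halast : a (m - 1) = 1 := by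
    have h0 : 0 < m := by omega
    have h1 : m - 1 < m := by omega
    simp only [ha, h1, dif_pos]
    rw [hp, Finset.coe_orderIsoOfFin_apply, Finset.orderEmbOfFin_last _ h0, hmax]
  have ha_mono : ∀ i j (hi : i < m) (hj : j < m), i < j → a i < a j := by
    intro i j hi hj hij
    simp only [ha, hi, hj, dif_pos]
    have : (⟨i, hi⟩ : Fin m) < ⟨j, hj⟩ := hij
    exact_mod_cast (p.lt_iff_lt.mpr this)
  have ha_le : ∀ i, i + 1 < m → a i ≤ a (i + 1) := fun i hi =>
    (ha_mono i (i + 1) (by omega) hi (by omega)).le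
  have ha_bounds : ∀ i (hi : i < m), 0 ≤ a i ∧ a i ≤ 1 := fun i hi => hSmem _ (ha_mem i hi)
  -- no point of `S` strictly between consecutive points
  have hgap : ∀ i, i + 1 < m → ∀ y, a i < y → y < a (i + 1) → y ∉ S := by
    intro i hi y hy1 hy2 hyS
    obtain ⟨j, hj⟩ := p.surjective ⟨y, hyS⟩
    have hjy : (p j : ℝ) = y := by rw [hj]
    have hii : i < m := by omega
    have h1 : (p ⟨i, hii⟩ : ℝ) < p j := by
      rw [hjy]; simpa [ha, hii] using hy1
    have h2 : (p j : ℝ) < p ⟨i + 1, hi⟩ := by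
      rw [hjy]; simpa [ha, hi] using hy2
    have h1' : (⟨i, hii⟩ : Fin m) < j := p.lt_iff_lt.mp (by exact_mod_cast h1)
    have h2' : j < ⟨i + 1, hi⟩ := p.lt_iff_lt.mp (by exact_mod_cast h2)
    have := Fin.lt_def.mp h1'
    have := Fin.lt_def.mp h2'
    simp at *
    omega
  -- on each gap, `F = c · e(ω ·)`
  have hpiece : ∀ i, i + 1 < m → ∃ c : ℂ, ‖c‖ ≤ 1 ∧
      ∀ y ∈ Set.Ioo (a i) (a (i + 1)), F y = c * cexp (2 * π * I * ((ω * y : ℝ) : ℂ)) := by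
    intro i hi
    have hii : i < m := by omega
    set G : ℝ → ℂ := fun y => F y * cexp (2 * π * I * ((-(ω * y) : ℝ) : ℂ)) with hG
    -- `G` restricted to the open gap is locally constant
    have hIoo_sub : ∀ y ∈ Set.Ioo (a i) (a (i + 1)), y ∈ Set.Icc (0 : ℝ) 1 ∧ y ∉ T := by
      intro y hy
      have hy0 : 0 ≤ y := (ha_bounds i hii).1.trans hy.1.le
      have hy1 : y ≤ 1 := hy.2.le.trans (ha_bounds (i + 1) hi).2
      refine ⟨⟨hy0, hy1⟩, fun hyT => ?_⟩
      have hyS : y ∈ S := by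
        have h0 : 0 < y := lt_of_le_of_lt (ha_bounds i hii).1 hy.1
        have h1 : y < 1 := lt_of_lt_of_le hy.2 (ha_bounds (i + 1) hi).2
        simp only [hSdef, Finset.mem_insert, Finset.mem_filter]
        exact Or.inr (Or.inr ⟨hyT, h0, h1⟩)
      exact hgap i hi y hy.1 hy.2 hyS
    haveI : PreconnectedSpace (Set.Ioo (a i) (a (i + 1))) :=
      Subtype.preconnectedSpace isPreconnected_Ioo
    have hlc : IsLocallyConstant (fun y : Set.Ioo (a i) (a (i + 1)) => G y) := by
      rw [IsLocallyConstant.iff_eventually_eq]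
      intro y
      obtain ⟨hy1, hy2⟩ := hIoo_sub y y.2
      have h := hloc y hy1 hy2
      exact (continuous_subtype_val.tendsto y).eventually h
    set mid : ℝ := (a i + a (i + 1)) / 2 with hmid
    have hmid_mem : mid ∈ Set.Ioo (a i) (a (i + 1)) := by
      have := ha_mono i (i + 1) hii hi (by omega)
      constructor <;> · rw [hmid]; linarith
    refine ⟨G mid, ?_, fun y hy => ?_⟩
    · rw [hG, norm_mul]
      have : ‖cexp (2 * π * I * ((-(ω * mid) : ℝ) : ℂ))‖ = 1 := by
        rw [show (2 * π * I * ((-(ω * mid) : ℝ) : ℂ)) = ((2 * π * (-(ω * mid)) : ℝ) : ℂ) * I by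
          push_cast; ring]
        exact Complex.norm_exp_ofReal_mul_I _
      rw [this, mul_one]; exact hF1 mid
    · have heq : G y = G mid := by
        have := congrFun (hlc.eq_const ⟨mid, hmid_mem⟩) ⟨y, hy⟩
        simpa using this
      have hGy : G y = F y * cexp (2 * π * I * ((-(ω * y) : ℝ) : ℂ)) := rfl
      rw [← heq, hGy, mul_assoc, ← Complex.exp_add]
      rw [show (2 * π * I * ((-(ω * y) : ℝ) : ℂ) + 2 * π * I * ((ω * y : ℝ) : ℂ)) = 0 by
        push_cast; ring, Complex.exp_zero, mul_one]
  -- each piece integral is small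
  have hint_piece : ∀ i, i + 1 < m → ‖∫ y in a i..a (i + 1), F y‖ ≤ 1 / (π * |ω|) := by
    intro i hi
    obtain ⟨c, hc, hFc⟩ := hpiece i hi
    have heq : ∫ y in a i..a (i + 1), F y =
        ∫ y in a i..a (i + 1), c * cexp (2 * π * I * ((ω * y : ℝ) : ℂ)) := by
      refine intervalIntegral.integral_congr_ae ?_
      have hae : ∀ᵐ y : ℝ ∂volume, y ∉ ({a (i + 1)} : Set ℝ) :=
        (Set.countable_singleton _).ae_notMem _
      filter_upwards [hae] with y hy hyI
      rw [Set.uIoc_of_le (ha_le i hi)] at hyI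
      have hy' : y ∈ Set.Ioo (a i) (a (i + 1)) :=
        ⟨hyI.1, lt_of_le_of_ne hyI.2 (by simpa using hy)⟩
      exact hFc y hy'
    rw [heq]
    exact norm_integral_const_mul_e_le hω hc
  -- assemble
  have hsum : ∫ x in (0 : ℝ)..1, F x = ∑ i ∈ range (m - 1), ∫ y in a i..a (i + 1), F y := by
    rw [intervalIntegral.sum_integral_adjacent_intervals, ha0, halast]
    intro k hk
    refine hFi.mono_set ?_
    rw [Set.uIcc_of_le zero_le_one, Set.uIcc_of_le (ha_le k (by omega))]
    exact Set.Icc_subset_Icc (ha_bounds k (by omega)).1 (ha_bounds (k + 1) (by omega)).2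
  rw [hsum]
  calc ‖∑ i ∈ range (m - 1), ∫ y in a i..a (i + 1), F y‖
      ≤ ∑ i ∈ range (m - 1), ‖∫ y in a i..a (i + 1), F y‖ := norm_sum_le _ _
    _ ≤ ∑ i ∈ range (m - 1), 1 / (π * |ω|) :=
        Finset.sum_le_sum fun i hi => hint_piece i (by have := mem_range.mp hi; omega)
    _ = (m - 1 : ℕ) * (1 / (π * |ω|)) := by rw [Finset.sum_const, card_range, nsmul_eq_mul]
    _ ≤ (T.card + 1 : ℝ) * (1 / (π * |ω|)) := by
        gcongr
        have : m - 1 ≤ T.card + 1 := by omega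
        exact_mod_cast this
    _ = (T.card + 1) / (π * |ω|) := by ring

/-! ### G. Approximation of piecewise-exponential functions by trigonometric polynomials -/

/-- `1 − ∏ xᵢ ≤ ∑ (1 − xᵢ)` for `xᵢ ∈ [0, 1]`. [folklore] -/
theorem one_sub_prod_le_sum {ι : Type*} (s : Finset ι) (x : ι → ℝ)
    (h0 : ∀ i ∈ s, 0 ≤ x i) (h1 : ∀ i ∈ s, x i ≤ 1) :
    1 - ∏ i ∈ s, x i ≤ ∑ i ∈ s, (1 - x i) := by
  classical
  induction s using Finset.induction_on with
  | empty => simp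
  | insert a s ha ih =>
    rw [Finset.prod_insert ha, Finset.sum_insert ha]
    have h0' : ∀ i ∈ s, 0 ≤ x i := fun i hi => h0 i (Finset.mem_insert_of_mem hi)
    have h1' : ∀ i ∈ s, x i ≤ 1 := fun i hi => h1 i (Finset.mem_insert_of_mem hi)
    have hih := ih h0' h1'
    have hxa0 := h0 a (Finset.mem_insert_self a s)
    have hxa1 := h1 a (Finset.mem_insert_self a s)
    have hP0 : 0 ≤ ∏ i ∈ s, x i := Finset.prod_nonneg h0'
    have hP1 : ∏ i ∈ s, x i ≤ 1 := Finset.prod_le_one h0' h1'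
    nlinarith

/-- `∫₀¹ e(jx) dx = [j = 0]` for an integer `j`. [folklore] -/
theorem integral_e_int_mul (j : ℤ) :
    ∫ x in (0 : ℝ)..1, cexp (2 * π * I * (((j : ℝ) * x : ℝ) : ℂ)) = if j = 0 then 1 else 0 := by
  split_ifs with hj
  · subst hj; simp
  · set c : ℂ := 2 * π * I * j with hc
    have hc0 : c ≠ 0 := by
      rw [hc]
      refine mul_ne_zero (mul_ne_zero (mul_ne_zero two_ne_zero ?_) Complex.I_ne_zero) ?_
      · exact_mod_cast Real.pi_ne_zero
      · exact_mod_cast hj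
    have hrw : (fun x : ℝ => cexp (2 * π * I * (((j : ℝ) * x : ℝ) : ℂ))) =
        fun x : ℝ => cexp (c * x) := by
      funext x; rw [hc]; push_cast; ring_nf
    rw [hrw, integral_exp_mul_complex hc0]
    have h1 : cexp c = 1 := by rw [hc]; exact e_int j
    simp [h1]

/-- The `k`-th Fourier coefficient of the trigonometric polynomial `∑_{k' ∈ s} c_{k'} e(k'x)` on
`[0, 1]` is `c_k` (or `0` if `k ∉ s`). [folklore] -/
theorem integral_trigPoly_mul_e_neg (s : Finset ℤ) (c : ℤ → ℂ) (k : ℤ) :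
    ∫ x in (0 : ℝ)..1, (∑ k' ∈ s, c k' * cexp (2 * π * I * (((k' : ℝ) * x : ℝ) : ℂ))) *
        cexp (2 * π * I * ((-((k : ℝ) * x) : ℝ) : ℂ)) = if k ∈ s then c k else 0 := by
  classical
  have hterm : ∀ x : ℝ, (∑ k' ∈ s, c k' * cexp (2 * π * I * (((k' : ℝ) * x : ℝ) : ℂ))) *
      cexp (2 * π * I * ((-((k : ℝ) * x) : ℝ) : ℂ)) =
      ∑ k' ∈ s, c k' * cexp (2 * π * I * ((((k' - k : ℤ) : ℝ) * x : ℝ) : ℂ)) := by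
    intro x
    rw [Finset.sum_mul]
    refine Finset.sum_congr rfl fun k' _ => ?_
    rw [mul_assoc, ← e_add]
    congr 2; push_cast; ring
  simp_rw [hterm]
  rw [intervalIntegral.integral_finsetSum]
  · simp_rw [intervalIntegral.integral_const_mul, integral_e_int_mul, sub_eq_zero]
    simp [Finset.sum_ite_eq']
  · intro k' _
    exact (Continuous.intervalIntegrable (by fun_prop) _ _)

/-- `∫₀¹ 𝟙_{[c-r, c+r]} ≤ 2r` for `r ≥ 0`. [folklore] -/
theorem integral_indicator_Icc_le (c : ℝ) {r : ℝ} (hr : 0 ≤ r) :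
    ∫ x in (0 : ℝ)..1, (Set.Icc (c - r) (c + r)).indicator (1 : ℝ → ℝ) x ≤ 2 * r := by
  rw [intervalIntegral.integral_of_le zero_le_one, integral_indicator_one measurableSet_Icc,
    measureReal_restrict_apply measurableSet_Icc]
  calc volume.real (Set.Icc (c - r) (c + r) ∩ Set.Ioc 0 1)
      ≤ volume.real (Set.Icc (c - r) (c + r)) :=
        measureReal_mono Set.inter_subset_left (by simp [Real.volume_Icc])
    _ = 2 * r := by
        rw [Real.volume_real_Icc_of_le (by linarith)]; ring

/-- The cut-off profile `ψ(z) = min 1 (max 0 (|z| − 1))`: continuous, valued in `[0, 1]`, `= 0` for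
`|z| ≤ 1` and `= 1` for `|z| ≥ 2`. [folklore] -/
theorem cutoff_props :
    Continuous (fun z : ℝ => min 1 (max 0 (|z| - 1))) ∧
    (∀ z : ℝ, 0 ≤ min 1 (max 0 (|z| - 1))) ∧ (∀ z : ℝ, min 1 (max 0 (|z| - 1)) ≤ 1) ∧
    (∀ z : ℝ, |z| ≤ 1 → min 1 (max 0 (|z| - 1)) = 0) ∧
    (∀ z : ℝ, 2 ≤ |z| → min 1 (max 0 (|z| - 1)) = 1) := by
  refine ⟨by fun_prop, fun z => le_min zero_le_one (le_max_left _ _), fun z => min_le_left _ _,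
    fun z hz => ?_, fun z hz => ?_⟩
  · rw [max_eq_left (by linarith), min_eq_right zero_le_one]
  · rw [min_eq_left]; exact le_trans (by linarith) (le_max_right _ _)

/-- **Approximation lemma.** Let `f : ℝ → ℂ`, `‖f‖ ≤ 1`, be interval integrable on `[0, 1]` and,
off a finite set `T`, let `f·e(−κ·)` be locally constant on `[0, 1]`. Then for every `ε > 0`
there are a trigonometric polynomial `P(x) = ∑_{k ∈ s} c_k e(kx)` and a continuous `τ : [0,1] →
[0,1]` with `∫₀¹ τ ≤ ε`, `‖f − P‖ ≤ τ + ε` on `[0, 1]`, and `‖c_k − ∫₀¹ f(x)e(−kx)dx‖ ≤ 2ε` for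
every `k` (with `c_k = 0` off `s`). (Cut `f` off continuously near `T ∪ {0, 1}`, lift to the circle
and use density of trigonometric polynomials, `WeylCircle.exists_trigPoly_approx`.) [folklore] -/
theorem exists_trigPoly_approx_of_locally_e {f : ℝ → ℂ} {κ : ℝ} (T : Finset ℝ)
    (hf1 : ∀ x, ‖f x‖ ≤ 1) (hfi : IntervalIntegrable f volume 0 1)
    (hloc : ∀ x ∈ Set.Icc (0 : ℝ) 1, x ∉ T →
      ∀ᶠ y in 𝓝 x, f y * cexp (2 * π * I * ((-(κ * y) : ℝ) : ℂ)) =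
        f x * cexp (2 * π * I * ((-(κ * x) : ℝ) : ℂ)))
    (trigApprox : ∀ (G : C(AddCircle (2 * Real.pi), ℂ)) {ε : ℝ}, 0 < ε →
      ∃ (s : Finset ℤ) (c : ℤ → ℂ),
        ∀ t : ℝ, ‖G (t : AddCircle (2 * Real.pi)) - ∑ k ∈ s, c k * cexp (k * t * I)‖ ≤ ε)
    {ε : ℝ} (hε : 0 < ε) :
    ∃ (s : Finset ℤ) (c : ℤ → ℂ) (τ : ℝ → ℝ),
      ContinuousOn τ (Set.Icc 0 1) ∧ (∀ x, 0 ≤ τ x) ∧ (∀ x, τ x ≤ 1) ∧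
      (∫ x in (0 : ℝ)..1, τ x) ≤ ε ∧
      (∀ x ∈ Set.Icc (0 : ℝ) 1,
        ‖f x - ∑ k ∈ s, c k * cexp (2 * π * I * (((k : ℝ) * x : ℝ) : ℂ))‖ ≤ τ x + ε) ∧
      (∀ k : ℤ, ‖(if k ∈ s then c k else 0) -
          ∫ x in (0 : ℝ)..1, f x * cexp (2 * π * I * ((-((k : ℝ) * x) : ℝ) : ℂ))‖ ≤ 2 * ε) := by
  have hπ := Real.pi_pos
  classical
  obtain ⟨hψc, hψ0, hψ1, hψzero, hψone⟩ := cutoff_props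
  set ψ : ℝ → ℝ := fun z => min 1 (max 0 (|z| - 1)) with hψdef
  set S : Finset ℝ := insert 0 (insert 1 T) with hSdef
  have hS0 : (0 : ℝ) ∈ S := by simp [hSdef]
  have hS1 : (1 : ℝ) ∈ S := by simp [hSdef]
  have hTS : T ⊆ S := fun x hx => by simp [hSdef, hx]
  have hMpos : (0 : ℝ) < S.card := by
    have : 0 < S.card := Finset.card_pos.mpr ⟨0, hS0⟩
    exact_mod_cast this
  set δ : ℝ := ε / (4 * S.card) with hδdef
  have hδ : 0 < δ := by positivity
  -- the cut-off `χ` and `τ = 1 - χ`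
  set χ : ℝ → ℝ := fun y => ∏ c ∈ S, ψ ((y - c) / δ) with hχdef
  have hχc : Continuous χ := by
    refine continuous_finsetProd _ fun c _ => ?_
    exact hψc.comp ((continuous_id.sub continuous_const).div_const _)
  have hχ0 : ∀ y, 0 ≤ χ y := fun y => Finset.prod_nonneg fun c _ => hψ0 _
  have hχ1 : ∀ y, χ y ≤ 1 := fun y => Finset.prod_le_one (fun c _ => hψ0 _) fun c _ => hψ1 _
  have hχzero : ∀ y, ∀ c ∈ S, |y - c| ≤ δ → χ y = 0 := by
    intro y c hc hyc
    refine Finset.prod_eq_zero hc (hψzero _ ?_)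
    rw [abs_div, abs_of_pos hδ, div_le_one hδ]; exact hyc
  have hχS : ∀ c ∈ S, χ c = 0 := fun c hc => hχzero c c hc (by simp [hδ.le])
  set τ : ℝ → ℝ := fun y => 1 - χ y with hτdef
  -- `g = f χ`
  set g : ℝ → ℂ := fun y => f y * (χ y : ℂ) with hgdef
  have hg_norm : ∀ y, ‖g y‖ ≤ χ y := fun y => by
    rw [hgdef, norm_mul, Complex.norm_real, Real.norm_of_nonneg (hχ0 y)]
    calc ‖f y‖ * χ y ≤ 1 * χ y := mul_le_mul_of_nonneg_right (hf1 y) (hχ0 y)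
      _ = χ y := one_mul _
  have hg0 : g 0 = 0 := by simp [hgdef, hχS 0 hS0]
  have hg1 : g 1 = 0 := by simp [hgdef, hχS 1 hS1]
  have hgS : ∀ c ∈ S, g c = 0 := fun c hc => by simp [hgdef, hχS c hc]
  -- continuity of `g` on `[0, 1]`
  have hg_cont : ∀ y ∈ Set.Icc (0 : ℝ) 1, ContinuousAt g y := by
    intro y hy
    by_cases hyS : y ∈ S
    · -- squeeze: `‖g z‖ ≤ χ z → 0`
      have h0 : Tendsto χ (𝓝 y) (𝓝 0) := by
        have := hχc.tendsto y; rwa [hχS y hyS] at this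
      have h1 : Tendsto g (𝓝 y) (𝓝 0) := squeeze_zero_norm (fun z => hg_norm z) h0
      rw [ContinuousAt, hgS y hyS]; exact h1
    · have hyT : y ∉ T := fun h => hyS (hTS h)
      have hev := hloc y hy hyT
      -- `f` is continuous at `y`
      have hfc : ContinuousAt f y := by
        have hF : ContinuousAt (fun z : ℝ => (f y * cexp (2 * π * I * ((-(κ * y) : ℝ) : ℂ))) *
            cexp (2 * π * I * ((κ * z : ℝ) : ℂ))) y := by fun_prop
        refine hF.congr_of_eventuallyEq ?_
        filter_upwards [hev] with z hz
        rw [← hz, mul_assoc, ← Complex.exp_add]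
        rw [show (2 * π * I * ((-(κ * z) : ℝ) : ℂ) + 2 * π * I * ((κ * z : ℝ) : ℂ)) = 0 by
          push_cast; ring, Complex.exp_zero, mul_one]
      exact hfc.mul (Complex.continuous_ofReal.continuousAt.comp (hχc.continuousAt))
  have hg_contOn : ContinuousOn g (Set.Icc 0 1) := fun y hy => (hg_cont y hy).continuousWithinAt
  -- lift to the circle of circumference `2π`
  set gc : ℝ → ℂ := fun t => g (t / (2 * π)) with hgcdef
  have hgc_cont : ContinuousOn gc (Set.Icc 0 (0 + 2 * π)) := by
    refine hg_contOn.comp (continuousOn_id.div_const _) fun t ht => ?_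
    simp only [zero_add, Set.mem_Icc] at ht
    constructor
    · exact div_nonneg ht.1 (by positivity)
    · rw [div_le_one (by positivity)]; exact ht.2
  have hgc_per : gc 0 = gc (0 + 2 * π) := by
    simp only [hgcdef, zero_div, zero_add]
    rw [div_self (by positivity), hg0, hg1]
  haveI : Fact (0 < 2 * π) := ⟨by positivity⟩
  set G : C(AddCircle (2 * π), ℂ) :=
    ⟨AddCircle.liftIco (2 * π) 0 gc, AddCircle.liftIco_continuous hgc_per hgc_cont⟩ with hGdef
  have hGval : ∀ x ∈ Set.Icc (0 : ℝ) 1, G ((2 * π * x : ℝ) : AddCircle (2 * π)) = g x := by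
    intro x hx
    rcases eq_or_lt_of_le hx.2 with rfl | hx1
    · -- `x = 1`: the point `2π ≡ 0`
      have : ((2 * π * (1 : ℝ) : ℝ) : AddCircle (2 * π)) = ((0 : ℝ) : AddCircle (2 * π)) := by
        rw [mul_one, AddCircle.coe_period, QuotientAddGroup.mk_zero]
      rw [this]
      show AddCircle.liftIco (2 * π) 0 gc ((0 : ℝ) : AddCircle (2 * π)) = g 1
      rw [AddCircle.liftIco_coe_apply (by simp [Real.pi_pos])]
      simp only [hgcdef, zero_div]; rw [hg0, hg1]
    · show AddCircle.liftIco (2 * π) 0 gc ((2 * π * x : ℝ) : AddCircle (2 * π)) = g x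
      rw [AddCircle.liftIco_coe_apply]
      · simp only [hgcdef]; congr 1; field_simp
      · constructor
        · nlinarith [hx.1]
        · rw [zero_add]; nlinarith
  -- trigonometric approximation of `G`
  obtain ⟨s, c, hsc⟩ := trigApprox G hε
  set P : ℝ → ℂ := fun x => ∑ k ∈ s, c k * cexp (2 * π * I * (((k : ℝ) * x : ℝ) : ℂ)) with hPdef
  have hPeq : ∀ x : ℝ, ∑ k ∈ s, c k * cexp (k * (2 * π * x : ℝ) * I) = P x := by
    intro x; simp only [hPdef]
    refine Finset.sum_congr rfl fun k _ => ?_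
    congr 1; congr 1; push_cast; ring
  have hgP : ∀ x ∈ Set.Icc (0 : ℝ) 1, ‖g x - P x‖ ≤ ε := by
    intro x hx
    have := hsc (2 * π * x)
    rwa [hGval x hx, hPeq] at this
  have hfP : ∀ x ∈ Set.Icc (0 : ℝ) 1, ‖f x - P x‖ ≤ τ x + ε := by
    intro x hx
    have h1 : ‖f x - g x‖ ≤ τ x := by
      have : f x - g x = f x * ((1 - χ x : ℝ) : ℂ) := by simp only [hgdef]; push_cast; ring
      rw [this, norm_mul, Complex.norm_real, Real.norm_of_nonneg (by linarith [hχ1 x])]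
      calc ‖f x‖ * (1 - χ x) ≤ 1 * (1 - χ x) := by
            gcongr; · linarith [hχ1 x]
            · exact hf1 x
        _ = τ x := by simp [hτdef]
    calc ‖f x - P x‖ = ‖(f x - g x) + (g x - P x)‖ := by ring_nf
      _ ≤ ‖f x - g x‖ + ‖g x - P x‖ := norm_add_le _ _
      _ ≤ τ x + ε := add_le_add h1 (hgP x hx)
  -- `∫ τ ≤ ε`
  have hτ_le : ∀ y, τ y ≤ ∑ c' ∈ S, (Set.Icc (c' - 2 * δ) (c' + 2 * δ)).indicator (1 : ℝ → ℝ) y := by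
    intro y
    have h1 : τ y ≤ ∑ c' ∈ S, (1 - ψ ((y - c') / δ)) :=
      one_sub_prod_le_sum S (fun c' => ψ ((y - c') / δ)) (fun _ _ => hψ0 _) fun _ _ => hψ1 _
    refine h1.trans (Finset.sum_le_sum fun c' _ => ?_)
    by_cases hyc : y ∈ Set.Icc (c' - 2 * δ) (c' + 2 * δ)
    · rw [Set.indicator_of_mem hyc]; simp only [Pi.one_apply]; linarith [hψ0 ((y - c') / δ)]
    · rw [Set.indicator_of_notMem hyc]
      have : 2 ≤ |(y - c') / δ| := by
        rw [abs_div, abs_of_pos hδ, le_div_iff₀ hδ]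
        simp only [Set.mem_Icc, not_and_or, not_le] at hyc
        rcases hyc with h | h
        · rw [abs_of_neg (by linarith)]; linarith
        · rw [abs_of_pos (by linarith)]; linarith
      have h' := hψone _ this
      simp only [hψdef] at h' ⊢
      rw [h']; simp
  have hτc : Continuous τ := continuous_const.sub hχc
  have hτ0 : ∀ y, 0 ≤ τ y := fun y => by simp only [hτdef]; linarith [hχ1 y]
  have hτ1 : ∀ y, τ y ≤ 1 := fun y => by simp only [hτdef]; linarith [hχ0 y]
  have hind_int : ∀ c' ∈ S, IntervalIntegrable
      (fun y => (Set.Icc (c' - 2 * δ) (c' + 2 * δ)).indicator (1 : ℝ → ℝ) y) volume 0 1 := by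
    intro c' _
    refine MeasureTheory.IntegrableOn.intervalIntegrable ?_
    refine IntegrableOn.indicator ?_ measurableSet_Icc
    rw [Set.uIcc_of_le zero_le_one]
    exact integrableOn_const (by simp [Real.volume_Icc])
  have hτint : (∫ x in (0 : ℝ)..1, τ x) ≤ ε := by
    calc (∫ x in (0 : ℝ)..1, τ x)
        ≤ ∫ x in (0 : ℝ)..1, ∑ c' ∈ S, (Set.Icc (c' - 2 * δ) (c' + 2 * δ)).indicator (1 : ℝ → ℝ) x := by
          refine intervalIntegral.integral_mono_on zero_le_one (hτc.intervalIntegrable _ _) ?_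
            fun y _ => hτ_le y
          have := IntervalIntegrable.sum S hind_int
          rwa [Finset.sum_fn] at this
      _ = ∑ c' ∈ S, ∫ x in (0 : ℝ)..1, (Set.Icc (c' - 2 * δ) (c' + 2 * δ)).indicator (1 : ℝ → ℝ) x :=
          intervalIntegral.integral_finsetSum hind_int
      _ ≤ ∑ c' ∈ S, 2 * (2 * δ) :=
          Finset.sum_le_sum fun c' _ => integral_indicator_Icc_le c' (by positivity)
      _ = ε := by
          rw [Finset.sum_const, nsmul_eq_mul, hδdef]; field_simp; ring
  -- Fourier coefficients
  have hcoef : ∀ k : ℤ, ‖(if k ∈ s then c k else 0) -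
      ∫ x in (0 : ℝ)..1, f x * cexp (2 * π * I * ((-((k : ℝ) * x) : ℝ) : ℂ))‖ ≤ 2 * ε := by
    intro k
    have hek_cont : Continuous fun x : ℝ => cexp (2 * π * I * ((-((k : ℝ) * x) : ℝ) : ℂ)) := by
      fun_prop
    have hPc : Continuous P := by simp only [hPdef]; fun_prop
    have hPk : IntervalIntegrable (fun x => P x * cexp (2 * π * I * ((-((k : ℝ) * x) : ℝ) : ℂ)))
        volume 0 1 := (hPc.mul hek_cont).intervalIntegrable _ _
    have hfk : IntervalIntegrable (fun x => f x * cexp (2 * π * I * ((-((k : ℝ) * x) : ℝ) : ℂ)))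
        volume 0 1 := hfi.mul_continuousOn hek_cont.continuousOn
    rw [← integral_trigPoly_mul_e_neg s c k]
    change ‖(∫ x in (0 : ℝ)..1, P x * cexp (2 * π * I * ((-((k : ℝ) * x) : ℝ) : ℂ))) - _‖ ≤ _
    rw [← intervalIntegral.integral_sub hPk hfk]
    have hbound : ∀ x ∈ Set.Icc (0 : ℝ) 1,
        ‖P x * cexp (2 * π * I * ((-((k : ℝ) * x) : ℝ) : ℂ)) -
          f x * cexp (2 * π * I * ((-((k : ℝ) * x) : ℝ) : ℂ))‖ ≤ τ x + ε := by
      intro x hx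
      rw [← sub_mul, norm_mul, norm_e, mul_one, norm_sub_rev]
      exact hfP x hx
    calc ‖∫ x in (0 : ℝ)..1, (P x * cexp (2 * π * I * ((-((k : ℝ) * x) : ℝ) : ℂ)) -
          f x * cexp (2 * π * I * ((-((k : ℝ) * x) : ℝ) : ℂ)))‖
        ≤ ∫ x in (0 : ℝ)..1, (τ x + ε) := by
          refine intervalIntegral.norm_integral_le_of_norm_le zero_le_one ?_ ?_
          · exact Eventually.of_forall fun x hx => hbound x ⟨hx.1.le, hx.2⟩
          · exact (hτc.add continuous_const).intervalIntegrable _ _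
      _ = (∫ x in (0 : ℝ)..1, τ x) + ε := by
          rw [intervalIntegral.integral_add (hτc.intervalIntegrable _ _)
            (continuous_const.intervalIntegrable _ _)]
          simp
      _ ≤ ε + ε := by linarith
      _ = 2 * ε := by ring
  exact ⟨s, c, τ, hτc.continuousOn, hτ0, hτ1, hτint, hfP, hcoef⟩

/-! ### G'. Riemann sums along `({θn})` (Kuipers–Niederreiter Thm 1.1 for the Kronecker sequence) -/

/-- For irrational `θ` and `g` continuous on `[0, 1]`, `(1/N) Σ_{n<N} g({θn}) → ∫₀¹ g` (the
tree's `equidistributedModOne_nat_mul` and `EquidistributedModOne.tendsto_fractAvg`).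
[cite: KuipersNiederreiter1974, Ch. 1, Theorem 1.1 and Example 2.1] -/
theorem tendsto_avg_fract_mul {θ : ℝ} (hθ : Irrational θ) {g : ℝ → ℝ}
    (hg : ContinuousOn g (Set.Icc 0 1)) :
    Tendsto (fun N : ℕ => (∑ n ∈ range N, g (Int.fract (θ * n))) / N) atTop
      (𝓝 (∫ x in (0 : ℝ)..1, g x)) := by
  have hud : EquidistributedModOne fun n : ℕ => θ * n := by
    have h := equidistributedModOne_nat_mul hθ
    have heq : (fun n : ℕ => (n : ℝ) * θ) = fun n : ℕ => θ * n := by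
      funext n; ring
    rw [heq] at h
    exact h
  have h := hud.tendsto_fractAvg hg
  simpa [fractAvg] using h

/-! ### H. Twisted Weyl sums with two piecewise-exponential weights -/

/-- From `(1/N) Σ_{n<N} g({θn}) → ∫ g ≤ ε` to the eventual bound `Σ_{n<N} g({θn}) ≤ 2εN`.
[folklore] -/
theorem eventually_sum_fract_le {θ : ℝ} (hθ : Irrational θ) {g : ℝ → ℝ}
    (hg : ContinuousOn g (Set.Icc 0 1)) {ε : ℝ} (hε : 0 < ε)
    (hint : (∫ x in (0 : ℝ)..1, g x) ≤ ε) :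
    ∀ᶠ N : ℕ in atTop, ∑ n ∈ range N, g (Int.fract (θ * n)) ≤ 2 * ε * N := by
  have h := tendsto_avg_fract_mul hθ hg
  have h2 : ∀ᶠ N : ℕ in atTop, (∑ n ∈ range N, g (Int.fract (θ * n))) / N < 2 * ε :=
    (tendsto_order.1 h).2 _ (by linarith)
  filter_upwards [h2, eventually_gt_atTop 0] with N hN hN0
  have hN0' : (0 : ℝ) < N := by exact_mod_cast hN0
  rw [div_lt_iff₀ hN0'] at hN
  exact hN.le

/-- The Fourier coefficient `∫₀¹ f e(−k·)` of a function bounded by `1` has norm `≤ 1`. [folklore] -/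
theorem norm_integral_mul_e_le_one {f : ℝ → ℂ} (hf : ∀ x, ‖f x‖ ≤ 1) (k : ℤ) :
    ‖∫ x in (0 : ℝ)..1, f x * cexp (2 * π * I * ((-((k : ℝ) * x) : ℝ) : ℂ))‖ ≤ 1 := by
  have := intervalIntegral.norm_integral_le_of_norm_le_const (a := (0 : ℝ)) (b := 1) (C := 1)
    (f := fun x => f x * cexp (2 * π * I * ((-((k : ℝ) * x) : ℝ) : ℂ))) fun x _ => by
      rw [norm_mul, norm_e, mul_one]; exact hf x
  simpa using this

/-- **Twisted Weyl sums with two weights.** Let `α, β` be irrational and suppose the resonance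
equation `Λ + kα + lβ ∈ ℤ` has at most one integer solution `(k, l)` (e.g. `1, α, β` linearly
independent over `ℚ`). Let `f₁, f₂ : ℝ → ℂ` be bounded by `1` and approximable by trigonometric
polynomials in the sense of `exists_trigPoly_approx_of_locally_e`, and let `B ≥ 0` bound
`|f̂₁(k)|·|f̂₂(l)|` at the resonant pair. Then for every `η > 0`, for all large `N`,
`‖Σ_{n<N} e(Λn) f₁({αn}) f₂({βn})‖ ≤ (B + η) N`. (Approximate `fᵢ` by `Pᵢ`; the main term is a
finite combination of geometric sums `Σ_n e((Λ + kα + lβ)n)`, all `o(N)` except the resonant one,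
whose coefficient is within `O(ε)` of `f̂₁(k) f̂₂(l)`; the error terms are controlled by the
equidistribution of `({αn})`, `({βn})`.) [cite: KuipersNiederreiter1974, Ch. 5 Thm. 1.8 (proof pattern)] -/
theorem twisted_sum_eventually_le {α β Λ : ℝ} (hα : Irrational α) (hβ : Irrational β)
    (huniq : ∀ k l k' l' : ℤ, (∃ j : ℤ, Λ + k * α + l * β = j) →
      (∃ j : ℤ, Λ + k' * α + l' * β = j) → k = k' ∧ l = l')
    {f₁ f₂ : ℝ → ℂ} (hf₁ : ∀ x, ‖f₁ x‖ ≤ 1) (hf₂ : ∀ x, ‖f₂ x‖ ≤ 1)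
    (happ₁ : ∀ ε : ℝ, 0 < ε → ∃ (s : Finset ℤ) (c : ℤ → ℂ) (τ : ℝ → ℝ),
      ContinuousOn τ (Set.Icc 0 1) ∧ (∀ x, 0 ≤ τ x) ∧ (∀ x, τ x ≤ 1) ∧
      (∫ x in (0 : ℝ)..1, τ x) ≤ ε ∧
      (∀ x ∈ Set.Icc (0 : ℝ) 1,
        ‖f₁ x - ∑ k ∈ s, c k * cexp (2 * π * I * (((k : ℝ) * x : ℝ) : ℂ))‖ ≤ τ x + ε) ∧
      (∀ k : ℤ, ‖(if k ∈ s then c k else 0) -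
          ∫ x in (0 : ℝ)..1, f₁ x * cexp (2 * π * I * ((-((k : ℝ) * x) : ℝ) : ℂ))‖ ≤ 2 * ε))
    (happ₂ : ∀ ε : ℝ, 0 < ε → ∃ (s : Finset ℤ) (c : ℤ → ℂ) (τ : ℝ → ℝ),
      ContinuousOn τ (Set.Icc 0 1) ∧ (∀ x, 0 ≤ τ x) ∧ (∀ x, τ x ≤ 1) ∧
      (∫ x in (0 : ℝ)..1, τ x) ≤ ε ∧
      (∀ x ∈ Set.Icc (0 : ℝ) 1,
        ‖f₂ x - ∑ k ∈ s, c k * cexp (2 * π * I * (((k : ℝ) * x : ℝ) : ℂ))‖ ≤ τ x + ε) ∧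
      (∀ k : ℤ, ‖(if k ∈ s then c k else 0) -
          ∫ x in (0 : ℝ)..1, f₂ x * cexp (2 * π * I * ((-((k : ℝ) * x) : ℝ) : ℂ))‖ ≤ 2 * ε))
    {B : ℝ} (hB0 : 0 ≤ B)
    (hB : ∀ k l j : ℤ, Λ + k * α + l * β = j →
      ‖∫ x in (0 : ℝ)..1, f₁ x * cexp (2 * π * I * ((-((k : ℝ) * x) : ℝ) : ℂ))‖ *
        ‖∫ x in (0 : ℝ)..1, f₂ x * cexp (2 * π * I * ((-((l : ℝ) * x) : ℝ) : ℂ))‖ ≤ B)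
    {η : ℝ} (hη : 0 < η) :
    ∀ᶠ N : ℕ in atTop,
      ‖∑ n ∈ range N, cexp (2 * π * I * ((Λ * n : ℝ) : ℂ)) * f₁ (Int.fract (α * n)) *
          f₂ (Int.fract (β * n))‖ ≤ (B + η) * N := by
  classical
  -- parameters
  set ε : ℝ := min (η / 21) 1 with hεdef
  have hε : 0 < ε := lt_min (by positivity) one_pos
  have hε1 : ε ≤ 1 := min_le_right _ _
  have hεη : 21 * ε ≤ η := by
    have : ε ≤ η / 21 := min_le_left _ _
    linarith
  obtain ⟨s₁, c₁, τ₁, hτ₁c, hτ₁0, hτ₁1, hτ₁i, hfP₁, hc₁⟩ := happ₁ ε hε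
  obtain ⟨s₂, c₂, τ₂, hτ₂c, hτ₂0, hτ₂1, hτ₂i, hfP₂, hc₂⟩ := happ₂ ε hε
  set P₁ : ℝ → ℂ := fun x => ∑ k ∈ s₁, c₁ k * cexp (2 * π * I * (((k : ℝ) * x : ℝ) : ℂ)) with hP₁
  set P₂ : ℝ → ℂ := fun x => ∑ k ∈ s₂, c₂ k * cexp (2 * π * I * (((k : ℝ) * x : ℝ) : ℂ)) with hP₂
  have hfract_mem : ∀ (θ : ℝ) (n : ℕ), Int.fract (θ * n) ∈ Set.Icc (0 : ℝ) 1 := fun θ n =>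
    ⟨Int.fract_nonneg _, (Int.fract_lt_one _).le⟩
  -- pointwise error bound
  have hP₁norm : ∀ x ∈ Set.Icc (0 : ℝ) 1, ‖P₁ x‖ ≤ 3 := by
    intro x hx
    have h1 := hfP₁ x hx
    have h2 : ‖P₁ x‖ ≤ ‖f₁ x‖ + ‖f₁ x - P₁ x‖ := by
      have := norm_sub_le (f₁ x) (f₁ x - P₁ x); simp at this; exact this
    linarith [hf₁ x, hτ₁1 x]
  have herr : ∀ n : ℕ,
      ‖cexp (2 * π * I * ((Λ * n : ℝ) : ℂ)) * f₁ (Int.fract (α * n)) * f₂ (Int.fract (β * n)) -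
        cexp (2 * π * I * ((Λ * n : ℝ) : ℂ)) * P₁ (Int.fract (α * n)) * P₂ (Int.fract (β * n))‖ ≤
      τ₁ (Int.fract (α * n)) + 3 * τ₂ (Int.fract (β * n)) + 4 * ε := by
    intro n
    set u := Int.fract (α * n)
    set v := Int.fract (β * n)
    have hu := hfract_mem α n
    have hv := hfract_mem β n
    have hdec : cexp (2 * π * I * ((Λ * n : ℝ) : ℂ)) * f₁ u * f₂ v -
        cexp (2 * π * I * ((Λ * n : ℝ) : ℂ)) * P₁ u * P₂ v =
        cexp (2 * π * I * ((Λ * n : ℝ) : ℂ)) * ((f₁ u - P₁ u) * f₂ v + P₁ u * (f₂ v - P₂ v)) := by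
      ring
    rw [hdec, norm_mul, norm_e, one_mul]
    calc ‖(f₁ u - P₁ u) * f₂ v + P₁ u * (f₂ v - P₂ v)‖
        ≤ ‖f₁ u - P₁ u‖ * ‖f₂ v‖ + ‖P₁ u‖ * ‖f₂ v - P₂ v‖ := by
          refine (norm_add_le _ _).trans ?_; rw [norm_mul, norm_mul]
      _ ≤ (τ₁ u + ε) * 1 + 3 * (τ₂ v + ε) :=
          add_le_add (mul_le_mul (hfP₁ u hu) (hf₂ v) (norm_nonneg _) (by linarith [hτ₁0 u]))
            (mul_le_mul (hP₁norm u hu) (hfP₂ v hv) (norm_nonneg _) (by norm_num))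
      _ = τ₁ u + 3 * τ₂ v + 4 * ε := by ring
  -- the main term as a combination of geometric sums
  have hmain_pt : ∀ n : ℕ,
      cexp (2 * π * I * ((Λ * n : ℝ) : ℂ)) * P₁ (Int.fract (α * n)) * P₂ (Int.fract (β * n)) =
      ∑ p ∈ s₁ ×ˢ s₂, c₁ p.1 * c₂ p.2 *
        cexp (2 * π * I * (((Λ + p.1 * α + p.2 * β) * n : ℝ) : ℂ)) := by
    intro n
    rw [Finset.sum_product]
    simp only [hP₁, hP₂]
    simp_rw [e_int_mul_fract]
    rw [mul_assoc, Finset.sum_mul_sum, Finset.mul_sum]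
    refine Finset.sum_congr rfl fun k _ => ?_
    rw [Finset.mul_sum]
    refine Finset.sum_congr rfl fun l _ => ?_
    have : (((Λ + k * α + l * β) * n : ℝ) : ℂ) =
        ((Λ * n : ℝ) : ℂ) + (((k : ℝ) * (α * n) : ℝ) : ℂ) + (((l : ℝ) * (β * n) : ℝ) : ℂ) := by
      push_cast; ring
    rw [this, e_add, e_add]
    ring
  -- resonant / non-resonant split
  set R : Finset (ℤ × ℤ) := (s₁ ×ˢ s₂).filter (fun p => ∃ j : ℤ, Λ + p.1 * α + p.2 * β = j)
    with hRdef
  set NR : Finset (ℤ × ℤ) := (s₁ ×ˢ s₂).filter (fun p => ¬ ∃ j : ℤ, Λ + p.1 * α + p.2 * β = j)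
    with hNRdef
  have hRcard : R.card ≤ 1 := by
    refine Finset.card_le_one.mpr fun p hp q hq => ?_
    have hp' := (Finset.mem_filter.1 hp).2
    have hq' := (Finset.mem_filter.1 hq).2
    obtain ⟨h1, h2⟩ := huniq p.1 p.2 q.1 q.2 hp' hq'
    exact Prod.ext h1 h2
  -- resonant coefficient bound
  have hRbound : ∀ p ∈ R, ‖c₁ p.1 * c₂ p.2‖ ≤ B + 8 * ε := by
    intro p hp
    obtain ⟨hp12, ⟨j, hj⟩⟩ := Finset.mem_filter.1 hp
    obtain ⟨hk, hl⟩ := Finset.mem_product.1 hp12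
    set F₁ := ∫ x in (0 : ℝ)..1, f₁ x * cexp (2 * π * I * ((-((p.1 : ℝ) * x) : ℝ) : ℂ))
    set F₂ := ∫ x in (0 : ℝ)..1, f₂ x * cexp (2 * π * I * ((-((p.2 : ℝ) * x) : ℝ) : ℂ))
    have h1 : ‖c₁ p.1‖ ≤ ‖F₁‖ + 2 * ε := by
      have := hc₁ p.1; rw [if_pos hk] at this
      have h := norm_sub_norm_le (c₁ p.1) F₁; linarith
    have h2 : ‖c₂ p.2‖ ≤ ‖F₂‖ + 2 * ε := by
      have := hc₂ p.2; rw [if_pos hl] at this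
      have h := norm_sub_norm_le (c₂ p.2) F₂; linarith
    have hF₁ : ‖F₁‖ ≤ 1 := norm_integral_mul_e_le_one hf₁ p.1
    have hF₂ : ‖F₂‖ ≤ 1 := norm_integral_mul_e_le_one hf₂ p.2
    have hFB : ‖F₁‖ * ‖F₂‖ ≤ B := hB p.1 p.2 j hj
    rw [norm_mul]
    calc ‖c₁ p.1‖ * ‖c₂ p.2‖ ≤ (‖F₁‖ + 2 * ε) * (‖F₂‖ + 2 * ε) := by
          gcongr
      _ = ‖F₁‖ * ‖F₂‖ + 2 * ε * ‖F₂‖ + 2 * ε * ‖F₁‖ + 4 * ε * ε := by ring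
      _ ≤ B + 2 * ε * 1 + 2 * ε * 1 + 4 * ε * 1 := by gcongr
      _ = B + 8 * ε := by ring
  -- non-resonant sums are small
  set K : ℝ := ∑ p ∈ s₁ ×ˢ s₂, ‖c₁ p.1 * c₂ p.2‖ with hKdef
  have hK0 : 0 ≤ K := Finset.sum_nonneg fun p _ => norm_nonneg _
  have hNRev : ∀ᶠ N : ℕ in atTop, ∀ p ∈ NR,
      ‖∑ n ∈ range N, cexp (2 * π * I * (((Λ + p.1 * α + p.2 * β) * n : ℝ) : ℂ))‖ ≤
        ε / (K + 1) * N := by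
    refine (Finset.eventually_all NR).mpr fun p hp => ?_
    have hp' := (Finset.mem_filter.1 hp).2
    refine eventually_norm_le_of_isLittleO (isLittleO_sum_range_e _ ?_) (by positivity)
    refine FloorMultipleUD.exp_ne_one_of_ne_int fun z hz => hp' ⟨z, ?_⟩
    exact_mod_cast hz
  have hτ₁ev := eventually_sum_fract_le hα hτ₁c hε hτ₁i
  have hτ₂ev := eventually_sum_fract_le hβ hτ₂c hε hτ₂i
  filter_upwards [hNRev, hτ₁ev, hτ₂ev] with N hNR hτ₁N hτ₂N
  -- notation for the sums
  set S : ℂ := ∑ n ∈ range N, cexp (2 * π * I * ((Λ * n : ℝ) : ℂ)) * f₁ (Int.fract (α * n)) *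
    f₂ (Int.fract (β * n)) with hSdef
  set M : ℂ := ∑ n ∈ range N, cexp (2 * π * I * ((Λ * n : ℝ) : ℂ)) * P₁ (Int.fract (α * n)) *
    P₂ (Int.fract (β * n)) with hMdef
  set W : ℤ × ℤ → ℂ := fun p =>
    ∑ n ∈ range N, cexp (2 * π * I * (((Λ + p.1 * α + p.2 * β) * n : ℝ) : ℂ)) with hWdef
  have hSM : ‖S - M‖ ≤ 12 * ε * N := by
    rw [hSdef, hMdef, ← Finset.sum_sub_distrib]
    calc ‖∑ n ∈ range N, (cexp (2 * π * I * ((Λ * n : ℝ) : ℂ)) * f₁ (Int.fract (α * n)) *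
            f₂ (Int.fract (β * n)) -
          cexp (2 * π * I * ((Λ * n : ℝ) : ℂ)) * P₁ (Int.fract (α * n)) * P₂ (Int.fract (β * n)))‖
        ≤ ∑ n ∈ range N, (τ₁ (Int.fract (α * n)) + 3 * τ₂ (Int.fract (β * n)) + 4 * ε) :=
          (norm_sum_le _ _).trans (Finset.sum_le_sum fun n _ => herr n)
      _ = ∑ n ∈ range N, τ₁ (Int.fract (α * n)) + 3 * ∑ n ∈ range N, τ₂ (Int.fract (β * n)) +
            4 * ε * N := by
          rw [Finset.sum_add_distrib, Finset.sum_add_distrib, Finset.sum_const, card_range,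
            nsmul_eq_mul, ← Finset.mul_sum]; ring
      _ ≤ 2 * ε * N + 3 * (2 * ε * N) + 4 * ε * N := by gcongr
      _ = 12 * ε * N := by ring
  have hMW : M = ∑ p ∈ s₁ ×ˢ s₂, c₁ p.1 * c₂ p.2 * W p := by
    rw [hMdef]
    simp_rw [hmain_pt]
    rw [Finset.sum_comm]
    refine Finset.sum_congr rfl fun p _ => ?_
    rw [hWdef, Finset.mul_sum]
  have hsplit : ∑ p ∈ s₁ ×ˢ s₂, c₁ p.1 * c₂ p.2 * W p =
      ∑ p ∈ R, c₁ p.1 * c₂ p.2 * W p + ∑ p ∈ NR, c₁ p.1 * c₂ p.2 * W p := by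
    rw [hRdef, hNRdef, Finset.sum_filter_add_sum_filter_not]
  have hWle : ∀ p, ‖W p‖ ≤ N := by
    intro p
    rw [hWdef]
    calc ‖∑ n ∈ range N, cexp (2 * π * I * (((Λ + p.1 * α + p.2 * β) * n : ℝ) : ℂ))‖
        ≤ ∑ n ∈ range N, ‖cexp (2 * π * I * (((Λ + p.1 * α + p.2 * β) * n : ℝ) : ℂ))‖ :=
          norm_sum_le _ _
      _ = N := by simp_rw [norm_e]; simp
  have hRsum : ‖∑ p ∈ R, c₁ p.1 * c₂ p.2 * W p‖ ≤ (B + 8 * ε) * N := by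
    calc ‖∑ p ∈ R, c₁ p.1 * c₂ p.2 * W p‖ ≤ ∑ p ∈ R, ‖c₁ p.1 * c₂ p.2 * W p‖ := norm_sum_le _ _
      _ ≤ ∑ p ∈ R, (B + 8 * ε) * N := by
          refine Finset.sum_le_sum fun p hp => ?_
          rw [norm_mul]
          exact mul_le_mul (hRbound p hp) (hWle p) (norm_nonneg _) (by positivity)
      _ = R.card * ((B + 8 * ε) * N) := by rw [Finset.sum_const, nsmul_eq_mul]
      _ ≤ 1 * ((B + 8 * ε) * N) := by
          gcongr
          exact_mod_cast hRcard
      _ = (B + 8 * ε) * N := one_mul _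
  have hNRsum : ‖∑ p ∈ NR, c₁ p.1 * c₂ p.2 * W p‖ ≤ ε * N := by
    calc ‖∑ p ∈ NR, c₁ p.1 * c₂ p.2 * W p‖ ≤ ∑ p ∈ NR, ‖c₁ p.1 * c₂ p.2 * W p‖ := norm_sum_le _ _
      _ ≤ ∑ p ∈ NR, ‖c₁ p.1 * c₂ p.2‖ * (ε / (K + 1) * N) := by
          refine Finset.sum_le_sum fun p hp => ?_
          rw [norm_mul]
          exact mul_le_mul_of_nonneg_left (hNR p hp) (norm_nonneg _)
      _ = (∑ p ∈ NR, ‖c₁ p.1 * c₂ p.2‖) * (ε / (K + 1) * N) := by rw [Finset.sum_mul]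
      _ ≤ K * (ε / (K + 1) * N) := by
          gcongr
          exact Finset.sum_le_sum_of_subset_of_nonneg (Finset.filter_subset _ _)
            fun _ _ _ => norm_nonneg _
      _ ≤ ε * N := by
          rw [show K * (ε / (K + 1) * N) = (K / (K + 1)) * (ε * N) by ring]
          have : K / (K + 1) ≤ 1 := by rw [div_le_one (by linarith)]; linarith
          calc K / (K + 1) * (ε * N) ≤ 1 * (ε * N) := by gcongr
            _ = ε * N := one_mul _
  -- assemble
  have hMle : ‖M‖ ≤ (B + 8 * ε) * N + ε * N := by
    rw [hMW, hsplit]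
    exact (norm_add_le _ _).trans (add_le_add hRsum hNRsum)
  calc ‖S‖ = ‖(S - M) + M‖ := by ring_nf
    _ ≤ ‖S - M‖ + ‖M‖ := norm_add_le _ _
    _ ≤ 12 * ε * N + ((B + 8 * ε) * N + ε * N) := add_le_add hSM hMle
    _ = (B + 21 * ε) * N := by ring
    _ ≤ (B + η) * N := by gcongr

/-! ### I. One weight: twisted Weyl sums `Σ e(Λn) f({αn})` -/

/-- For every real `α` and `Λ` there is `β` admitting no relation `kα + lβ ∈ ℤ` or
`Λ + kα + lβ ∈ ℤ` with `l ≠ 0` (the excluded set is countable). [folklore] -/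
theorem exists_generic_real (α Λ : ℝ) :
    ∃ β : ℝ, (∀ k l j : ℤ, (k : ℝ) * α + l * β = j → l = 0) ∧
      (∀ k l j : ℤ, Λ + k * α + l * β = j → l = 0) := by
  set S : Set ℝ := Set.range (fun t : ℤ × ℤ × ℤ => ((t.2.2 : ℝ) - t.1 * α) / t.2.1) ∪
    Set.range (fun t : ℤ × ℤ × ℤ => ((t.2.2 : ℝ) - Λ - t.1 * α) / t.2.1) with hS
  have hSc : S.Countable := (Set.countable_range _).union (Set.countable_range _)
  obtain ⟨β, hβ⟩ : ∃ β : ℝ, β ∉ S := by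
    by_contra h
    push Not at h
    exact Cardinal.not_countable_real (hSc.mono fun x _ => h x)
  refine ⟨β, fun k l j h => ?_, fun k l j h => ?_⟩ <;> by_contra hl
  · have hl' : (l : ℝ) ≠ 0 := by exact_mod_cast hl
    exact hβ (Or.inl ⟨(k, l, j), by simp only; field_simp; linarith⟩)
  · have hl' : (l : ℝ) ≠ 0 := by exact_mod_cast hl
    exact hβ (Or.inr ⟨(k, l, j), by simp only; field_simp; linarith⟩)

/-- **Twisted Weyl sums with one weight.** Let `α` be irrational, `f : ℝ → ℂ` bounded by `1` and
approximable by trigonometric polynomials (as in `exists_trigPoly_approx_of_locally_e`), and let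
`B ≥ 0` bound `|f̂(k)|` at the (unique, if any) resonant frequency `k`, `Λ + kα ∈ ℤ`. Then for
every `η > 0`, `‖Σ_{n<N} e(Λn) f({αn})‖ ≤ (B + η)N` for all large `N`.
[cite: KuipersNiederreiter1974, Ch. 5 Thm. 1.8 (proof pattern)] -/
theorem twisted_sum_eventually_le_one {α Λ : ℝ} (hα : Irrational α)
    {f : ℝ → ℂ} (hf : ∀ x, ‖f x‖ ≤ 1)
    (happ : ∀ ε : ℝ, 0 < ε → ∃ (s : Finset ℤ) (c : ℤ → ℂ) (τ : ℝ → ℝ),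
      ContinuousOn τ (Set.Icc 0 1) ∧ (∀ x, 0 ≤ τ x) ∧ (∀ x, τ x ≤ 1) ∧
      (∫ x in (0 : ℝ)..1, τ x) ≤ ε ∧
      (∀ x ∈ Set.Icc (0 : ℝ) 1,
        ‖f x - ∑ k ∈ s, c k * cexp (2 * π * I * (((k : ℝ) * x : ℝ) : ℂ))‖ ≤ τ x + ε) ∧
      (∀ k : ℤ, ‖(if k ∈ s then c k else 0) -
          ∫ x in (0 : ℝ)..1, f x * cexp (2 * π * I * ((-((k : ℝ) * x) : ℝ) : ℂ))‖ ≤ 2 * ε))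
    {B : ℝ} (hB0 : 0 ≤ B)
    (hB : ∀ k j : ℤ, Λ + k * α = j →
      ‖∫ x in (0 : ℝ)..1, f x * cexp (2 * π * I * ((-((k : ℝ) * x) : ℝ) : ℂ))‖ ≤ B)
    {η : ℝ} (hη : 0 < η) :
    ∀ᶠ N : ℕ in atTop,
      ‖∑ n ∈ range N, cexp (2 * π * I * ((Λ * n : ℝ) : ℂ)) * f (Int.fract (α * n))‖ ≤
        (B + η) * N := by
  classical
  obtain ⟨β, hβ1, hβ2⟩ := exists_generic_real α Λ
  have hβ : Irrational β := by
    rintro ⟨q, hq⟩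
    have := hβ1 0 q.den q.num (by
      rw [← hq]; push_cast
      have := Rat.mul_den_eq_num q
      have h' : ((q * q.den : ℚ) : ℝ) = (q.num : ℝ) := by exact_mod_cast this
      push_cast at h'; linarith)
    exact q.den_nz (by exact_mod_cast this)
  have huniq : ∀ k l k' l' : ℤ, (∃ j : ℤ, Λ + k * α + l * β = j) →
      (∃ j : ℤ, Λ + k' * α + l' * β = j) → k = k' ∧ l = l' := by
    rintro k l k' l' ⟨j, hj⟩ ⟨j', hj'⟩
    have hl := hβ2 k l j hj
    have hl' := hβ2 k' l' j' hj'
    subst hl; subst hl'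
    refine ⟨?_, rfl⟩
    by_contra hne
    have h1 : ((k - k' : ℤ) : ℝ) * α = ((j - j' : ℤ) : ℝ) := by push_cast; linarith
    have hkk : (k - k' : ℤ) ≠ 0 := sub_ne_zero.mpr hne
    exact (hα.intCast_mul hkk).ne_int (j - j') (by rw [h1])
  -- the constant weight `1`
  have happ₂ : ∀ ε : ℝ, 0 < ε → ∃ (s : Finset ℤ) (c : ℤ → ℂ) (τ : ℝ → ℝ),
      ContinuousOn τ (Set.Icc 0 1) ∧ (∀ x, 0 ≤ τ x) ∧ (∀ x, τ x ≤ 1) ∧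
      (∫ x in (0 : ℝ)..1, τ x) ≤ ε ∧
      (∀ x ∈ Set.Icc (0 : ℝ) 1,
        ‖(fun _ : ℝ => (1 : ℂ)) x -
          ∑ k ∈ s, c k * cexp (2 * π * I * (((k : ℝ) * x : ℝ) : ℂ))‖ ≤ τ x + ε) ∧
      (∀ k : ℤ, ‖(if k ∈ s then c k else 0) -
          ∫ x in (0 : ℝ)..1, (fun _ : ℝ => (1 : ℂ)) x *
            cexp (2 * π * I * ((-((k : ℝ) * x) : ℝ) : ℂ))‖ ≤ 2 * ε) := by
    intro ε hε
    refine ⟨{0}, fun _ => 1, fun _ => 0, continuousOn_const, fun _ => le_rfl,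
      fun _ => zero_le_one, by simp; exact hε.le, fun x _ => ?_, fun k => ?_⟩
    · simp; exact hε.le
    · have hint : ∫ x in (0 : ℝ)..1, (fun _ : ℝ => (1 : ℂ)) x *
          cexp (2 * π * I * ((-((k : ℝ) * x) : ℝ) : ℂ)) = if k = 0 then 1 else 0 := by
        have := integral_e_int_mul (-k)
        simp only [neg_eq_zero, Int.cast_neg] at this
        rw [← this]
        refine intervalIntegral.integral_congr fun x _ => ?_
        simp only [one_mul]; congr 2; push_cast; ring
      rw [hint]
      simp only [Finset.mem_singleton]
      split_ifs <;> simp <;> positivity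
  have hB' : ∀ k l j : ℤ, Λ + k * α + l * β = j →
      ‖∫ x in (0 : ℝ)..1, f x * cexp (2 * π * I * ((-((k : ℝ) * x) : ℝ) : ℂ))‖ *
        ‖∫ x in (0 : ℝ)..1, (fun _ : ℝ => (1 : ℂ)) x *
          cexp (2 * π * I * ((-((l : ℝ) * x) : ℝ) : ℂ))‖ ≤ B := by
    intro k l j h
    have hl := hβ2 k l j h
    subst hl
    have h' : Λ + k * α = j := by simpa using h
    have h1 : ‖∫ x in (0 : ℝ)..1, (fun _ : ℝ => (1 : ℂ)) x *
        cexp (2 * π * I * ((-(((0 : ℤ) : ℝ) * x) : ℝ) : ℂ))‖ = 1 := by simp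
    rw [h1, mul_one]
    exact hB k j h'
  have key := twisted_sum_eventually_le hα hβ huniq hf (f₂ := fun _ => (1 : ℂ))
    (fun _ => by simp) happ happ₂ hB0 hB' hη
  simpa using key

/-! ### J. Piecewise-exponential functions: the instances -/

/-- A bounded measurable function is interval integrable. [folklore] -/
theorem intervalIntegrable_of_norm_le_one {f : ℝ → ℂ} (hf : Measurable f) (h1 : ∀ x, ‖f x‖ ≤ 1)
    (a b : ℝ) : IntervalIntegrable f volume a b := by
  refine MeasureTheory.IntegrableOn.intervalIntegrable ?_
  refine Measure.integrableOn_of_bounded (M := 1) ?_ hf.aestronglyMeasurable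
    (Eventually.of_forall h1)
  rw [Set.uIcc]; exact measure_Icc_lt_top.ne

/-- The piece functions `u ↦ 𝟙[(1 ≤ s + u) ↔ i = 1] · e(κu)` of the correlation identity are
measurable. [folklore] -/
theorem measurable_piece (s κ : ℝ) (i : ℕ) :
    Measurable fun u : ℝ => (if (1 ≤ s + u ↔ i = 1) then (1 : ℂ) else 0) *
      cexp (2 * π * I * ((κ * u : ℝ) : ℂ)) := by
  refine Measurable.mul ?_ (by fun_prop)
  refine Measurable.ite ?_ measurable_const measurable_const
  by_cases hi : i = 1
  · simp only [hi, iff_true]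
    exact measurableSet_le measurable_const (measurable_const.add measurable_id)
  · simp only [hi, iff_false, not_le]
    exact measurableSet_lt (measurable_const.add measurable_id) measurable_const

/-- The piece functions are bounded by `1`. [folklore] -/
theorem norm_piece_le (s κ : ℝ) (i : ℕ) (u : ℝ) :
    ‖(if (1 ≤ s + u ↔ i = 1) then (1 : ℂ) else 0) * cexp (2 * π * I * ((κ * u : ℝ) : ℂ))‖ ≤ 1 := by
  rw [norm_mul, norm_e, mul_one]
  split_ifs <;> simp

/-- The piece functions are locally exponential off the single point `1 - s`. [folklore] -/
theorem piece_locally_e (s κ : ℝ) (i : ℕ) :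
    ∀ x ∈ Set.Icc (0 : ℝ) 1, x ∉ ({1 - s} : Finset ℝ) →
      ∀ᶠ y in 𝓝 x,
        (fun u : ℝ => (if (1 ≤ s + u ↔ i = 1) then (1 : ℂ) else 0) *
            cexp (2 * π * I * ((κ * u : ℝ) : ℂ))) y * cexp (2 * π * I * ((-(κ * y) : ℝ) : ℂ)) =
        (fun u : ℝ => (if (1 ≤ s + u ↔ i = 1) then (1 : ℂ) else 0) *
            cexp (2 * π * I * ((κ * u : ℝ) : ℂ))) x * cexp (2 * π * I * ((-(κ * x) : ℝ) : ℂ)) := by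
  intro x _ hx
  have hx' : x ≠ 1 - s := by simpa using hx
  have hcancel : ∀ y : ℝ, cexp (2 * π * I * ((κ * y : ℝ) : ℂ)) *
      cexp (2 * π * I * ((-(κ * y) : ℝ) : ℂ)) = 1 := by
    intro y
    rw [← e_add, show (((κ * y : ℝ) : ℂ) + ((-(κ * y) : ℝ) : ℂ)) = 0 by push_cast; ring]
    simp
  have hiff : ∀ᶠ y in 𝓝 x, (1 ≤ s + y ↔ 1 ≤ s + x) := by
    rcases lt_or_gt_of_ne hx' with h | h
    · filter_upwards [gt_mem_nhds h] with y hy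
      constructor <;> intro <;> linarith
    · filter_upwards [lt_mem_nhds h] with y hy
      constructor <;> intro h' <;> linarith [hy]
  filter_upwards [hiff] with y hy
  rw [mul_assoc, hcancel, mul_assoc, hcancel]
  simp only [hy]

/-- Products of locally exponential functions are locally exponential (frequencies add, exceptional
sets unite). [folklore] -/
theorem mul_locally_e {f g : ℝ → ℂ} {κ κ' : ℝ} {T T' : Finset ℝ}
    (hf : ∀ x ∈ Set.Icc (0 : ℝ) 1, x ∉ T →
      ∀ᶠ y in 𝓝 x, f y * cexp (2 * π * I * ((-(κ * y) : ℝ) : ℂ)) =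
        f x * cexp (2 * π * I * ((-(κ * x) : ℝ) : ℂ)))
    (hg : ∀ x ∈ Set.Icc (0 : ℝ) 1, x ∉ T' →
      ∀ᶠ y in 𝓝 x, g y * cexp (2 * π * I * ((-(κ' * y) : ℝ) : ℂ)) =
        g x * cexp (2 * π * I * ((-(κ' * x) : ℝ) : ℂ))) :
    ∀ x ∈ Set.Icc (0 : ℝ) 1, x ∉ T ∪ T' →
      ∀ᶠ y in 𝓝 x, (f y * g y) * cexp (2 * π * I * ((-((κ + κ') * y) : ℝ) : ℂ)) =
        (f x * g x) * cexp (2 * π * I * ((-((κ + κ') * x) : ℝ) : ℂ)) := by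
  intro x hx hxT
  rw [Finset.mem_union, not_or] at hxT
  filter_upwards [hf x hx hxT.1, hg x hx hxT.2] with y hfy hgy
  have split : ∀ z : ℝ, cexp (2 * π * I * ((-((κ + κ') * z) : ℝ) : ℂ)) =
      cexp (2 * π * I * ((-(κ * z) : ℝ) : ℂ)) * cexp (2 * π * I * ((-(κ' * z) : ℝ) : ℂ)) := by
    intro z; rw [← e_add]; congr 1; push_cast; ring
  rw [split, split]
  calc f y * g y * (cexp (2 * π * I * ((-(κ * y) : ℝ) : ℂ)) * cexp (2 * π * I * ((-(κ' * y) : ℝ) : ℂ)))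
      = (f y * cexp (2 * π * I * ((-(κ * y) : ℝ) : ℂ))) *
          (g y * cexp (2 * π * I * ((-(κ' * y) : ℝ) : ℂ))) := by ring
    _ = (f x * cexp (2 * π * I * ((-(κ * x) : ℝ) : ℂ))) *
          (g x * cexp (2 * π * I * ((-(κ' * x) : ℝ) : ℂ))) := by rw [hfy, hgy]
    _ = f x * g x * (cexp (2 * π * I * ((-(κ * x) : ℝ) : ℂ)) * cexp (2 * π * I * ((-(κ' * x) : ℝ) : ℂ))) := by
        ring

/-- The pure exponential `e(κ·)` is locally exponential with empty exceptional set. [folklore] -/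
theorem e_locally_e (κ : ℝ) :
    ∀ x ∈ Set.Icc (0 : ℝ) 1, x ∉ (∅ : Finset ℝ) →
      ∀ᶠ y in 𝓝 x, cexp (2 * π * I * ((κ * y : ℝ) : ℂ)) * cexp (2 * π * I * ((-(κ * y) : ℝ) : ℂ)) =
        cexp (2 * π * I * ((κ * x : ℝ) : ℂ)) * cexp (2 * π * I * ((-(κ * x) : ℝ) : ℂ)) := by
  intro x _ _
  refine Eventually.of_forall fun y => ?_
  rw [← e_add, ← e_add]
  congr 1; push_cast; ring

/-- **Composition with an integral dilation.** If `f·e(−κ·)` is locally constant on `[0,1]` off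
`T`, then `y ↦ f({Ay + ρ})` times `e(−Aκ·)` is locally constant on `[0, 1]` off the finite set
of `y` with `Ay + ρ ∈ ℤ` or `{Ay + ρ} ∈ T` (for `A = 0` the composite is constant). [folklore] -/
theorem comp_fract_locally_e {f : ℝ → ℂ} {κ : ℝ} {T : Finset ℝ}
    (hf : ∀ x ∈ Set.Icc (0 : ℝ) 1, x ∉ T →
      ∀ᶠ y in 𝓝 x, f y * cexp (2 * π * I * ((-(κ * y) : ℝ) : ℂ)) =
        f x * cexp (2 * π * I * ((-(κ * x) : ℝ) : ℂ)))
    (A : ℤ) (ρ : ℝ) :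
    ∃ T' : Finset ℝ, T'.card ≤ (T.card + 1) * (A.natAbs + 3) ∧
      ∀ x ∈ Set.Icc (0 : ℝ) 1, x ∉ T' →
        ∀ᶠ y in 𝓝 x, f (Int.fract (A * y + ρ)) * cexp (2 * π * I * ((-((A * κ) * y) : ℝ) : ℂ)) =
          f (Int.fract (A * x + ρ)) * cexp (2 * π * I * ((-((A * κ) * x) : ℝ) : ℂ)) := by
  classical
  by_cases hA : A = 0
  · subst hA
    refine ⟨∅, by simp, fun x _ _ => Eventually.of_forall fun y => ?_⟩
    simp
  have hA' : (A : ℝ) ≠ 0 := by exact_mod_cast hA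
  -- the range of integers `z` that `Ay + ρ` (`y ∈ [0,1]`) can have as value or as integer part
  set lo : ℤ := ⌊min ρ (A + ρ)⌋ with hlo
  set hi : ℤ := ⌈max ρ (A + ρ)⌉ with hhi
  set Z : Finset ℤ := Finset.Icc lo hi with hZ
  have hZcard : Z.card ≤ A.natAbs + 3 := by
    rw [hZ, Int.card_Icc]
    have h1 : (hi : ℝ) < max ρ (A + ρ) + 1 := Int.ceil_lt_add_one _
    have h2 : min ρ (A + ρ) - 1 < (lo : ℝ) := by
      have := Int.sub_one_lt_floor (min ρ (A + ρ)); linarith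
    have h3 : max ρ ((A : ℝ) + ρ) - min ρ (A + ρ) = |(A : ℝ)| := by
      rcases le_or_gt (0 : ℝ) A with h | h
      · rw [max_eq_right (by linarith), min_eq_left (by linarith), abs_of_nonneg h]; ring
      · rw [max_eq_left (by linarith), min_eq_right (by linarith), abs_of_neg h]; ring
    have h4 : ((hi + 1 - lo : ℤ) : ℝ) < |(A : ℝ)| + 3 := by push_cast; linarith
    have h5 : (A.natAbs : ℝ) = |(A : ℝ)| := by
      rw [Nat.cast_natAbs, Int.cast_abs]
    have h6 : (hi + 1 - lo : ℤ) < ((A.natAbs + 3 : ℕ) : ℤ) := by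
      have : ((hi + 1 - lo : ℤ) : ℝ) < (((A.natAbs + 3 : ℕ) : ℤ) : ℝ) := by
        push_cast at h4 ⊢; linarith
      exact_mod_cast this
    omega
  have hZmem : ∀ y ∈ Set.Icc (0 : ℝ) 1, ⌊(A : ℝ) * y + ρ⌋ ∈ Z ∧
      ∀ z : ℤ, (A : ℝ) * y + ρ = z → z ∈ Z := by
    intro y hy
    have hrange : min ρ ((A : ℝ) + ρ) ≤ A * y + ρ ∧ (A : ℝ) * y + ρ ≤ max ρ (A + ρ) := by
      rcases le_or_gt (0 : ℝ) A with h | h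
      · rw [max_eq_right (by linarith), min_eq_left (by linarith)]
        constructor <;> nlinarith [hy.1, hy.2]
      · rw [max_eq_left (by linarith), min_eq_right (by linarith)]
        constructor <;> nlinarith [hy.1, hy.2]
    have hmemZ : ∀ z : ℤ, min ρ ((A : ℝ) + ρ) - 1 < z → (z : ℝ) ≤ max ρ (A + ρ) → z ∈ Z := by
      intro z h1 h2
      rw [hZ, Finset.mem_Icc]
      constructor
      · rw [hlo]
        have : (⌊min ρ ((A : ℝ) + ρ)⌋ : ℝ) ≤ min ρ ((A : ℝ) + ρ) := Int.floor_le _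
        have : (lo : ℝ) < z + 1 := by rw [hlo]; linarith
        exact_mod_cast Int.lt_add_one_iff.mp (by exact_mod_cast this)
      · rw [hhi]; exact Int.le_ceil_iff.mpr (by linarith [Int.le_ceil (max ρ ((A:ℝ) + ρ))])
    constructor
    · refine hmemZ _ ?_ ?_
      · have := Int.sub_one_lt_floor ((A : ℝ) * y + ρ); linarith [hrange.1]
      · exact (Int.floor_le _).trans hrange.2
    · intro z hz
      refine hmemZ z ?_ ?_ <;> linarith [hrange.1, hrange.2]
  -- the exceptional set
  set T' : Finset ℝ := (Z.image fun z : ℤ => ((z : ℝ) - ρ) / A) ∪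
    ((T ×ˢ Z).image fun p : ℝ × ℤ => (p.1 + p.2 - ρ) / A) with hT'
  refine ⟨T', ?_, ?_⟩
  · calc T'.card ≤ (Z.image fun z : ℤ => ((z : ℝ) - ρ) / A).card +
          ((T ×ˢ Z).image fun p : ℝ × ℤ => (p.1 + p.2 - ρ) / A).card := Finset.card_union_le _ _
      _ ≤ Z.card + (T ×ˢ Z).card := add_le_add Finset.card_image_le Finset.card_image_le
      _ = (T.card + 1) * Z.card := by rw [Finset.card_product]; ring
      _ ≤ (T.card + 1) * (A.natAbs + 3) := Nat.mul_le_mul_left _ hZcard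
  intro x hx hxT'
  -- `A x + ρ ∉ ℤ` and `{A x + ρ} ∉ T`
  have hnotint : ∀ z : ℤ, (A : ℝ) * x + ρ ≠ z := by
    intro z hz
    apply hxT'
    rw [hT', Finset.mem_union]
    refine Or.inl (Finset.mem_image.mpr ⟨z, (hZmem x hx).2 z hz, ?_⟩)
    field_simp; linarith
  have hnotT : Int.fract ((A : ℝ) * x + ρ) ∉ T := by
    intro hmem
    apply hxT'
    rw [hT', Finset.mem_union]
    refine Or.inr (Finset.mem_image.mpr ⟨(Int.fract ((A : ℝ) * x + ρ), ⌊(A : ℝ) * x + ρ⌋),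
      Finset.mem_product.mpr ⟨hmem, (hZmem x hx).1⟩, ?_⟩)
    have := Int.floor_add_fract ((A : ℝ) * x + ρ)
    field_simp; linarith
  -- `fract (A y + ρ) = A y + ρ - ⌊A x + ρ⌋` near `x`
  have hfloor : ∀ᶠ y in 𝓝 x, ⌊(A : ℝ) * y + ρ⌋ = ⌊(A : ℝ) * x + ρ⌋ := by
    have hcont : ContinuousAt (fun y : ℝ => (A : ℝ) * y + ρ) x := by fun_prop
    have h1 : ∀ᶠ t in 𝓝 ((A : ℝ) * x + ρ), ⌊t⌋ = ⌊(A : ℝ) * x + ρ⌋ := by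
      have hlt : (⌊(A : ℝ) * x + ρ⌋ : ℝ) < (A : ℝ) * x + ρ :=
        lt_of_le_of_ne (Int.floor_le _) (fun h => hnotint _ h.symm)
      have hlt2 : (A : ℝ) * x + ρ < ⌊(A : ℝ) * x + ρ⌋ + 1 := Int.lt_floor_add_one _
      filter_upwards [lt_mem_nhds hlt, gt_mem_nhds hlt2] with t ht1 ht2
      rw [Int.floor_eq_iff]; exact ⟨ht1.le, ht2⟩
    exact hcont.eventually h1
  have hfract_mem : Int.fract ((A : ℝ) * x + ρ) ∈ Set.Icc (0 : ℝ) 1 :=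
    ⟨Int.fract_nonneg _, (Int.fract_lt_one _).le⟩
  have hfev := hf _ hfract_mem hnotT
  have hcontφ : ContinuousAt (fun y : ℝ => Int.fract ((A : ℝ) * y + ρ)) x := by
    have : (fun y : ℝ => Int.fract ((A : ℝ) * y + ρ)) =ᶠ[𝓝 x]
        fun y => (A : ℝ) * y + ρ - ⌊(A : ℝ) * x + ρ⌋ := by
      filter_upwards [hfloor] with y hy
      rw [Int.fract, hy]
    refine (ContinuousAt.congr_of_eventuallyEq ?_ this)
    fun_prop
  have hpull := hcontφ.eventually hfev
  filter_upwards [hpull, hfloor] with y hy hyfl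
  have hφy : Int.fract ((A : ℝ) * y + ρ) = Int.fract ((A : ℝ) * x + ρ) + A * (y - x) := by
    rw [Int.fract, Int.fract, hyfl]; ring
  -- rewrite `e(-Aκ y) = e(-κ φ(y)) · e(κ φ(x) - Aκ x)` using `hφy`
  have hey : cexp (2 * π * I * ((-((A * κ) * y) : ℝ) : ℂ)) =
      cexp (2 * π * I * ((-(κ * Int.fract ((A : ℝ) * y + ρ)) : ℝ) : ℂ)) *
        cexp (2 * π * I * ((κ * Int.fract ((A : ℝ) * x + ρ) - (A * κ) * x : ℝ) : ℂ)) := by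
    rw [← e_add]; congr 1; rw [hφy]; push_cast; ring
  have hex : cexp (2 * π * I * ((-((A * κ) * x) : ℝ) : ℂ)) =
      cexp (2 * π * I * ((-(κ * Int.fract ((A : ℝ) * x + ρ)) : ℝ) : ℂ)) *
        cexp (2 * π * I * ((κ * Int.fract ((A : ℝ) * x + ρ) - (A * κ) * x : ℝ) : ℂ)) := by
    rw [← e_add]; congr 1; push_cast; ring
  rw [hey, hex, ← mul_assoc, ← mul_assoc, hy]

/-! ### K. Resonances in the independent case (`1, α, β` linearly independent over `ℚ`) -/

/-- Rational version of the independence hypothesis. [folklore] -/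
theorem rat_indep_of_int_indep {α β : ℝ}
    (hind : ∀ k l j : ℤ, (k : ℝ) * α + l * β = j → k = 0 ∧ l = 0)
    (q₀ q₁ q₂ : ℚ) (h : (q₀ : ℝ) + q₁ * α + q₂ * β = 0) : q₀ = 0 ∧ q₁ = 0 ∧ q₂ = 0 := by
  -- clear denominators with `D = q₀.den * q₁.den * q₂.den`
  set D : ℤ := (q₀.den : ℤ) * q₁.den * q₂.den with hD
  have hD0 : D ≠ 0 := by
    rw [hD]; exact mul_ne_zero (mul_ne_zero (by exact_mod_cast q₀.den_nz)
      (by exact_mod_cast q₁.den_nz)) (by exact_mod_cast q₂.den_nz)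
  have hq : ∀ q : ℚ, ((q * q.den : ℚ) : ℝ) = (q.num : ℝ) := fun q => by
    exact_mod_cast Rat.mul_den_eq_num q
  -- integers `kᵢ = qᵢ D`
  set k₀ : ℤ := q₀.num * q₁.den * q₂.den with hk₀
  set k₁ : ℤ := q₁.num * q₀.den * q₂.den with hk₁
  set k₂ : ℤ := q₂.num * q₀.den * q₁.den with hk₂
  have e₀ : (k₀ : ℝ) = q₀ * D := by
    rw [hk₀, hD]; push_cast; rw [← hq q₀]; push_cast; ring
  have e₁ : (k₁ : ℝ) = q₁ * D := by
    rw [hk₁, hD]; push_cast; rw [← hq q₁]; push_cast; ring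
  have e₂ : (k₂ : ℝ) = q₂ * D := by
    rw [hk₂, hD]; push_cast; rw [← hq q₂]; push_cast; ring
  have hrel : (k₁ : ℝ) * α + k₂ * β = ((-k₀ : ℤ) : ℝ) := by
    push_cast; rw [e₀, e₁, e₂]
    have : ((q₀ : ℝ) + q₁ * α + q₂ * β) * D = 0 := by rw [h, zero_mul]
    linarith
  obtain ⟨h1, h2⟩ := hind k₁ k₂ (-k₀) hrel
  have hDR : (D : ℝ) ≠ 0 := by exact_mod_cast hD0
  have hq₁ : q₁ = 0 := by
    have : (q₁ : ℝ) * D = 0 := by rw [← e₁]; exact_mod_cast h1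
    exact_mod_cast (mul_eq_zero.mp this).resolve_right hDR
  have hq₂ : q₂ = 0 := by
    have : (q₂ : ℝ) * D = 0 := by rw [← e₂]; exact_mod_cast h2
    exact_mod_cast (mul_eq_zero.mp this).resolve_right hDR
  refine ⟨?_, hq₁, hq₂⟩
  have : (q₀ : ℝ) = 0 := by rw [hq₁, hq₂] at h; simpa using h
  exact_mod_cast this

/-- **Resonances in the independent case.** Let `α, β > 0` with `1, α, β` linearly independent over
`ℚ`, `γ` irrational, and assume the exceptional configuration of Håland's Proposition 1.2 does not
occur: there is no positive rational `c` with `(α/β)² = c` and `γ ∈ ℚ + ℚ(α/β)`. For the shift `h`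
and the piece `(i, j)` put `m₁ = ⌊βh⌋ + j`, `m₂ = ⌊αh⌋ + i`, `λ = γ(m₁α + m₂β)`. Then for every `M`,
for all large `h`, every resonance `λ + kα + lβ ∈ ℤ` has `|γm₁ + k| ≥ M` or `|γm₂ + l| ≥ M`.
(If `γα, γβ ∉ ℚ + ℚα + ℚβ`, two resonances with non-proportional `(m₁, m₂)` would express `γα, γβ`
rationally, and proportional ones only occur for bounded `h` since `α/β ∉ ℚ`; if `γα = r₀ + r₁α + r₂β`,
`γβ = s₀ + s₁α + s₂β`, then `k, l` are forced and `α(γm₁ + k) = −h(s₁α² − r₀β − r₂β²) + O(1)`,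
`β(γm₂ + l) = −h(r₂β² − s₀α − s₁α²) + O(1)`; both slopes vanish only if `r₀ = s₀ = 0` and
`s₁(α/β)² = r₂`, i.e. in the excluded configuration.) [cite: Haland1994, Prop. 1.2] -/
theorem key_indep {α β γ : ℝ} (hα : 0 < α) (hβ : 0 < β)
    (hind : ∀ k l j : ℤ, (k : ℝ) * α + l * β = j → k = 0 ∧ l = 0)
    (hγ : Irrational γ)
    (hbad : ∀ c : ℚ, 0 < c → (α / β) ^ 2 = c →
      γ ∈ Submodule.span ℚ ({1, α / β} : Set ℝ) → False)
    (M : ℝ) :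
    ∃ h₀ : ℕ, ∀ h : ℕ, h₀ ≤ h → ∀ p ∈ ({0, 1} ×ˢ {0, 1} : Finset (ℕ × ℕ)), ∀ k l j : ℤ,
      γ * ((⌊β * h⌋ + p.2) * α + (⌊α * h⌋ + p.1) * β) + k * α + l * β = j →
        M ≤ |γ * (⌊β * h⌋ + p.2) + k| ∨ M ≤ |γ * (⌊α * h⌋ + p.1) + l| := by
  have hθ : 0 < α / β := div_pos hα hβ
  -- sizes of the carries
  have hpiece : ∀ p ∈ ({0, 1} ×ˢ {0, 1} : Finset (ℕ × ℕ)), (p.1 : ℝ) ≤ 1 ∧ (p.2 : ℝ) ≤ 1 := by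
    intro p hp
    simp only [Finset.mem_product, Finset.mem_insert, Finset.mem_singleton] at hp
    obtain ⟨h1, h2⟩ := hp
    constructor
    · rcases h1 with h | h <;> simp [h]
    · rcases h2 with h | h <;> simp [h]
  have hτ : ∀ (θ : ℝ) (h : ℕ) (e : ℕ), (e : ℝ) ≤ 1 →
      |((⌊θ * h⌋ : ℤ) : ℝ) + e - θ * h| ≤ 1 := by
    intro θ h e he
    have h1 := Int.floor_le (θ * h)
    have h2 := Int.lt_floor_add_one (θ * h)
    have h3 : (0 : ℝ) ≤ e := Nat.cast_nonneg e
    rw [abs_le]; constructor <;> linarith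
  by_cases hfull : ∃ r₀ r₁ r₂ s₀ s₁ s₂ : ℚ,
      γ * α = r₀ + r₁ * α + r₂ * β ∧ γ * β = s₀ + s₁ * α + s₂ * β
  · -- Case (a2): fully resonant
    obtain ⟨r₀, r₁, r₂, s₀, s₁, s₂, hγα, hγβ⟩ := hfull
    set D₁ : ℝ := s₁ * α ^ 2 - r₀ * β - r₂ * β ^ 2 with hD₁
    set D₂ : ℝ := r₂ * β ^ 2 - s₀ * α - s₁ * α ^ 2 with hD₂
    set C₁ : ℝ := |(r₀ : ℝ)| + |(r₂ : ℝ)| * β + |(s₁ : ℝ)| * α with hC₁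
    set C₂ : ℝ := |(s₀ : ℝ)| + |(s₁ : ℝ)| * α + |(r₂ : ℝ)| * β with hC₂
    -- the forced values of `k, l` and the resulting identities
    have hforced : ∀ (h : ℕ) (p : ℕ × ℕ) (k l j : ℤ),
        γ * ((⌊β * h⌋ + p.2) * α + (⌊α * h⌋ + p.1) * β) + k * α + l * β = j →
        α * (γ * (⌊β * h⌋ + p.2) + k) = (⌊β * h⌋ + p.2 : ℝ) * r₀ + (⌊β * h⌋ + p.2 : ℝ) * r₂ * β -
            (⌊α * h⌋ + p.1 : ℝ) * s₁ * α ∧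
        β * (γ * (⌊α * h⌋ + p.1) + l) = (⌊α * h⌋ + p.1 : ℝ) * s₀ + (⌊α * h⌋ + p.1 : ℝ) * s₁ * α -
            (⌊β * h⌋ + p.2 : ℝ) * r₂ * β := by
      intro h p k l j hres
      set m₁ : ℝ := ⌊β * h⌋ + p.2 with hm₁
      set m₂ : ℝ := ⌊α * h⌋ + p.1 with hm₂
      -- integrality of `m₁, m₂` as rationals
      obtain ⟨M₁, hM₁⟩ : ∃ M₁ : ℤ, (M₁ : ℝ) = m₁ := ⟨⌊β * h⌋ + p.2, by push_cast; rfl⟩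
      obtain ⟨M₂, hM₂⟩ : ∃ M₂ : ℤ, (M₂ : ℝ) = m₂ := ⟨⌊α * h⌋ + p.1, by push_cast; rfl⟩
      have hexp : γ * (m₁ * α + m₂ * β) = m₁ * (r₀ + r₁ * α + r₂ * β) + m₂ * (s₀ + s₁ * α + s₂ * β) := by
        rw [← hγα, ← hγβ]; ring
      -- the rational relation
      have hrel : (((M₁ * r₀ + M₂ * s₀ - j : ℚ)) : ℝ) + ((M₁ * r₁ + M₂ * s₁ + k : ℚ) : ℝ) * α +
          ((M₁ * r₂ + M₂ * s₂ + l : ℚ) : ℝ) * β = 0 := by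
        push_cast; rw [hM₁, hM₂]
        have : γ * (m₁ * α + m₂ * β) + k * α + l * β - j = 0 := by rw [← hres]; ring
        rw [hexp] at this; linarith
      obtain ⟨_, h1, h2⟩ := rat_indep_of_int_indep hind _ _ _ hrel
      have hk : (k : ℝ) = -(m₁ * r₁ + m₂ * s₁) := by
        have : ((M₁ * r₁ + M₂ * s₁ + k : ℚ) : ℝ) = 0 := by exact_mod_cast h1
        push_cast at this; rw [hM₁, hM₂] at this; linarith
      have hl : (l : ℝ) = -(m₁ * r₂ + m₂ * s₂) := by
        have : ((M₁ * r₂ + M₂ * s₂ + l : ℚ) : ℝ) = 0 := by exact_mod_cast h2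
        push_cast at this; rw [hM₁, hM₂] at this; linarith
      constructor
      · rw [hk]
        have : α * (γ * m₁) = m₁ * (r₀ + r₁ * α + r₂ * β) := by rw [← hγα]; ring
        linear_combination this
      · rw [hl]
        have : β * (γ * m₂) = m₂ * (s₀ + s₁ * α + s₂ * β) := by rw [← hγβ]; ring
        linear_combination this
    -- Sub-case analysis on the slopes
    by_cases hD : D₁ = 0 ∧ D₂ = 0
    · -- the excluded configuration: derive a contradiction
      exfalso
      obtain ⟨hD₁0, hD₂0⟩ := hD
      have hsum : (r₀ : ℝ) * β + s₀ * α = 0 := by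
        have : D₁ + D₂ = 0 := by rw [hD₁0, hD₂0, add_zero]
        rw [hD₁, hD₂] at this; linarith
      obtain ⟨_, hs₀, hr₀⟩ := rat_indep_of_int_indep hind 0 s₀ r₀ (by push_cast; linarith)
      have hr₀' : (r₀ : ℝ) = 0 := by exact_mod_cast hr₀
      have hs₀' : (s₀ : ℝ) = 0 := by exact_mod_cast hs₀
      have hsq : (s₁ : ℝ) * α ^ 2 = r₂ * β ^ 2 := by
        have := hD₁0; rw [hD₁, hr₀'] at this; linarith
      by_cases hs₁ : s₁ = 0
      · -- then `r₂ = 0` and `γ = r₁ ∈ ℚ`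
        have hs₁' : (s₁ : ℝ) = 0 := by exact_mod_cast hs₁
        have hr₂ : (r₂ : ℝ) = 0 := by
          rw [hs₁', zero_mul] at hsq
          have : (r₂ : ℝ) * β ^ 2 = 0 := hsq.symm
          rcases mul_eq_zero.mp this with h | h
          · exact h
          · exfalso; exact absurd (pow_eq_zero_iff two_ne_zero |>.mp h) hβ.ne'
        have : γ = r₁ := by
          have h1 : γ * α = r₁ * α := by rw [hγα, hr₀', hr₂]; ring
          exact mul_right_cancel₀ hα.ne' h1
        exact hγ ⟨r₁, this.symm⟩
      · -- then `(α/β)² = r₂/s₁` and `γ = r₁ + s₁ (α/β)`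
        have hs₁' : (s₁ : ℝ) ≠ 0 := by exact_mod_cast hs₁
        have hc : (α / β) ^ 2 = ((r₂ / s₁ : ℚ) : ℝ) := by
          push_cast; field_simp; linarith
        have hcpos : (0 : ℚ) < r₂ / s₁ := by
          have : (0 : ℝ) < ((r₂ / s₁ : ℚ) : ℝ) := by rw [← hc]; positivity
          exact_mod_cast this
        refine hbad (r₂ / s₁) hcpos hc ?_
        rw [Submodule.mem_span_pair]
        refine ⟨r₁, s₁, ?_⟩
        simp only [Rat.smul_def, mul_one]
        -- `γ α = r₁ α + r₂ β` and `s₁ α² = r₂ β²` give `γ = r₁ + s₁ α/β`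
        have h1 : γ * α = r₁ * α + r₂ * β := by rw [hγα, hr₀']; ring
        have hβne := hβ.ne'
        have hαne := hα.ne'
        field_simp
        nlinarith [h1, hsq, hα, hβ]
    · -- generic sub-case: one slope is non-zero, linear growth
      rw [not_and_or] at hD
      have hEbound : ∀ (τ₁ τ₂ a b c x y : ℝ), |τ₁| ≤ 1 → |τ₂| ≤ 1 → 0 ≤ x → 0 ≤ y →
          |τ₁ * a + τ₁ * b * x - τ₂ * c * y| ≤ |a| + |b| * x + |c| * y := by
        intro τ₁ τ₂ a b c x y h1 h2 hx hy
        have e1 : |τ₁ * a| ≤ |a| := by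
          rw [abs_mul]; exact mul_le_of_le_one_left (abs_nonneg _) h1
        have e2 : |τ₁ * b * x| ≤ |b| * x := by
          rw [abs_mul, abs_mul, abs_of_nonneg hx]
          calc |τ₁| * |b| * x ≤ 1 * |b| * x := by gcongr
            _ = |b| * x := by ring
        have e3 : |τ₂ * c * y| ≤ |c| * y := by
          rw [abs_mul, abs_mul, abs_of_nonneg hy]
          calc |τ₂| * |c| * y ≤ 1 * |c| * y := by gcongr
            _ = |c| * y := by ring
        calc |τ₁ * a + τ₁ * b * x - τ₂ * c * y|
            ≤ |τ₁ * a + τ₁ * b * x| + |τ₂ * c * y| := abs_sub _ _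
          _ ≤ |τ₁ * a| + |τ₁ * b * x| + |τ₂ * c * y| := by gcongr; exact abs_add_le _ _
          _ ≤ |a| + |b| * x + |c| * y := by linarith
      rcases hD with hD₁ne | hD₂ne
      · have hD₁pos : 0 < |D₁| := abs_pos.mpr hD₁ne
        obtain ⟨h₀, hh₀⟩ := exists_nat_ge ((M * α + C₁) / |D₁|)
        refine ⟨h₀, fun h hh p hp k l j hres => Or.inl ?_⟩
        obtain ⟨hk, _⟩ := hforced h p k l j hres
        obtain ⟨hp1, hp2⟩ := hpiece p hp
        have hτ₁ := hτ β h p.2 hp2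
        have hτ₂ := hτ α h p.1 hp1
        have hrew : α * (γ * (⌊β * h⌋ + p.2) + k) = -(h * D₁) +
            ((((⌊β * h⌋ : ℤ) : ℝ) + p.2 - β * h) * r₀ + (((⌊β * h⌋ : ℤ) : ℝ) + p.2 - β * h) * r₂ * β -
              (((⌊α * h⌋ : ℤ) : ℝ) + p.1 - α * h) * s₁ * α) := by
          rw [hk, hD₁]; ring
        have hE := hEbound _ _ (r₀ : ℝ) (r₂ : ℝ) (s₁ : ℝ) β α hτ₁ hτ₂ hβ.le hα.le
        have hh' : (M * α + C₁) / |D₁| ≤ h := hh₀.trans (by exact_mod_cast hh)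
        rw [div_le_iff₀ hD₁pos] at hh'
        have habs : (h : ℝ) * |D₁| - C₁ ≤ |α * (γ * (⌊β * h⌋ + p.2) + k)| := by
          rw [hrew]
          have h1 := abs_sub_abs_le_abs_sub (-(h * D₁))
            (-((((⌊β * h⌋ : ℤ) : ℝ) + p.2 - β * h) * r₀ + (((⌊β * h⌋ : ℤ) : ℝ) + p.2 - β * h) * r₂ * β -
              (((⌊α * h⌋ : ℤ) : ℝ) + p.1 - α * h) * s₁ * α))
          rw [sub_neg_eq_add, abs_neg, abs_neg, abs_mul, Nat.abs_cast] at h1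
          rw [hC₁]; linarith
        rw [abs_mul, abs_of_pos hα] at habs
        have hfin : α * M ≤ α * |γ * (⌊β * h⌋ + p.2) + k| := by linarith
        exact le_of_mul_le_mul_left hfin hα
      · have hD₂pos : 0 < |D₂| := abs_pos.mpr hD₂ne
        obtain ⟨h₀, hh₀⟩ := exists_nat_ge ((M * β + C₂) / |D₂|)
        refine ⟨h₀, fun h hh p hp k l j hres => Or.inr ?_⟩
        obtain ⟨_, hl⟩ := hforced h p k l j hres
        obtain ⟨hp1, hp2⟩ := hpiece p hp
        have hτ₁ := hτ β h p.2 hp2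
        have hτ₂ := hτ α h p.1 hp1
        have hrew : β * (γ * (⌊α * h⌋ + p.1) + l) = -(h * D₂) +
            ((((⌊α * h⌋ : ℤ) : ℝ) + p.1 - α * h) * s₀ + (((⌊α * h⌋ : ℤ) : ℝ) + p.1 - α * h) * s₁ * α -
              (((⌊β * h⌋ : ℤ) : ℝ) + p.2 - β * h) * r₂ * β) := by
          rw [hl, hD₂]; ring
        have hE := hEbound _ _ (s₀ : ℝ) (s₁ : ℝ) (r₂ : ℝ) α β hτ₂ hτ₁ hα.le hβ.le
        have hh' : (M * β + C₂) / |D₂| ≤ h := hh₀.trans (by exact_mod_cast hh)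
        rw [div_le_iff₀ hD₂pos] at hh'
        have habs : (h : ℝ) * |D₂| - C₂ ≤ |β * (γ * (⌊α * h⌋ + p.1) + l)| := by
          rw [hrew]
          have h1 := abs_sub_abs_le_abs_sub (-(h * D₂))
            (-((((⌊α * h⌋ : ℤ) : ℝ) + p.1 - α * h) * s₀ + (((⌊α * h⌋ : ℤ) : ℝ) + p.1 - α * h) * s₁ * α -
              (((⌊β * h⌋ : ℤ) : ℝ) + p.2 - β * h) * r₂ * β))
          rw [sub_neg_eq_add, abs_neg, abs_neg, abs_mul, Nat.abs_cast] at h1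
          rw [hC₂]; linarith
        rw [abs_mul, abs_of_pos hβ] at habs
        have hfin : β * M ≤ β * |γ * (⌊α * h⌋ + p.1) + l| := by linarith
        exact le_of_mul_le_mul_left hfin hβ
  · -- Case (a1): not fully resonant; resonances only occur for bounded `h`
    -- beyond `H₁`, the carry `m₁ = ⌊βh⌋ + j ≥ 1`
    obtain ⟨H₁, hH₁⟩ := exists_nat_gt (1 / β)
    have hm₁pos : ∀ h : ℕ, H₁ ≤ h → ∀ e : ℕ, (1 : ℝ) ≤ ⌊β * h⌋ + e := by
      intro h hh e
      have h1 : (1 : ℝ) ≤ β * h := by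
        have : (1 / β : ℝ) < h := hH₁.trans_le (by exact_mod_cast hh)
        rw [div_lt_iff₀ hβ] at this; linarith
      have h2 : (1 : ℤ) ≤ ⌊β * h⌋ := Int.le_floor.mpr (by exact_mod_cast h1)
      have h3 : (1 : ℝ) ≤ ⌊β * h⌋ := by exact_mod_cast h2
      have h4 : (0 : ℝ) ≤ e := Nat.cast_nonneg e
      linarith
    by_cases hex : ∃ h₁ : ℕ, H₁ ≤ h₁ ∧ ∃ p₁ ∈ ({0, 1} ×ˢ {0, 1} : Finset (ℕ × ℕ)),
        ∃ k₁ l₁ j₁ : ℤ,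
          γ * ((⌊β * h₁⌋ + p₁.2) * α + (⌊α * h₁⌋ + p₁.1) * β) + k₁ * α + l₁ * β = j₁
    · obtain ⟨h₁, hh₁, p₁, hp₁, k₁, l₁, j₁, hres₁⟩ := hex
      set n₁ : ℝ := ⌊β * h₁⌋ + p₁.2 with hn₁
      set n₂ : ℝ := ⌊α * h₁⌋ + p₁.1 with hn₂
      obtain ⟨N₁, hN₁⟩ : ∃ N₁ : ℤ, (N₁ : ℝ) = n₁ := ⟨⌊β * h₁⌋ + p₁.2, by push_cast; rfl⟩
      obtain ⟨N₂, hN₂⟩ : ∃ N₂ : ℤ, (N₂ : ℝ) = n₂ := ⟨⌊α * h₁⌋ + p₁.1, by push_cast; rfl⟩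
      have hn₁pos : 1 ≤ n₁ := hm₁pos h₁ hh₁ p₁.2
      -- `c₀ = |β n₂ - α n₁| > 0`
      have hc₀ : β * n₂ - α * n₁ ≠ 0 := by
        intro h0
        have := hind N₁ (-N₂) 0 (by push_cast; rw [hN₁, hN₂]; linarith)
        have : (N₁ : ℝ) = 0 := by exact_mod_cast this.1
        rw [hN₁] at this; linarith
      have hc₀pos : 0 < |β * n₂ - α * n₁| := abs_pos.mpr hc₀
      obtain ⟨H₂, hH₂⟩ := exists_nat_gt ((|n₁| + |n₂|) / |β * n₂ - α * n₁|)
      refine ⟨max H₁ H₂, fun h hh p hp k l j hres => ?_⟩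
      exfalso
      have hhH₁ : H₁ ≤ h := le_trans (le_max_left _ _) hh
      have hhH₂ : H₂ ≤ h := le_trans (le_max_right _ _) hh
      set m₁ : ℝ := ⌊β * h⌋ + p.2 with hm₁
      set m₂ : ℝ := ⌊α * h⌋ + p.1 with hm₂
      obtain ⟨M₁, hM₁⟩ : ∃ M₁ : ℤ, (M₁ : ℝ) = m₁ := ⟨⌊β * h⌋ + p.2, by push_cast; rfl⟩
      obtain ⟨M₂, hM₂⟩ : ∃ M₂ : ℤ, (M₂ : ℝ) = m₂ := ⟨⌊α * h⌋ + p.1, by push_cast; rfl⟩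
      by_cases hdet : m₁ * n₂ - m₂ * n₁ = 0
      · -- proportional: forces `h` small
        obtain ⟨hp1, hp2⟩ := hpiece p hp
        have hτ₁ := hτ β h p.2 hp2
        have hτ₂ := hτ α h p.1 hp1
        have hid : (h : ℝ) * (β * n₂ - α * n₁) =
            -((((⌊β * h⌋ : ℤ) : ℝ) + p.2 - β * h) * n₂ - (((⌊α * h⌋ : ℤ) : ℝ) + p.1 - α * h) * n₁) := by
          have : m₁ * n₂ - m₂ * n₁ = 0 := hdet
          rw [hm₁, hm₂] at this
          linarith
        have hbd : (h : ℝ) * |β * n₂ - α * n₁| ≤ |n₁| + |n₂| := by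
          rw [← Nat.abs_cast h, ← abs_mul, hid, abs_neg]
          calc |(((⌊β * h⌋ : ℤ) : ℝ) + p.2 - β * h) * n₂ - (((⌊α * h⌋ : ℤ) : ℝ) + p.1 - α * h) * n₁|
              ≤ |(((⌊β * h⌋ : ℤ) : ℝ) + p.2 - β * h) * n₂| + |(((⌊α * h⌋ : ℤ) : ℝ) + p.1 - α * h) * n₁| :=
                abs_sub _ _
            _ ≤ 1 * |n₂| + 1 * |n₁| := by
                rw [abs_mul, abs_mul]; gcongr
            _ = |n₁| + |n₂| := by ring
        have hlt : (|n₁| + |n₂|) / |β * n₂ - α * n₁| < h := hH₂.trans_le (by exact_mod_cast hhH₂)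
        rw [div_lt_iff₀ hc₀pos] at hlt
        linarith
      · -- non-proportional: Cramer's rule expresses `γα, γβ` rationally
        apply hfull
        have hdetR : (M₁ : ℝ) * N₂ - M₂ * N₁ ≠ 0 := by
          rw [hM₁, hM₂, hN₁, hN₂]; exact hdet
        have hres' : γ * (m₁ * α + m₂ * β) + k * α + l * β = j := hres
        have hres₁' : γ * (n₁ * α + n₂ * β) + k₁ * α + l₁ * β = j₁ := hres₁
        refine ⟨((N₂ * j - M₂ * j₁ : ℤ) : ℚ) / (M₁ * N₂ - M₂ * N₁ : ℤ),
          ((-N₂ * k + M₂ * k₁ : ℤ) : ℚ) / (M₁ * N₂ - M₂ * N₁ : ℤ),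
          ((-N₂ * l + M₂ * l₁ : ℤ) : ℚ) / (M₁ * N₂ - M₂ * N₁ : ℤ),
          ((M₁ * j₁ - N₁ * j : ℤ) : ℚ) / (M₁ * N₂ - M₂ * N₁ : ℤ),
          ((-M₁ * k₁ + N₁ * k : ℤ) : ℚ) / (M₁ * N₂ - M₂ * N₁ : ℤ),
          ((-M₁ * l₁ + N₁ * l : ℤ) : ℚ) / (M₁ * N₂ - M₂ * N₁ : ℤ), ?_, ?_⟩
        · push_cast
          rw [div_mul_eq_mul_div, div_mul_eq_mul_div, ← add_div, ← add_div, eq_div_iff hdetR,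
            hM₁, hM₂, hN₁, hN₂]
          linear_combination n₂ * hres' - m₂ * hres₁'
        · push_cast
          rw [div_mul_eq_mul_div, div_mul_eq_mul_div, ← add_div, ← add_div, eq_div_iff hdetR,
            hM₁, hM₂, hN₁, hN₂]
          linear_combination m₁ * hres₁' - n₁ * hres'
    · refine ⟨H₁, fun h hh p hp k l j hres => ?_⟩
      exfalso
      exact hex ⟨h, hh, p, hp, k, l, j, hres⟩

/-! ### L. Fourier coefficients of locally exponential functions -/

/-- **Decay of the Fourier coefficients of a locally exponential function**: if `f·e(−κ·)` is locally
constant on `[0, 1]` off `T` (`‖f‖ ≤ 1`, measurable), then for an integer `k ≠ κ`,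
`‖∫₀¹ f(x)e(−kx)dx‖ ≤ (|T| + 1)/(π|κ − k|)`. [folklore] -/
theorem norm_fourierCoeff_le_of_locally_e {f : ℝ → ℂ} {κ : ℝ} (T : Finset ℝ)
    (hf1 : ∀ x, ‖f x‖ ≤ 1) (hfm : Measurable f)
    (hloc : ∀ x ∈ Set.Icc (0 : ℝ) 1, x ∉ T →
      ∀ᶠ y in 𝓝 x, f y * cexp (2 * π * I * ((-(κ * y) : ℝ) : ℂ)) =
        f x * cexp (2 * π * I * ((-(κ * x) : ℝ) : ℂ)))
    (k : ℤ) (hk : κ - k ≠ 0) :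
    ‖∫ x in (0 : ℝ)..1, f x * cexp (2 * π * I * ((-((k : ℝ) * x) : ℝ) : ℂ))‖ ≤
      (T.card + 1) / (π * |κ - k|) := by
  refine norm_integral_le_of_locally_e hk T (fun x => ?_) ?_ ?_
  · rw [norm_mul, norm_e, mul_one]; exact hf1 x
  · refine intervalIntegrable_of_norm_le_one (hfm.mul (by fun_prop)) (fun x => ?_) 0 1
    show ‖f x * cexp _‖ ≤ 1
    rw [norm_mul, norm_e, mul_one]; exact hf1 x
  · intro x hx hxT
    filter_upwards [hloc x hx hxT] with y hy
    have hsplit : ∀ z : ℝ, cexp (2 * π * I * ((-((k : ℝ) * z) : ℝ) : ℂ)) *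
        cexp (2 * π * I * ((-((κ - k) * z) : ℝ) : ℂ)) = cexp (2 * π * I * ((-(κ * z) : ℝ) : ℂ)) := by
      intro z; rw [← e_add]; congr 1; push_cast; ring
    rw [mul_assoc (f y), hsplit, mul_assoc (f x), hsplit, hy]

/-! ### M. The independent case assembled -/

/-- Integer independence of `1, α, β` makes `α` irrational. [folklore] -/
theorem irrational_of_indep_left {α β : ℝ}
    (hind : ∀ k l j : ℤ, (k : ℝ) * α + l * β = j → k = 0 ∧ l = 0) : Irrational α := by
  rintro ⟨q, hq⟩
  have h := hind q.den 0 q.num (by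
    rw [← hq]; push_cast
    have h' : ((q * q.den : ℚ) : ℝ) = (q.num : ℝ) := by exact_mod_cast Rat.mul_den_eq_num q
    push_cast at h'; linarith)
  exact q.den_nz (by exact_mod_cast h.1)

/-- Integer independence of `1, α, β` makes `β` irrational. [folklore] -/
theorem irrational_of_indep_right {α β : ℝ}
    (hind : ∀ k l j : ℤ, (k : ℝ) * α + l * β = j → k = 0 ∧ l = 0) : Irrational β := by
  refine irrational_of_indep_left (α := β) (β := α) fun k l j h => ?_
  have := hind l k j (by linarith)
  exact ⟨this.2, this.1⟩

/-- **The independent case of the sufficiency half of Håland's Proposition 1.2.** Let `α, β > 0`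
with `1, α, β` linearly independent over `ℚ`, `γ` irrational, and not in the exceptional
configuration `(α/β)² = c ∈ ℚ₊ ∧ γ ∈ ℚ + ℚ(α/β)`. Then the Weyl sums of `γ⌊αn⌋⌊βn⌋` at frequency
`1` are `o(N)`. (Strengthened van der Corput; the correlation at lag `h` splits into four twisted
sums, each eventually `≤ (2/(πM) + η/8)N` by `twisted_sum_eventually_le` and `key_indep`.)
[cite: Haland1994, Prop. 1.2] -/
theorem isLittleO_floor_mul_floor_indep {α β γ : ℝ} (hα : 0 < α) (hβ : 0 < β)
    (hind : ∀ k l j : ℤ, (k : ℝ) * α + l * β = j → k = 0 ∧ l = 0)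
    (hγ : Irrational γ)
    (hbad : ∀ c : ℚ, 0 < c → (α / β) ^ 2 = c →
      γ ∈ Submodule.span ℚ ({1, α / β} : Set ℝ) → False)
    (trigApprox : ∀ (G : C(AddCircle (2 * Real.pi), ℂ)) {ε : ℝ}, 0 < ε →
      ∃ (s : Finset ℤ) (c : ℤ → ℂ),
        ∀ t : ℝ, ‖G (t : AddCircle (2 * Real.pi)) - ∑ k ∈ s, c k * cexp (k * t * I)‖ ≤ ε) :
    (fun N : ℕ => ∑ n ∈ range N, cexp (2 * π * I * ((⌊α * n⌋ * ⌊β * n⌋ * γ : ℝ) : ℂ)))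
      =o[atTop] fun N : ℕ => (N : ℝ) := by
  have hπ := Real.pi_pos
  have hαi := irrational_of_indep_left hind
  have hβi := irrational_of_indep_right hind
  refine isLittleO_sum_e_of_corr_eventually_small (x := fun n : ℕ => (⌊α * n⌋ * ⌊β * n⌋ * γ : ℝ))
    fun η hη => ?_
  set M : ℝ := 16 / (π * η) with hM
  have hMpos : 0 < M := by positivity
  obtain ⟨h₀, hkey⟩ := key_indep hα hβ hind hγ hbad M
  refine ⟨h₀, fun h hh => ?_⟩
  set B : ℝ := 2 / (π * M) with hBdef
  have hB0 : 0 ≤ B := by positivity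
  -- each piece is eventually small
  have hpieces : ∀ p ∈ ({0, 1} ×ˢ {0, 1} : Finset (ℕ × ℕ)), ∀ᶠ N : ℕ in atTop,
      ‖∑ n ∈ range N,
          cexp (2 * π * I * ((γ * ((⌊β * h⌋ + p.2) * α + (⌊α * h⌋ + p.1) * β) * n : ℝ) : ℂ)) *
          ((if (1 ≤ Int.fract (α * h) + Int.fract (α * n) ↔ p.1 = 1) then 1 else 0) *
            cexp (2 * π * I * ((-(γ * (⌊β * h⌋ + p.2)) * Int.fract (α * n) : ℝ) : ℂ))) *
          ((if (1 ≤ Int.fract (β * h) + Int.fract (β * n) ↔ p.2 = 1) then 1 else 0) *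
            cexp (2 * π * I * ((-(γ * (⌊α * h⌋ + p.1)) * Int.fract (β * n) : ℝ) : ℂ)))‖ ≤
        (B + η / 8) * N := by
    intro p hp
    set Λ : ℝ := γ * ((⌊β * h⌋ + p.2) * α + (⌊α * h⌋ + p.1) * β) with hΛ
    set κ₁ : ℝ := -(γ * (⌊β * h⌋ + p.2)) with hκ₁
    set κ₂ : ℝ := -(γ * (⌊α * h⌋ + p.1)) with hκ₂
    set f₁ : ℝ → ℂ := fun u => (if (1 ≤ Int.fract (α * h) + u ↔ p.1 = 1) then (1 : ℂ) else 0) *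
      cexp (2 * π * I * ((κ₁ * u : ℝ) : ℂ)) with hf₁
    set f₂ : ℝ → ℂ := fun u => (if (1 ≤ Int.fract (β * h) + u ↔ p.2 = 1) then (1 : ℂ) else 0) *
      cexp (2 * π * I * ((κ₂ * u : ℝ) : ℂ)) with hf₂
    have huniq : ∀ k l k' l' : ℤ, (∃ j : ℤ, Λ + k * α + l * β = j) →
        (∃ j : ℤ, Λ + k' * α + l' * β = j) → k = k' ∧ l = l' := by
      rintro k l k' l' ⟨j, hj⟩ ⟨j', hj'⟩
      have := hind (k - k') (l - l') (j - j') (by push_cast; linarith)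
      omega
    have hloc₁ := piece_locally_e (Int.fract (α * h)) κ₁ p.1
    have hloc₂ := piece_locally_e (Int.fract (β * h)) κ₂ p.2
    have hnorm₁ : ∀ x, ‖f₁ x‖ ≤ 1 := fun x => norm_piece_le _ _ _ x
    have hnorm₂ : ∀ x, ‖f₂ x‖ ≤ 1 := fun x => norm_piece_le _ _ _ x
    have hmeas₁ : Measurable f₁ := measurable_piece _ _ _
    have hmeas₂ : Measurable f₂ := measurable_piece _ _ _
    have happ₁ := fun ε (hε : 0 < ε) => exists_trigPoly_approx_of_locally_e _ hnorm₁
      (intervalIntegrable_of_norm_le_one hmeas₁ hnorm₁ 0 1) hloc₁ trigApprox hε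
    have happ₂ := fun ε (hε : 0 < ε) => exists_trigPoly_approx_of_locally_e _ hnorm₂
      (intervalIntegrable_of_norm_le_one hmeas₂ hnorm₂ 0 1) hloc₂ trigApprox hε
    have hB : ∀ k l j : ℤ, Λ + k * α + l * β = j →
        ‖∫ x in (0 : ℝ)..1, f₁ x * cexp (2 * π * I * ((-((k : ℝ) * x) : ℝ) : ℂ))‖ *
          ‖∫ x in (0 : ℝ)..1, f₂ x * cexp (2 * π * I * ((-((l : ℝ) * x) : ℝ) : ℂ))‖ ≤ B := by
      intro k l j hres
      have hF₁ : ‖∫ x in (0 : ℝ)..1, f₁ x * cexp (2 * π * I * ((-((k : ℝ) * x) : ℝ) : ℂ))‖ ≤ 1 := by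
        have := intervalIntegral.norm_integral_le_of_norm_le_const (a := (0 : ℝ)) (b := 1) (C := 1)
          (f := fun x => f₁ x * cexp (2 * π * I * ((-((k : ℝ) * x) : ℝ) : ℂ))) fun x _ => by
            rw [norm_mul, norm_e, mul_one]; exact hnorm₁ x
        simpa using this
      have hF₂ : ‖∫ x in (0 : ℝ)..1, f₂ x * cexp (2 * π * I * ((-((l : ℝ) * x) : ℝ) : ℂ))‖ ≤ 1 := by
        have := intervalIntegral.norm_integral_le_of_norm_le_const (a := (0 : ℝ)) (b := 1) (C := 1)
          (f := fun x => f₂ x * cexp (2 * π * I * ((-((l : ℝ) * x) : ℝ) : ℂ))) fun x _ => by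
            rw [norm_mul, norm_e, mul_one]; exact hnorm₂ x
        simpa using this
      rcases hkey h hh p hp k l j hres with hM1 | hM2
      · -- decay from the first factor
        have hne : κ₁ - k ≠ 0 := by
          intro h0; rw [hκ₁] at h0
          have : |γ * (⌊β * h⌋ + p.2) + k| = 0 := by
            rw [abs_eq_zero]; linarith
          linarith
        have h1 := norm_fourierCoeff_le_of_locally_e _ hnorm₁ hmeas₁ hloc₁ k hne
        have habs : M ≤ |κ₁ - k| := by
          rw [hκ₁, show -(γ * (⌊β * h⌋ + p.2)) - (k : ℝ) = -(γ * (⌊β * h⌋ + p.2) + k) by ring,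
            abs_neg]; exact hM1
        have h2 : ((({1 - Int.fract (α * h)} : Finset ℝ).card + 1 : ℝ)) / (π * |κ₁ - k|) ≤ B := by
          rw [Finset.card_singleton, hBdef]; push_cast
          rw [show (1 : ℝ) + 1 = 2 by norm_num]
          exact div_le_div_of_nonneg_left (by norm_num) (by positivity) (by gcongr)
        calc _ ≤ B * 1 := mul_le_mul (h1.trans h2) hF₂ (norm_nonneg _) hB0
          _ = B := mul_one _
      · have hne : κ₂ - l ≠ 0 := by
          intro h0; rw [hκ₂] at h0
          have : |γ * (⌊α * h⌋ + p.1) + l| = 0 := by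
            rw [abs_eq_zero]; linarith
          linarith
        have h1 := norm_fourierCoeff_le_of_locally_e _ hnorm₂ hmeas₂ hloc₂ l hne
        have habs : M ≤ |κ₂ - l| := by
          rw [hκ₂, show -(γ * (⌊α * h⌋ + p.1)) - (l : ℝ) = -(γ * (⌊α * h⌋ + p.1) + l) by ring,
            abs_neg]; exact hM2
        have h2 : ((({1 - Int.fract (β * h)} : Finset ℝ).card + 1 : ℝ)) / (π * |κ₂ - l|) ≤ B := by
          rw [Finset.card_singleton, hBdef]; push_cast
          rw [show (1 : ℝ) + 1 = 2 by norm_num]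
          exact div_le_div_of_nonneg_left (by norm_num) (by positivity) (by gcongr)
        calc _ ≤ 1 * B := mul_le_mul hF₁ (h1.trans h2) (norm_nonneg _) zero_le_one
          _ = B := one_mul _
    have key := twisted_sum_eventually_le hαi hβi huniq hnorm₁ hnorm₂ happ₁ happ₂ hB0 hB
      (η := η / 8) (by positivity)
    simp only [hf₁, hf₂, hΛ] at key
    exact key
  -- combine the four pieces
  have hall := (Finset.eventually_all _).mpr hpieces
  filter_upwards [hall] with N hN
  have hcard : (({0, 1} ×ˢ {0, 1} : Finset (ℕ × ℕ))).card = 4 := by decide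
  calc ‖∑ n ∈ range N, cexp (2 * π * I *
          ((((⌊α * (n + h : ℕ)⌋ * ⌊β * (n + h : ℕ)⌋ * γ : ℝ)) - (⌊α * n⌋ * ⌊β * n⌋ * γ : ℝ) : ℝ) : ℂ))‖
      ≤ _ := norm_sum_e_corr_le α β γ h N
    _ ≤ ∑ p ∈ ({0, 1} ×ˢ {0, 1} : Finset (ℕ × ℕ)), (B + η / 8) * N := Finset.sum_le_sum hN
    _ = 4 * ((B + η / 8) * N) := by rw [Finset.sum_const, hcard, nsmul_eq_mul]; norm_num
    _ = η * N := by
        rw [hBdef, hM]; field_simp; ring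

/-! ### N. The dependent case: the excluded configuration -/

/-- If `ξ` is irrational and `q₀ + q₁ξ = 0` with `q₀, q₁ ∈ ℚ` then `q₀ = q₁ = 0`. [folklore] -/
theorem rat_indep_of_irrational {ξ : ℝ} (hξ : Irrational ξ) (q₀ q₁ : ℚ)
    (h : (q₀ : ℝ) + q₁ * ξ = 0) : q₀ = 0 ∧ q₁ = 0 := by
  by_cases hq₁ : q₁ = 0
  · subst hq₁
    have : (q₀ : ℝ) = 0 := by simpa using h
    exact ⟨by exact_mod_cast this, rfl⟩
  · exfalso
    have hq₁' : (q₁ : ℝ) ≠ 0 := by exact_mod_cast hq₁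
    have : ξ = ((-q₀ / q₁ : ℚ) : ℝ) := by push_cast; field_simp; linarith
    exact hξ ⟨_, this.symm⟩

/-- **The degenerate configuration in the dependent case is the excluded one.** Let `ξ` be
irrational, `α = Aξ + a₀ > 0`, `β = Bξ + b₀ > 0` (`A, B ∈ ℤ` not both zero, `a₀, b₀ ∈ ℚ`), `γ`
irrational with `γα = r₀ + r₁ξ`, `γβ = s₀ + s₁ξ` (`rᵢ, sᵢ ∈ ℚ`). If the growth rate
`βr₁ + αs₁ − γ(Aβ + Bα)` of the resonant frequency defect vanishes, then `(α/β)² ∈ ℚ` and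
`γ ∈ ℚ + ℚ(α/β)` — the configuration excluded by Håland's Proposition 1.2 (ii). (Conjugation in
the quadratic field `ℚ(ξ)`: the vanishing reads `(γ − γ̄)(ᾱβ + αβ̄) = 0`.)
[cite: Haland1994, Prop. 1.2] -/
theorem no_degenerate_dep {α β γ ξ : ℝ} {A B : ℤ} {a₀ b₀ r₀ r₁ s₀ s₁ : ℚ}
    (hα : 0 < α) (hβ : 0 < β) (hξ : Irrational ξ) (hAB : (A, B) ≠ (0, 0))
    (hαξ : α = A * ξ + a₀) (hβξ : β = B * ξ + b₀)
    (hγ : Irrational γ)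
    (hbad : ∀ c : ℚ, 0 < c → (α / β) ^ 2 = c →
      γ ∈ Submodule.span ℚ ({1, α / β} : Set ℝ) → False)
    (hγα : γ * α = r₀ + r₁ * ξ) (hγβ : γ * β = s₀ + s₁ * ξ)
    (hG : β * r₁ + α * s₁ = γ * (A * β + B * α)) : False := by
  have hθ : 0 < α / β := div_pos hα hβ
  -- the quadratic relation for `ξ`
  set P₂ : ℚ := r₁ * B - s₁ * A with hP₂
  set P₁ : ℚ := r₀ * B + r₁ * b₀ - s₀ * A - s₁ * a₀ with hP₁
  set P₀ : ℚ := r₀ * b₀ - s₀ * a₀ with hP₀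
  have hquad : (P₂ : ℝ) * ξ ^ 2 + P₁ * ξ + P₀ = 0 := by
    simp only [hP₂, hP₁, hP₀]; push_cast
    linear_combination (-β) * hγα + α * hγβ - ((r₀ : ℝ) + r₁ * ξ) * hβξ + ((s₀ : ℝ) + s₁ * ξ) * hαξ
  -- (†'): the rational part of `hG`
  have hdagR : (b₀ : ℝ) * r₁ + a₀ * s₁ = A * s₀ + B * r₀ := by
    linear_combination hG - (r₁ : ℝ) * hβξ - (s₁ : ℝ) * hαξ + (A : ℝ) * hγβ + (B : ℝ) * hγα
  have hdag : b₀ * r₁ + a₀ * s₁ = A * s₀ + B * r₀ := by exact_mod_cast hdagR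
  have ha₀ : A = 0 → (a₀ : ℝ) = α := fun hA => by rw [hαξ, hA]; simp
  have hb₀ : B = 0 → (b₀ : ℝ) = β := fun hB => by rw [hβξ, hB]; simp
  by_cases htriv : P₂ = 0 ∧ P₁ = 0 ∧ P₀ = 0
  · -- trivial quadratic: `γ` is rational
    obtain ⟨h2, h1, _⟩ := htriv
    by_cases hA : A = 0
    · have hBne : B ≠ 0 := by rintro rfl; exact hAB (by rw [hA])
      have hBR : (B : ℝ) ≠ 0 := by exact_mod_cast hBne
      have hBQ : (B : ℚ) ≠ 0 := by exact_mod_cast hBne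
      have hr₁ : r₁ = 0 := by
        have : r₁ * B = 0 := by have := h2; rw [hP₂, hA] at this; simpa using this
        exact (mul_eq_zero.mp this).resolve_right hBQ
      have hr₀ : (r₀ : ℝ) * B = a₀ * s₁ := by
        have e1 := h1; rw [hP₁, hA, hr₁] at e1
        have e2 := hdag; rw [hA, hr₁] at e2
        have : 2 * (B * r₀ - a₀ * s₁) = 0 := by
          push_cast at e1 e2 ⊢; linarith
        have : (B : ℚ) * r₀ = a₀ * s₁ := by linarith
        have := congrArg (fun q : ℚ => (q : ℝ)) this; push_cast at this; linarith
      have hαa : (a₀ : ℝ) = α := ha₀ hA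
      have ha₀ne : (a₀ : ℝ) ≠ 0 := by rw [hαa]; exact hα.ne'
      apply hγ
      refine ⟨s₁ / B, ?_⟩
      push_cast
      have : γ * a₀ = r₀ := by rw [hαa, hγα, hr₁]; simp
      field_simp
      have : γ * a₀ * B = r₀ * B := by rw [this]
      rw [hr₀] at this
      have : (γ * B - s₁) * a₀ = 0 := by linarith
      rcases mul_eq_zero.mp this with h | h
      · linarith
      · exact absurd h ha₀ne
    · have hAR : (A : ℝ) ≠ 0 := by exact_mod_cast hA
      have hAQ : (A : ℚ) ≠ 0 := by exact_mod_cast hA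
      have hs₁ : (s₁ : ℝ) = r₁ * B / A := by
        have : r₁ * B = s₁ * A := by have := h2; rw [hP₂] at this; linarith
        have := congrArg (fun q : ℚ => (q : ℝ)) this; push_cast at this
        field_simp; linarith
      have hs₀ : (s₀ : ℝ) = r₁ * b₀ / A := by
        have e1 := h1; rw [hP₁] at e1
        have : 2 * (r₁ * b₀ - A * s₀) = 0 := by linarith [hdag]
        have : r₁ * b₀ = A * s₀ := by linarith
        have := congrArg (fun q : ℚ => (q : ℝ)) this; push_cast at this
        field_simp; linarith
      apply hγ
      refine ⟨r₁ / A, ?_⟩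
      push_cast
      have h1 : γ * β = r₁ / A * β := by
        rw [hγβ, hs₀, hs₁, hβξ]; field_simp; ring
      exact (mul_right_cancel₀ hβ.ne' h1).symm
  · -- non-trivial quadratic: `ξ` is quadratic, `P₂ ≠ 0`
    have hP₂ne : P₂ ≠ 0 := by
      intro h0
      rw [not_and] at htriv
      have hrest := htriv h0
      rw [not_and_or] at hrest
      have h0R : (P₂ : ℝ) = 0 := by exact_mod_cast h0
      rw [h0R, zero_mul, zero_add] at hquad
      obtain ⟨h1, h2⟩ := rat_indep_of_irrational hξ P₀ P₁ (by linarith)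
      rcases hrest with h | h
      · exact h h2
      · exact h h1
    have hP₂R : (P₂ : ℝ) ≠ 0 := by exact_mod_cast hP₂ne
    -- the conjugate root and conjugates
    set S : ℚ := -P₁ / P₂ with hS
    set P : ℚ := P₀ / P₂ with hP
    set ξ' : ℝ := S - ξ with hξ'
    have hsum : ξ + ξ' = S := by rw [hξ']; ring
    have hprod : ξ * ξ' = P := by
      rw [hξ', hS, hP]; push_cast; field_simp
      linear_combination (-1 : ℝ) * hquad
    have hξ'irr : Irrational ξ' := by
      rw [hξ']; exact (hξ.ratCast_sub S)
    have hξne : ξ - ξ' ≠ 0 := by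
      intro h0
      have : ξ = ((S / 2 : ℚ) : ℝ) := by push_cast; rw [hξ'] at h0; linarith
      exact hξ ⟨_, this.symm⟩
    set α' : ℝ := A * ξ' + a₀ with hα'
    set β' : ℝ := B * ξ' + b₀ with hβ'
    set Γ : ℝ := r₀ + r₁ * ξ' with hΓ
    set Sg : ℝ := s₀ + s₁ * ξ' with hSg
    -- the conjugate quadratic relation: `β' Γ = α' Sg`
    have hSR : (S : ℝ) * P₂ = -P₁ := by rw [hS]; push_cast; field_simp
    have hquad' : (P₂ : ℝ) * ξ' ^ 2 + P₁ * ξ' + P₀ = 0 := by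
      rw [hξ']
      linear_combination hquad + ((S : ℝ) - 2 * ξ) * hSR
    have hconj : β' * Γ - α' * Sg = 0 := by
      rw [hβ', hΓ, hα', hSg]
      have : (P₂ : ℝ) * ξ' ^ 2 + P₁ * ξ' + P₀ = 0 := hquad'
      simp only [hP₂, hP₁, hP₀] at this; push_cast at this
      linear_combination this
    -- non-vanishing of the conjugates
    have hα'ne : α' ≠ 0 := by
      intro h0
      by_cases hA : A = 0
      · have h1 : (a₀ : ℝ) = 0 := by rw [hα', hA] at h0; simpa using h0
        have h2 := ha₀ hA; linarith
      · have hAR : (A : ℝ) ≠ 0 := by exact_mod_cast hA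
        apply hξ'irr
        refine ⟨-a₀ / A, ?_⟩; push_cast; field_simp; rw [hα'] at h0; linarith
    have hβ'ne : β' ≠ 0 := by
      intro h0
      by_cases hB : B = 0
      · have h1 : (b₀ : ℝ) = 0 := by rw [hβ', hB] at h0; simpa using h0
        have h2 := hb₀ hB; linarith
      · have hBR : (B : ℝ) ≠ 0 := by exact_mod_cast hB
        apply hξ'irr
        refine ⟨-b₀ / B, ?_⟩; push_cast; field_simp; rw [hβ'] at h0; linarith
    -- the key factorisation `(γ α' − Γ)(α' β + α β') = 0`
    have e1 : (r₁ : ℝ) * (ξ - ξ') = γ * α - Γ := by rw [hΓ, hγα]; ring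
    have e2 : (s₁ : ℝ) * (ξ - ξ') = γ * β - Sg := by rw [hSg, hγβ]; ring
    have e3 : (A : ℝ) * (ξ - ξ') = α - α' := by rw [hα', hαξ]; ring
    have e4 : (B : ℝ) * (ξ - ξ') = β - β' := by rw [hβ', hβξ]; ring
    have hGd : (β * r₁ + α * s₁ - γ * (A * β + B * α)) * (ξ - ξ') =
        -β * Γ - α * Sg + γ * (α' * β + β' * α) := by
      linear_combination β * e1 + α * e2 - γ * β * e3 - γ * α * e4
    have hkey : (γ * α' - Γ) * (α' * β + α * β') = 0 := by
      have h0 : β * r₁ + α * s₁ - γ * (A * β + B * α) = 0 := by rw [hG]; ring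
      rw [h0, zero_mul] at hGd
      linear_combination (-α') * hGd - α * hconj
    rcases mul_eq_zero.mp hkey with hk | hk
    · -- `γ α' = Γ`: then `γ A = r₁`, so `γ ∈ ℚ`
      have hAr : (γ * A - r₁) * (ξ - ξ') = 0 := by
        linear_combination (-1 : ℝ) * hk + γ * e3 - e1 + 0 * hγα
      have hγA : γ * A = r₁ := by
        rcases mul_eq_zero.mp hAr with h | h
        · linarith
        · exact absurd h hξne
      by_cases hA : A = 0
      · have hr₁ : (r₁ : ℝ) = 0 := by rw [← hγA, hA]; simp
        have hαa := ha₀ hA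
        apply hγ
        refine ⟨r₀ / a₀, ?_⟩
        have ha₀ne : (a₀ : ℚ) ≠ 0 := by
          intro h0; rw [h0] at hαa; simp at hαa; linarith
        push_cast
        have : γ * a₀ = r₀ := by rw [hαa, hγα, hr₁]; ring
        field_simp; linarith
      · have hAR : (A : ℝ) ≠ 0 := by exact_mod_cast hA
        apply hγ
        refine ⟨r₁ / A, ?_⟩
        push_cast; field_simp; linarith
    · -- `α' β + α β' = 0`: then `(α/β)² = -N(α)/N(β) ∈ ℚ` and `γ ∈ ℚ + ℚ (α/β)`
      set Nα : ℚ := a₀ ^ 2 + a₀ * A * S + A ^ 2 * P with hNα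
      set Nβ : ℚ := b₀ ^ 2 + b₀ * B * S + B ^ 2 * P with hNβ
      have hNαR : α * α' = Nα := by
        rw [hNα]; push_cast; rw [← hsum, ← hprod, hαξ, hα']; ring
      have hNβR : β * β' = Nβ := by
        rw [hNβ]; push_cast; rw [← hsum, ← hprod, hβξ, hβ']; ring
      have hNαne : (Nα : ℝ) ≠ 0 := by rw [← hNαR]; exact mul_ne_zero hα.ne' hα'ne
      have hNβne : (Nβ : ℝ) ≠ 0 := by rw [← hNβR]; exact mul_ne_zero hβ.ne' hβ'ne
      have hNαQ : Nα ≠ 0 := by exact_mod_cast hNαne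
      have hNβQ : Nβ ≠ 0 := by exact_mod_cast hNβne
      -- `(α/β)² = -Nα/Nβ`
      have hββ' : β * β' ≠ 0 := mul_ne_zero hβ.ne' hβ'ne
      have hc : (α / β) ^ 2 = ((-Nα / Nβ : ℚ) : ℝ) := by
        push_cast
        rw [← hNαR, ← hNβR, div_pow, div_eq_div_iff (pow_ne_zero 2 hβ.ne') hββ']
        linear_combination (α * β) * hk
      have hcpos : (0 : ℚ) < -Nα / Nβ := by
        have : (0 : ℝ) < ((-Nα / Nβ : ℚ) : ℝ) := by rw [← hc]; positivity
        exact_mod_cast this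
      refine hbad _ hcpos hc ?_
      -- coordinates of `γ` and `θ = α/β` in the basis `1, ξ`
      set G₀ : ℚ := r₀ * a₀ + r₀ * A * S + r₁ * A * P with hG₀
      set G₁ : ℚ := r₁ * a₀ - r₀ * A with hG₁
      set T₀ : ℚ := a₀ * b₀ + a₀ * B * S + A * B * P with hT₀
      set T₁ : ℚ := A * b₀ - a₀ * B with hT₁
      have hN : γ * Nα = G₀ + G₁ * ξ := by
        have h1 : γ * α * α' = G₀ + G₁ * ξ := by
          rw [hγα, hG₀, hG₁]; push_cast; rw [← hsum, ← hprod, hα']; ring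
        rw [mul_assoc, hNαR] at h1
        exact h1
      have hT : α / β * Nβ = T₀ + T₁ * ξ := by
        have h1 : α * β' = T₀ + T₁ * ξ := by
          rw [hT₀, hT₁]; push_cast; rw [← hsum, ← hprod, hαξ, hβ']; ring
        have h2 : α / β * (β * β') = α * β' := by field_simp
        rw [← hNβR, h2, h1]
      -- `T₁ ≠ 0`: otherwise `α/β ∈ ℚ`, forcing `α' β + α β' ≠ 0`
      have hT₁ne : T₁ ≠ 0 := by
        intro h0
        have hprop : (A : ℚ) * b₀ = a₀ * B := by
          have : (A : ℚ) * b₀ - a₀ * B = 0 := h0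
          linarith
        by_cases hB : B = 0
        · have hb : (b₀ : ℝ) = β := hb₀ hB
          have hb0 : b₀ ≠ 0 := by
            intro h; rw [h] at hb; simp at hb; linarith
          have hA : A = 0 := by
            have : (A : ℚ) * b₀ = 0 := by rw [hprop, hB]; simp
            exact_mod_cast (mul_eq_zero.mp this).resolve_right hb0
          exact hAB (by rw [hA, hB])
        · have hBR : (B : ℝ) ≠ 0 := by exact_mod_cast hB
          have hpropR : (A : ℝ) * b₀ = a₀ * B := by exact_mod_cast hprop
          have ht : α * B = A * β := by
            linear_combination (B : ℝ) * hαξ - (A : ℝ) * hβξ - hpropR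
          have ht' : α' * B = A * β' := by
            linear_combination (B : ℝ) * hα' - (A : ℝ) * hβ' - hpropR
          have h2 : (2 : ℝ) * A * (β * β') = 0 := by
            linear_combination (B : ℝ) * hk - β * ht' - β' * ht
          rcases mul_eq_zero.mp h2 with h | h
          · rcases mul_eq_zero.mp h with h' | h'
            · norm_num at h'
            · have : α * B = 0 := by rw [ht, h', zero_mul]
              rcases mul_eq_zero.mp this with h'' | h''
              · linarith
              · exact hBR h''
          · exact hββ' h
      have hT₁R : (T₁ : ℝ) ≠ 0 := by exact_mod_cast hT₁ne
      have hden : ((Nα * T₁ : ℚ) : ℝ) ≠ 0 := by push_cast; exact mul_ne_zero hNαne hT₁R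
      rw [Submodule.mem_span_pair]
      refine ⟨(G₀ * T₁ - G₁ * T₀) / (Nα * T₁), (G₁ * Nβ) / (Nα * T₁), ?_⟩
      simp only [Rat.smul_def, mul_one]
      have key : (((G₀ * T₁ - G₁ * T₀) / (Nα * T₁) + G₁ * Nβ / (Nα * T₁) * ((α / β : ℝ)) : ℝ)) = γ := by
        have e : ((G₀ * T₁ - G₁ * T₀ : ℚ) : ℝ) / ((Nα * T₁ : ℚ) : ℝ) +
            ((G₁ * Nβ : ℚ) : ℝ) / ((Nα * T₁ : ℚ) : ℝ) * (α / β) = γ := by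
          rw [div_mul_eq_mul_div, ← add_div, div_eq_iff hden]
          push_cast
          linear_combination (-(T₁ : ℝ)) * hN + (G₁ : ℝ) * hT
        push_cast at e ⊢
        exact e
      push_cast at key ⊢
      exact key

/-! ### O. Resonances in the dependent case -/

/-- In the dependent parametrisation `α = Aξ + a₀`, `β = Bξ + b₀` (`ξ ∉ ℚ`, `(A, B) ≠ 0`,
`α, β > 0`) one has `Aβ + Bα ≠ 0`. [folklore] -/
theorem A_mul_add_B_mul_ne_zero {α β ξ : ℝ} {A B : ℤ} {a₀ b₀ : ℚ}
    (hα : 0 < α) (hβ : 0 < β) (hξ : Irrational ξ) (hAB : (A, B) ≠ (0, 0))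
    (hαξ : α = A * ξ + a₀) (hβξ : β = B * ξ + b₀) : (A : ℝ) * β + B * α ≠ 0 := by
  intro h0
  by_cases hA : A = 0
  · have hB : B ≠ 0 := by rintro rfl; exact hAB (by rw [hA])
    have hBR : (B : ℝ) ≠ 0 := by exact_mod_cast hB
    rw [hA] at h0; simp at h0
    rcases h0 with h | h
    · exact hBR (by exact_mod_cast h)
    · linarith
  · by_cases hB : B = 0
    · have hAR : (A : ℝ) ≠ 0 := by exact_mod_cast hA
      rw [hB] at h0; simp at h0
      rcases h0 with h | h
      · exact hAR (by exact_mod_cast h)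
      · linarith
    · -- `2ABξ + (A b₀ + B a₀) = 0` contradicts irrationality
      have hABR : ((2 * A * B : ℤ) : ℝ) ≠ 0 := by
        push_cast; exact mul_ne_zero (mul_ne_zero two_ne_zero (by exact_mod_cast hA))
          (by exact_mod_cast hB)
      have hrel : ((A * b₀ + B * a₀ : ℚ) : ℝ) + ((2 * A * B : ℚ) : ℝ) * ξ = 0 := by
        push_cast; rw [hαξ, hβξ] at h0; linarith
      obtain ⟨_, h2⟩ := rat_indep_of_irrational hξ _ _ hrel
      have : ((2 * A * B : ℤ) : ℝ) = 0 := by exact_mod_cast h2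
      exact hABR this

/-- **Resonances in the dependent case.** Let `ξ` be irrational, `α = Aξ + a₀ > 0`,
`β = Bξ + b₀ > 0` (`A, B ∈ ℤ` not both zero, `a₀, b₀ ∈ ℚ`), `γ` irrational and not in the
excluded configuration, `D ≥ 1`. For the shift `H` and piece `(i, j)` put `m₁ = ⌊βH⌋ + j`,
`m₂ = ⌊αH⌋ + i`, `μ = m₁α + m₂β`. Then for every `M`, for all large `H`, every resonance
`Dγμ + k·Dξ ∈ ℤ` has frequency defect `|γ(Am₁ + Bm₂) + k| ≥ M`. (If `γα, γβ ∉ ℚ + ℚξ`, two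
resonances with non-proportional `(Am₁+Bm₂, a₀m₁+b₀m₂)` express `γα, γβ` in `ℚ + ℚξ`, while
proportional ones force `H` bounded (or `α/β ∈ ℚ`, where again `γα, γβ ∈ ℚ + ℚξ`); if
`γα = r₀ + r₁ξ`, `γβ = s₀ + s₁ξ`, then `k` is forced and the defect grows like
`H·(βr₁ + αs₁ − γ(Aβ + Bα))`, whose vanishing is excluded by `no_degenerate_dep`.)
[cite: Haland1994, Prop. 1.2] -/
theorem key_dep {α β γ ξ : ℝ} {A B : ℤ} {a₀ b₀ : ℚ} {D : ℕ} (hD : 0 < D)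
    (hα : 0 < α) (hβ : 0 < β) (hξ : Irrational ξ) (hAB : (A, B) ≠ (0, 0))
    (hαξ : α = A * ξ + a₀) (hβξ : β = B * ξ + b₀)
    (hγ : Irrational γ)
    (hbad : ∀ c : ℚ, 0 < c → (α / β) ^ 2 = c →
      γ ∈ Submodule.span ℚ ({1, α / β} : Set ℝ) → False)
    (M : ℝ) :
    ∃ H₀ : ℕ, ∀ H : ℕ, H₀ ≤ H → ∀ p ∈ ({0, 1} ×ˢ {0, 1} : Finset (ℕ × ℕ)), ∀ k j : ℤ,
      (D : ℝ) * (γ * ((⌊β * H⌋ + p.2) * α + (⌊α * H⌋ + p.1) * β)) + k * ((D : ℝ) * ξ) = j →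
        M ≤ |γ * (A * (⌊β * H⌋ + p.2) + B * (⌊α * H⌋ + p.1)) + k| := by
  have hDR : (0 : ℝ) < D := by exact_mod_cast hD
  have hDne : (D : ℝ) ≠ 0 := hDR.ne'
  have hS := A_mul_add_B_mul_ne_zero hα hβ hξ hAB hαξ hβξ
  have hpiece : ∀ p ∈ ({0, 1} ×ˢ {0, 1} : Finset (ℕ × ℕ)), (p.1 : ℝ) ≤ 1 ∧ (p.2 : ℝ) ≤ 1 := by
    intro p hp
    simp only [Finset.mem_product, Finset.mem_insert, Finset.mem_singleton] at hp
    obtain ⟨h1, h2⟩ := hp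
    constructor
    · rcases h1 with h | h <;> simp [h]
    · rcases h2 with h | h <;> simp [h]
  have hτ : ∀ (θ : ℝ) (h : ℕ) (e : ℕ), (e : ℝ) ≤ 1 →
      |((⌊θ * h⌋ : ℤ) : ℝ) + e - θ * h| ≤ 1 := by
    intro θ h e he
    have h1 := Int.floor_le (θ * h)
    have h2 := Int.lt_floor_add_one (θ * h)
    have h3 : (0 : ℝ) ≤ e := Nat.cast_nonneg e
    rw [abs_le]; constructor <;> linarith
  by_cases hfull : ∃ r₀ r₁ s₀ s₁ : ℚ, γ * α = r₀ + r₁ * ξ ∧ γ * β = s₀ + s₁ * ξ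
  · -- Case (b-II): fully resonant
    obtain ⟨r₀, r₁, s₀, s₁, hγα, hγβ⟩ := hfull
    set G : ℝ := β * r₁ + α * s₁ - γ * (A * β + B * α) with hGdef
    have hG : G ≠ 0 := by
      intro h0
      exact no_degenerate_dep hα hβ hξ hAB hαξ hβξ hγ hbad hγα hγβ (by rw [hGdef] at h0; linarith)
    have hGpos : 0 < |G| := abs_pos.mpr hG
    set C : ℝ := |(r₁ : ℝ) - γ * A| + |(s₁ : ℝ) - γ * B| with hC
    obtain ⟨H₀, hH₀⟩ := exists_nat_ge ((M + C) / |G|)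
    refine ⟨H₀, fun H hH p hp k j hres => ?_⟩
    obtain ⟨hp1, hp2⟩ := hpiece p hp
    set m₁ : ℝ := ⌊β * H⌋ + p.2 with hm₁
    set m₂ : ℝ := ⌊α * H⌋ + p.1 with hm₂
    obtain ⟨M₁, hM₁⟩ : ∃ M₁ : ℤ, (M₁ : ℝ) = m₁ := ⟨⌊β * H⌋ + p.2, by push_cast; rfl⟩
    obtain ⟨M₂, hM₂⟩ : ∃ M₂ : ℤ, (M₂ : ℝ) = m₂ := ⟨⌊α * H⌋ + p.1, by push_cast; rfl⟩
    -- `k` is forced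
    have hrel : (((D : ℚ) * (M₁ * r₀ + M₂ * s₀) - j : ℚ) : ℝ) +
        (((D : ℚ) * (M₁ * r₁ + M₂ * s₁ + k) : ℚ) : ℝ) * ξ = 0 := by
      push_cast; rw [hM₁, hM₂]
      have e : (D : ℝ) * (γ * (m₁ * α + m₂ * β)) + k * (D * ξ) - j = 0 := by rw [hres]; ring
      have e2 : γ * (m₁ * α + m₂ * β) = m₁ * (r₀ + r₁ * ξ) + m₂ * (s₀ + s₁ * ξ) := by
        rw [← hγα, ← hγβ]; ring
      rw [e2] at e; linarith
    obtain ⟨_, h2⟩ := rat_indep_of_irrational hξ _ _ hrel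
    have hk : (k : ℝ) = -(m₁ * r₁ + m₂ * s₁) := by
      have : (((D : ℚ) * (M₁ * r₁ + M₂ * s₁ + k) : ℚ) : ℝ) = 0 := by exact_mod_cast h2
      push_cast at this; rw [hM₁, hM₂] at this
      rcases mul_eq_zero.mp this with h | h
      · exact absurd h hDne
      · linarith
    -- the defect
    have hdef : γ * (A * m₁ + B * m₂) + k = -(H * G +
        ((((⌊β * H⌋ : ℤ) : ℝ) + p.2 - β * H) * (r₁ - γ * A) +
          (((⌊α * H⌋ : ℤ) : ℝ) + p.1 - α * H) * (s₁ - γ * B))) := by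
      rw [hk, hGdef, hm₁, hm₂]; ring
    have hτ₁ := hτ β H p.2 hp2
    have hτ₂ := hτ α H p.1 hp1
    have hE : |(((⌊β * H⌋ : ℤ) : ℝ) + p.2 - β * H) * (r₁ - γ * A) +
        (((⌊α * H⌋ : ℤ) : ℝ) + p.1 - α * H) * (s₁ - γ * B)| ≤ C := by
      rw [hC]
      refine (abs_add_le _ _).trans (add_le_add ?_ ?_)
      · rw [abs_mul]; exact mul_le_of_le_one_left (abs_nonneg _) hτ₁
      · rw [abs_mul]; exact mul_le_of_le_one_left (abs_nonneg _) hτ₂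
    have hH' : (M + C) / |G| ≤ H := hH₀.trans (by exact_mod_cast hH)
    rw [div_le_iff₀ hGpos] at hH'
    have key : (H : ℝ) * |G| - C ≤ |γ * (A * m₁ + B * m₂) + k| := by
      rw [hdef, abs_neg]
      have h1 := abs_sub_abs_le_abs_sub ((H : ℝ) * G)
        (-((((⌊β * H⌋ : ℤ) : ℝ) + p.2 - β * H) * (r₁ - γ * A) +
          (((⌊α * H⌋ : ℤ) : ℝ) + p.1 - α * H) * (s₁ - γ * B)))
      rw [sub_neg_eq_add, abs_neg, abs_mul, Nat.abs_cast] at h1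
      linarith
    have : γ * (A * (⌊β * H⌋ + p.2) + B * (⌊α * H⌋ + p.1)) + k = γ * (A * m₁ + B * m₂) + k := by
      rw [hm₁, hm₂]
    rw [this]
    linarith
  · -- Case (b-I): not fully resonant
    -- `|A m₁ + B m₂| ≥ 1` for large `H`
    have hSpos : 0 < |(A : ℝ) * β + B * α| := abs_pos.mpr hS
    obtain ⟨H₁, hH₁⟩ := exists_nat_ge ((1 + |(A : ℝ)| + |(B : ℝ)|) / |(A : ℝ) * β + B * α|)
    have hw₁ : ∀ H : ℕ, H₁ ≤ H → ∀ p ∈ ({0, 1} ×ˢ {0, 1} : Finset (ℕ × ℕ)),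
        (A : ℝ) * (⌊β * H⌋ + p.2) + B * (⌊α * H⌋ + p.1) ≠ 0 := by
      intro H hH p hp h0
      obtain ⟨hp1, hp2⟩ := hpiece p hp
      have hτ₁ := hτ β H p.2 hp2
      have hτ₂ := hτ α H p.1 hp1
      have hid : (H : ℝ) * (A * β + B * α) =
          -(A * ((((⌊β * H⌋ : ℤ) : ℝ) + p.2 - β * H)) + B * ((((⌊α * H⌋ : ℤ) : ℝ) + p.1 - α * H))) := by
        linarith
      have hbd : (H : ℝ) * |(A : ℝ) * β + B * α| ≤ |(A : ℝ)| + |(B : ℝ)| := by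
        rw [← Nat.abs_cast H, ← abs_mul, hid, abs_neg]
        refine (abs_add_le _ _).trans (add_le_add ?_ ?_)
        · rw [abs_mul]; exact mul_le_of_le_one_right (abs_nonneg _) hτ₁
        · rw [abs_mul]; exact mul_le_of_le_one_right (abs_nonneg _) hτ₂
      have hH' : (1 + |(A : ℝ)| + |(B : ℝ)|) / |(A : ℝ) * β + B * α| ≤ H :=
        hH₁.trans (by exact_mod_cast hH)
      rw [div_le_iff₀ hSpos] at hH'
      linarith
    by_cases hex : ∃ Hs : ℕ, H₁ ≤ Hs ∧ ∃ ps ∈ ({0, 1} ×ˢ {0, 1} : Finset (ℕ × ℕ)), ∃ ks js : ℤ,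
        (D : ℝ) * (γ * ((⌊β * Hs⌋ + ps.2) * α + (⌊α * Hs⌋ + ps.1) * β)) + ks * ((D : ℝ) * ξ) = js
    · obtain ⟨Hs, hHs, ps, hps, ks, js, hress⟩ := hex
      set n₁ : ℝ := ⌊β * Hs⌋ + ps.2 with hn₁
      set n₂ : ℝ := ⌊α * Hs⌋ + ps.1 with hn₂
      obtain ⟨N₁, hN₁⟩ : ∃ N₁ : ℤ, (N₁ : ℝ) = n₁ := ⟨⌊β * Hs⌋ + ps.2, by push_cast; rfl⟩
      obtain ⟨N₂, hN₂⟩ : ∃ N₂ : ℤ, (N₂ : ℝ) = n₂ := ⟨⌊α * Hs⌋ + ps.1, by push_cast; rfl⟩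
      have hW₁ne : (A : ℝ) * n₁ + B * n₂ ≠ 0 := hw₁ Hs hHs ps hps
      -- star quantities as rationals
      set W₁ : ℚ := A * N₁ + B * N₂ with hW₁
      set W₂ : ℚ := a₀ * N₁ + b₀ * N₂ with hW₂
      have hW₁R : (W₁ : ℝ) = A * n₁ + B * n₂ := by rw [hW₁]; push_cast; rw [hN₁, hN₂]
      have hW₂R : (W₂ : ℝ) = a₀ * n₁ + b₀ * n₂ := by rw [hW₂]; push_cast; rw [hN₁, hN₂]
      have hW₁ne' : (W₁ : ℝ) ≠ 0 := by rw [hW₁R]; exact hW₁ne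
      set C₁ : ℚ := A * W₂ - a₀ * W₁ with hC₁
      set C₂ : ℚ := B * W₂ - b₀ * W₁ with hC₂
      have hress' : (D : ℝ) * (γ * (n₁ * α + n₂ * β)) + ks * (D * ξ) = js := hress
      by_cases hc : C₁ = 0 ∧ C₂ = 0
      · -- then `α W₁ = A μ*`, `β W₁ = B μ*`, and `γα, γβ ∈ ℚ + ℚξ`
        exfalso
        obtain ⟨hc1, hc2⟩ := hc
        have hc1R : (A : ℝ) * (a₀ * n₁ + b₀ * n₂) - a₀ * (A * n₁ + B * n₂) = 0 := by
          have : ((A * W₂ - a₀ * W₁ : ℚ) : ℝ) = 0 := by rw [← hC₁]; exact_mod_cast hc1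
          push_cast at this; rw [hW₁R, hW₂R] at this; exact this
        have hc2R : (B : ℝ) * (a₀ * n₁ + b₀ * n₂) - b₀ * (A * n₁ + B * n₂) = 0 := by
          have : ((B * W₂ - b₀ * W₁ : ℚ) : ℝ) = 0 := by rw [← hC₂]; exact_mod_cast hc2
          push_cast at this; rw [hW₁R, hW₂R] at this; exact this
        apply hfull
        have hDW : (D : ℝ) * (W₁ : ℝ) ≠ 0 := mul_ne_zero hDne hW₁ne'
        refine ⟨(A * js : ℚ) / (D * W₁), (-(A * ks * D) : ℚ) / (D * W₁),
          (B * js : ℚ) / (D * W₁), (-(B * ks * D) : ℚ) / (D * W₁), ?_, ?_⟩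
        · push_cast
          rw [div_mul_eq_mul_div, ← add_div, eq_div_iff hDW, hW₁R]
          subst hαξ hβξ
          linear_combination (A : ℝ) * hress' - (D : ℝ) * γ * hc1R
        · push_cast
          rw [div_mul_eq_mul_div, ← add_div, eq_div_iff hDW, hW₁R]
          subst hαξ hβξ
          linear_combination (B : ℝ) * hress' - (D : ℝ) * γ * hc2R
      · -- `Δ = β C₁ + α C₂ ≠ 0`
        have hΔ : β * C₁ + α * C₂ ≠ 0 := by
          intro h0
          rw [not_and_or] at hc
          have hC₂ne : C₂ ≠ 0 := by
            intro h2
            have h2R : (C₂ : ℝ) = 0 := by exact_mod_cast h2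
            rw [h2R, mul_zero, add_zero] at h0
            rcases mul_eq_zero.mp h0 with h | h
            · linarith
            · have : C₁ = 0 := by exact_mod_cast h
              rcases hc with h' | h'
              · exact h' this
              · exact h' h2
          have hC₂R : (C₂ : ℝ) ≠ 0 := by exact_mod_cast hC₂ne
          -- `α = t β`, `t = -C₁/C₂ ∈ ℚ`
          set t : ℚ := -C₁ / C₂ with ht
          have htR : α = t * β := by
            rw [ht]; push_cast; field_simp; linarith
          have hrel : ((a₀ - t * b₀ : ℚ) : ℝ) + ((A - t * B : ℚ) : ℝ) * ξ = 0 := by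
            push_cast; rw [hαξ, hβξ] at htR; linarith
          obtain ⟨h1, h2⟩ := rat_indep_of_irrational hξ _ _ hrel
          have ha : a₀ = t * b₀ := by linarith
          have hA : (A : ℚ) = t * B := by linarith
          have hC₁t : C₁ = t * C₂ := by
            simp only [hC₁, hC₂, hW₂]; rw [ha, hA]; ring
          have htpos : (0 : ℝ) < t := by
            have : (0 : ℝ) < t * β := by rw [← htR]; exact hα
            nlinarith
          have hC₁tR : (C₁ : ℝ) = t * C₂ := by exact_mod_cast hC₁t
          rw [hC₁tR, htR] at h0
          have : (2 : ℝ) * t * β * C₂ = 0 := by linarith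
          rcases mul_eq_zero.mp this with h | h
          · rcases mul_eq_zero.mp h with h' | h'
            · rcases mul_eq_zero.mp h' with h'' | h''
              · norm_num at h''
              · linarith
            · linarith
          · exact hC₂R h
        have hΔpos : 0 < |β * C₁ + α * C₂| := abs_pos.mpr hΔ
        obtain ⟨H₂, hH₂⟩ := exists_nat_gt ((|(C₁ : ℝ)| + |(C₂ : ℝ)|) / |β * C₁ + α * C₂|)
        refine ⟨max H₁ H₂, fun H hH p hp k j hres => ?_⟩
        exfalso
        have hHH₁ : H₁ ≤ H := le_trans (le_max_left _ _) hH
        have hHH₂ : H₂ ≤ H := le_trans (le_max_right _ _) hH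
        obtain ⟨hp1, hp2⟩ := hpiece p hp
        set m₁ : ℝ := ⌊β * H⌋ + p.2 with hm₁
        set m₂ : ℝ := ⌊α * H⌋ + p.1 with hm₂
        obtain ⟨M₁, hM₁⟩ : ∃ M₁ : ℤ, (M₁ : ℝ) = m₁ := ⟨⌊β * H⌋ + p.2, by push_cast; rfl⟩
        obtain ⟨M₂, hM₂⟩ : ∃ M₂ : ℤ, (M₂ : ℝ) = m₂ := ⟨⌊α * H⌋ + p.1, by push_cast; rfl⟩
        set V₁ : ℚ := A * M₁ + B * M₂ with hV₁
        set V₂ : ℚ := a₀ * M₁ + b₀ * M₂ with hV₂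
        have hV₁R : (V₁ : ℝ) = A * m₁ + B * m₂ := by rw [hV₁]; push_cast; rw [hM₁, hM₂]
        have hV₂R : (V₂ : ℝ) = a₀ * m₁ + b₀ * m₂ := by rw [hV₂]; push_cast; rw [hM₁, hM₂]
        have hres' : (D : ℝ) * (γ * (m₁ * α + m₂ * β)) + k * (D * ξ) = j := hres
        by_cases hdet : V₁ * W₂ - V₂ * W₁ = 0
        · -- proportional: `m₁ C₁ + m₂ C₂ = 0` forces `H` small
          have hprop : m₁ * C₁ + m₂ * C₂ = 0 := by
            have : ((V₁ * W₂ - V₂ * W₁ : ℚ) : ℝ) = 0 := by exact_mod_cast hdet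
            simp only [hC₁, hC₂]; push_cast at this ⊢
            rw [hV₁R, hV₂R] at this
            linarith
          have hτ₁ := hτ β H p.2 hp2
          have hτ₂ := hτ α H p.1 hp1
          have hid : (H : ℝ) * (β * C₁ + α * C₂) =
              -(((((⌊β * H⌋ : ℤ) : ℝ) + p.2 - β * H)) * C₁ + ((((⌊α * H⌋ : ℤ) : ℝ) + p.1 - α * H)) * C₂) := by
            rw [hm₁, hm₂] at hprop; linarith
          have hbd : (H : ℝ) * |β * C₁ + α * C₂| ≤ |(C₁ : ℝ)| + |(C₂ : ℝ)| := by
            rw [← Nat.abs_cast H, ← abs_mul, hid, abs_neg]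
            refine (abs_add_le _ _).trans (add_le_add ?_ ?_)
            · rw [abs_mul]; exact mul_le_of_le_one_left (abs_nonneg _) hτ₁
            · rw [abs_mul]; exact mul_le_of_le_one_left (abs_nonneg _) hτ₂
          have hlt : (|(C₁ : ℝ)| + |(C₂ : ℝ)|) / |β * C₁ + α * C₂| < H :=
            hH₂.trans_le (by exact_mod_cast hHH₂)
          rw [div_lt_iff₀ hΔpos] at hlt
          linarith
        · -- non-proportional: Cramer's rule gives `γα, γβ ∈ ℚ + ℚξ`
          apply hfull
          have hdetR : (D : ℝ) * ((V₁ : ℝ) * W₂ - V₂ * W₁) ≠ 0 := by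
            refine mul_ne_zero hDne ?_
            have : ((V₁ * W₂ - V₂ * W₁ : ℚ) : ℝ) ≠ 0 := by exact_mod_cast hdet
            push_cast at this; exact this
          -- `D₁ = a₀ V₁ - A V₂`, `D₂ = b₀ V₁ - B V₂`
          refine ⟨(C₁ * j + (a₀ * V₁ - A * V₂) * js) / (D * (V₁ * W₂ - V₂ * W₁)),
            (-(D : ℚ) * (C₁ * k + (a₀ * V₁ - A * V₂) * ks)) / (D * (V₁ * W₂ - V₂ * W₁)),
            (C₂ * j + (b₀ * V₁ - B * V₂) * js) / (D * (V₁ * W₂ - V₂ * W₁)),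
            (-(D : ℚ) * (C₂ * k + (b₀ * V₁ - B * V₂) * ks)) / (D * (V₁ * W₂ - V₂ * W₁)), ?_, ?_⟩
          · push_cast
            rw [div_mul_eq_mul_div, ← add_div, eq_div_iff hdetR]
            simp only [hC₁, hW₁, hW₂, hV₁, hV₂]; push_cast
            rw [hM₁, hM₂, hN₁, hN₂]
            subst hαξ hβξ
            linear_combination ((A : ℝ) * (a₀ * n₁ + b₀ * n₂) - a₀ * (A * n₁ + B * n₂)) * hres' +
              ((a₀ : ℝ) * (A * m₁ + B * m₂) - A * (a₀ * m₁ + b₀ * m₂)) * hress'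
          · push_cast
            rw [div_mul_eq_mul_div, ← add_div, eq_div_iff hdetR]
            simp only [hC₂, hW₁, hW₂, hV₁, hV₂]; push_cast
            rw [hM₁, hM₂, hN₁, hN₂]
            subst hαξ hβξ
            linear_combination ((B : ℝ) * (a₀ * n₁ + b₀ * n₂) - b₀ * (A * n₁ + B * n₂)) * hres' +
              ((b₀ : ℝ) * (A * m₁ + B * m₂) - B * (a₀ * m₁ + b₀ * m₂)) * hress'
    · refine ⟨H₁, fun H hH p hp k j hres => ?_⟩
      exfalso
      exact hex ⟨H, hH, p, hp, k, j, hres⟩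

/-! ### P. The dependent case assembled -/

/-- The norm form of the correlation identity along a reindexing `ν` of the summation range:
`‖Σ_{m<N} e(q(ν m + H) − q(ν m))‖ ≤ Σ_{pieces} ‖Σ_{m<N} e(λ ν m) f¹({α ν m}) f²({β ν m})‖`.
[cite: Haland1994, §2] -/
theorem norm_sum_e_corr_le_comp (α β γ : ℝ) (ν : ℕ → ℕ) (h N : ℕ) :
    ‖∑ m ∈ range N, cexp (2 * π * I *
        ((⌊α * (ν m + h : ℕ)⌋ * ⌊β * (ν m + h : ℕ)⌋ * γ - ⌊α * (ν m)⌋ * ⌊β * (ν m)⌋ * γ : ℝ) : ℂ))‖ ≤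
      ∑ p ∈ ({0, 1} ×ˢ {0, 1} : Finset (ℕ × ℕ)),
        ‖∑ m ∈ range N,
          cexp (2 * π * I * ((γ * ((⌊β * h⌋ + p.2) * α + (⌊α * h⌋ + p.1) * β) * (ν m) : ℝ) : ℂ)) *
          ((if (1 ≤ Int.fract (α * h) + Int.fract (α * (ν m)) ↔ p.1 = 1) then 1 else 0) *
            cexp (2 * π * I * ((-(γ * (⌊β * h⌋ + p.2)) * Int.fract (α * (ν m)) : ℝ) : ℂ))) *
          ((if (1 ≤ Int.fract (β * h) + Int.fract (β * (ν m)) ↔ p.2 = 1) then 1 else 0) *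
            cexp (2 * π * I * ((-(γ * (⌊α * h⌋ + p.1)) * Int.fract (β * (ν m)) : ℝ) : ℂ)))‖ := by
  simp_rw [e_corr_eq_sum_pieces α β γ _ h]
  rw [Finset.sum_comm]
  refine (norm_sum_le _ _).trans (Finset.sum_le_sum fun p _ => ?_)
  have hre : ∀ n : ℕ,
      cexp (2 * π * I * ((γ * (⌊α * h⌋ + p.1) * (⌊β * h⌋ + p.2) : ℝ) : ℂ)) *
        cexp (2 * π * I * ((γ * ((⌊β * h⌋ + p.2) * α + (⌊α * h⌋ + p.1) * β) * n : ℝ) : ℂ)) *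
        ((if (1 ≤ Int.fract (α * h) + Int.fract (α * n) ↔ p.1 = 1) then 1 else 0) *
          cexp (2 * π * I * ((-(γ * (⌊β * h⌋ + p.2)) * Int.fract (α * n) : ℝ) : ℂ))) *
        ((if (1 ≤ Int.fract (β * h) + Int.fract (β * n) ↔ p.2 = 1) then 1 else 0) *
          cexp (2 * π * I * ((-(γ * (⌊α * h⌋ + p.1)) * Int.fract (β * n) : ℝ) : ℂ))) =
      cexp (2 * π * I * ((γ * (⌊α * h⌋ + p.1) * (⌊β * h⌋ + p.2) : ℝ) : ℂ)) *
        (cexp (2 * π * I * ((γ * ((⌊β * h⌋ + p.2) * α + (⌊α * h⌋ + p.1) * β) * n : ℝ) : ℂ)) *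
        ((if (1 ≤ Int.fract (α * h) + Int.fract (α * n) ↔ p.1 = 1) then 1 else 0) *
          cexp (2 * π * I * ((-(γ * (⌊β * h⌋ + p.2)) * Int.fract (α * n) : ℝ) : ℂ))) *
        ((if (1 ≤ Int.fract (β * h) + Int.fract (β * n) ↔ p.2 = 1) then 1 else 0) *
          cexp (2 * π * I * ((-(γ * (⌊α * h⌋ + p.1)) * Int.fract (β * n) : ℝ) : ℂ)))) :=
    fun n => by ring
  rw [Finset.sum_congr rfl fun m _ => hre (ν m), ← Finset.mul_sum, norm_mul]
  have h1 : ‖cexp (2 * π * I * ((γ * (⌊α * h⌋ + p.1) * (⌊β * h⌋ + p.2) : ℝ) : ℂ))‖ = 1 := norm_e _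
  rw [h1, one_mul]

/-- Fractional parts along an arithmetic progression in the dependent parametrisation:
if `α = Aξ + a₁/D` then `{α(Dm + r)} = {A·{Dξ·m} + αr}`. [folklore] -/
theorem fract_mul_AP {α ξ : ℝ} {A a₁ : ℤ} {D : ℕ} (hD : 0 < D) (hα : α = A * ξ + a₁ / D)
    (m r : ℕ) :
    Int.fract (α * ((D * m + r : ℕ) : ℝ)) = Int.fract (A * Int.fract ((D * ξ) * m) + α * r) := by
  have hDne : (D : ℝ) ≠ 0 := by
    have hD' : (0 : ℝ) < D := by exact_mod_cast hD
    exact hD'.ne'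
  have h1 : α * ((D * m + r : ℕ) : ℝ) = (A * Int.fract ((D * ξ) * m) + α * r) +
      ((A * ⌊(D * ξ) * m⌋ + a₁ * m : ℤ) : ℝ) := by
    have e : (A : ℝ) * ((D * ξ) * m) = A * ⌊(D * ξ) * m⌋ + A * Int.fract ((D * ξ) * m) := by
      rw [← mul_add, Int.floor_add_fract]
    push_cast
    have : α * (D * m) = A * ((D * ξ) * m) + a₁ * m := by
      rw [hα]; field_simp
    linear_combination this + e
  rw [h1, Int.fract_add_intCast]

/-- **The dependent case of the sufficiency half of Håland's Proposition 1.2.** Let `ξ` be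
irrational, `α = Aξ + a₁/D > 0`, `β = Bξ + b₁/D > 0` with integers `A, B` not both zero,
`a₁, b₁ ∈ ℤ`, `D ≥ 1`; let `γ` be irrational and not in the excluded configuration. Then the Weyl
sums of `γ⌊αn⌋⌊βn⌋` at frequency `1` are `o(N)`. (Along each residue class `n = Dm + r` the
fractional parts `{αn}, {βn}` are functions of the single rotation `{Dξ·m}`; strengthened van der
Corput, the correlation identity, `twisted_sum_eventually_le_one` and `key_dep`.)
[cite: Haland1994, Prop. 1.2 and §2 Remark p. 19] -/
theorem isLittleO_floor_mul_floor_dep {α β γ ξ : ℝ} {A B a₁ b₁ : ℤ} {D : ℕ} (hD : 0 < D)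
    (hα : 0 < α) (hβ : 0 < β) (hξ : Irrational ξ) (hAB : (A, B) ≠ (0, 0))
    (hαξ : α = A * ξ + a₁ / D) (hβξ : β = B * ξ + b₁ / D)
    (hγ : Irrational γ)
    (hbad : ∀ c : ℚ, 0 < c → (α / β) ^ 2 = c →
      γ ∈ Submodule.span ℚ ({1, α / β} : Set ℝ) → False)
    (trigApprox : ∀ (G : C(AddCircle (2 * Real.pi), ℂ)) {ε : ℝ}, 0 < ε →
      ∃ (s : Finset ℤ) (c : ℤ → ℂ),
        ∀ t : ℝ, ‖G (t : AddCircle (2 * Real.pi)) - ∑ k ∈ s, c k * cexp (k * t * I)‖ ≤ ε) :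
    (fun N : ℕ => ∑ n ∈ range N, cexp (2 * π * I * ((⌊α * n⌋ * ⌊β * n⌋ * γ : ℝ) : ℂ)))
      =o[atTop] fun N : ℕ => (N : ℝ) := by
  have hπ := Real.pi_pos
  have hDR : (0 : ℝ) < D := by exact_mod_cast hD
  have hDne : (D : ℝ) ≠ 0 := hDR.ne'
  -- rational offsets for `key_dep`
  have hαξ' : α = A * ξ + ((a₁ / D : ℚ) : ℝ) := by rw [hαξ]; push_cast; ring
  have hβξ' : β = B * ξ + ((b₁ / D : ℚ) : ℝ) := by rw [hβξ]; push_cast; ring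
  have hξ' : Irrational ((D : ℝ) * ξ) := by
    have : Irrational ((D : ℕ) * ξ) := hξ.natCast_mul hD.ne'
    simpa using this
  -- size of the exceptional sets of the composed pieces
  set P : ℕ := (1 + 1) * (A.natAbs + 3) + (1 + 1) * (B.natAbs + 3) with hPdef
  refine isLittleO_sum_range_of_residues (fun n => (norm_e _).le) hD fun r hr => ?_
  -- along the residue class `n = D m + r`
  refine isLittleO_sum_e_of_corr_eventually_small
    (x := fun m : ℕ => (⌊α * ((D * m + r : ℕ) : ℝ)⌋ * ⌊β * ((D * m + r : ℕ) : ℝ)⌋ * γ : ℝ))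
    fun η hη => ?_
  set M' : ℝ := 8 * (P + 1) / (π * η) with hM'
  have hM'pos : 0 < M' := by positivity
  obtain ⟨H₀, hkey⟩ := key_dep hD hα hβ hξ hAB hαξ' hβξ' hγ hbad M'
  refine ⟨H₀, fun h hh => ?_⟩
  have hHD : H₀ ≤ D * h := le_trans hh (Nat.le_mul_of_pos_left h hD)
  set Bnd : ℝ := (P + 1) / (π * M') with hBnd
  have hBnd0 : 0 ≤ Bnd := by positivity
  have hBndη : Bnd = η / 8 := by rw [hBnd, hM']; field_simp
  -- the shift `h` in `m` is the shift `D h` in `n`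
  have hshift : ∀ m : ℕ, (D * (m + h) + r : ℕ) = (D * m + r) + D * h := fun m => by ring
  -- each piece is eventually small
  have hpieces : ∀ p ∈ ({0, 1} ×ˢ {0, 1} : Finset (ℕ × ℕ)), ∀ᶠ N : ℕ in atTop,
      ‖∑ m ∈ range N,
          cexp (2 * π * I * ((γ * ((⌊β * (D * h : ℕ)⌋ + p.2) * α + (⌊α * (D * h : ℕ)⌋ + p.1) * β) *
            ((D * m + r : ℕ) : ℕ) : ℝ) : ℂ)) *
          ((if (1 ≤ Int.fract (α * (D * h : ℕ)) + Int.fract (α * ((D * m + r : ℕ) : ℕ)) ↔ p.1 = 1)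
              then 1 else 0) *
            cexp (2 * π * I * ((-(γ * (⌊β * (D * h : ℕ)⌋ + p.2)) *
              Int.fract (α * ((D * m + r : ℕ) : ℕ)) : ℝ) : ℂ))) *
          ((if (1 ≤ Int.fract (β * (D * h : ℕ)) + Int.fract (β * ((D * m + r : ℕ) : ℕ)) ↔ p.2 = 1)
              then 1 else 0) *
            cexp (2 * π * I * ((-(γ * (⌊α * (D * h : ℕ)⌋ + p.1)) *
              Int.fract (β * ((D * m + r : ℕ) : ℕ)) : ℝ) : ℂ)))‖ ≤ (Bnd + η / 8) * N := by
    intro p hp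
    set Hs : ℕ := D * h with hHs
    set lam : ℝ := γ * ((⌊β * (Hs : ℝ)⌋ + p.2) * α + (⌊α * (Hs : ℝ)⌋ + p.1) * β) with hlam
    set κ₁ : ℝ := -(γ * (⌊β * (Hs : ℝ)⌋ + p.2)) with hκ₁
    set κ₂ : ℝ := -(γ * (⌊α * (Hs : ℝ)⌋ + p.1)) with hκ₂
    set f₁ : ℝ → ℂ := fun u => (if (1 ≤ Int.fract (α * Hs) + u ↔ p.1 = 1) then (1 : ℂ) else 0) *
      cexp (2 * π * I * ((κ₁ * u : ℝ) : ℂ)) with hf₁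
    set f₂ : ℝ → ℂ := fun u => (if (1 ≤ Int.fract (β * Hs) + u ↔ p.2 = 1) then (1 : ℂ) else 0) *
      cexp (2 * π * I * ((κ₂ * u : ℝ) : ℂ)) with hf₂
    -- the composed weight `F(t) = f₁({A t + α r}) f₂({B t + β r})`
    set F : ℝ → ℂ := fun t => f₁ (Int.fract (A * t + α * r)) * f₂ (Int.fract (B * t + β * r))
      with hF
    have hnorm₁ : ∀ x, ‖f₁ x‖ ≤ 1 := fun x => norm_piece_le _ _ _ x
    have hnorm₂ : ∀ x, ‖f₂ x‖ ≤ 1 := fun x => norm_piece_le _ _ _ x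
    have hFnorm : ∀ t, ‖F t‖ ≤ 1 := fun t => by
      rw [hF, norm_mul]
      calc ‖f₁ (Int.fract (A * t + α * r))‖ * ‖f₂ (Int.fract (B * t + β * r))‖ ≤ 1 * 1 := by
            gcongr
            · exact hnorm₁ _
            · exact hnorm₂ _
        _ = 1 := one_mul _
    have hmeas₁ : Measurable f₁ := measurable_piece _ _ _
    have hmeas₂ : Measurable f₂ := measurable_piece _ _ _
    have hFmeas : Measurable F := by
      rw [hF]
      refine Measurable.mul (hmeas₁.comp ?_) (hmeas₂.comp ?_)
      · exact measurable_fract.comp (by fun_prop)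
      · exact measurable_fract.comp (by fun_prop)
    -- locally exponential structure of `F`
    obtain ⟨T₁, hT₁card, hloc₁⟩ :=
      comp_fract_locally_e (piece_locally_e (Int.fract (α * Hs)) κ₁ p.1) A (α * r)
    obtain ⟨T₂, hT₂card, hloc₂⟩ :=
      comp_fract_locally_e (piece_locally_e (Int.fract (β * Hs)) κ₂ p.2) B (β * r)
    have hlocF := mul_locally_e hloc₁ hloc₂
    have hTcard : ((T₁ ∪ T₂).card : ℝ) ≤ P := by
      have h1 : (T₁ ∪ T₂).card ≤ P := by
        rw [hPdef]
        refine (Finset.card_union_le _ _).trans (add_le_add ?_ ?_)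
        · simpa using hT₁card
        · simpa using hT₂card
      exact_mod_cast h1
    have happ := fun ε (hε : 0 < ε) => exists_trigPoly_approx_of_locally_e (f := F) _ hFnorm
      (intervalIntegrable_of_norm_le_one hFmeas hFnorm 0 1) hlocF trigApprox hε
    -- the resonant bound
    have hB : ∀ k j : ℤ, lam * D + k * (D * ξ) = j →
        ‖∫ x in (0 : ℝ)..1, F x * cexp (2 * π * I * ((-((k : ℝ) * x) : ℝ) : ℂ))‖ ≤ Bnd := by
      intro k j hres
      have hres' : (D : ℝ) * (γ * ((⌊β * (Hs : ℝ)⌋ + p.2) * α + (⌊α * (Hs : ℝ)⌋ + p.1) * β)) +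
          k * ((D : ℝ) * ξ) = j := by rw [← hres, hlam]; ring
      have hM := hkey Hs hHD p hp k j hres'
      have hne : (A * κ₁ + B * κ₂) - k ≠ 0 := by
        intro h0
        have : |γ * (A * (⌊β * (Hs : ℝ)⌋ + p.2) + B * (⌊α * (Hs : ℝ)⌋ + p.1)) + k| = 0 := by
          rw [abs_eq_zero, hκ₁, hκ₂] at *; linarith
        linarith
      have h1 := norm_fourierCoeff_le_of_locally_e _ hFnorm hFmeas hlocF k hne
      have habs : M' ≤ |(A * κ₁ + B * κ₂) - k| := by
        rw [hκ₁, hκ₂, show (A : ℝ) * -(γ * (⌊β * (Hs : ℝ)⌋ + p.2)) + B * -(γ * (⌊α * (Hs : ℝ)⌋ + p.1)) - k =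
          -(γ * (A * (⌊β * (Hs : ℝ)⌋ + p.2) + B * (⌊α * (Hs : ℝ)⌋ + p.1)) + k) by ring, abs_neg]
        exact hM
      refine h1.trans ?_
      rw [hBnd]
      calc (((T₁ ∪ T₂).card : ℝ) + 1) / (π * |(A * κ₁ + B * κ₂) - k|)
          ≤ ((P : ℝ) + 1) / (π * |(A * κ₁ + B * κ₂) - k|) := by gcongr
        _ ≤ ((P : ℝ) + 1) / (π * M') :=
            div_le_div_of_nonneg_left (by positivity) (by positivity) (by gcongr)
    have key := twisted_sum_eventually_le_one (Λ := lam * D) hξ' hFnorm happ hBnd0 hB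
      (η := η / 8) (by positivity)
    -- rewrite the piece sum in the form of `key`
    refine key.mono fun N hN => ?_
    have hterm : ∀ m : ℕ,
        cexp (2 * π * I * ((γ * ((⌊β * (D * h : ℕ)⌋ + p.2) * α + (⌊α * (D * h : ℕ)⌋ + p.1) * β) *
            ((D * m + r : ℕ) : ℕ) : ℝ) : ℂ)) *
          ((if (1 ≤ Int.fract (α * (D * h : ℕ)) + Int.fract (α * ((D * m + r : ℕ) : ℕ)) ↔ p.1 = 1)
              then 1 else 0) *
            cexp (2 * π * I * ((-(γ * (⌊β * (D * h : ℕ)⌋ + p.2)) *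
              Int.fract (α * ((D * m + r : ℕ) : ℕ)) : ℝ) : ℂ))) *
          ((if (1 ≤ Int.fract (β * (D * h : ℕ)) + Int.fract (β * ((D * m + r : ℕ) : ℕ)) ↔ p.2 = 1)
              then 1 else 0) *
            cexp (2 * π * I * ((-(γ * (⌊α * (D * h : ℕ)⌋ + p.1)) *
              Int.fract (β * ((D * m + r : ℕ) : ℕ)) : ℝ) : ℂ))) =
        cexp (2 * π * I * ((lam * r : ℝ) : ℂ)) *
          (cexp (2 * π * I * (((lam * D) * m : ℝ) : ℂ)) * F (Int.fract ((D * ξ) * m))) := by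
      intro m
      have hu : Int.fract (α * ((D * m + r : ℕ) : ℝ)) = Int.fract (A * Int.fract ((D * ξ) * m) + α * r) :=
        fract_mul_AP hD hαξ m r
      have hv : Int.fract (β * ((D * m + r : ℕ) : ℝ)) = Int.fract (B * Int.fract ((D * ξ) * m) + β * r) :=
        fract_mul_AP hD hβξ m r
      have he : cexp (2 * π * I * ((γ * ((⌊β * (D * h : ℕ)⌋ + p.2) * α + (⌊α * (D * h : ℕ)⌋ + p.1) * β) *
            ((D * m + r : ℕ) : ℕ) : ℝ) : ℂ)) =
          cexp (2 * π * I * ((lam * r : ℝ) : ℂ)) * cexp (2 * π * I * (((lam * D) * m : ℝ) : ℂ)) := by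
        rw [← e_add]; congr 1; rw [hlam, hHs]; push_cast; ring
      rw [he, hF, hf₁, hf₂]
      simp only [hHs, hu, hv, hκ₁, hκ₂]
      push_cast
      ring
    rw [Finset.sum_congr rfl fun m _ => hterm m, ← Finset.mul_sum, norm_mul, norm_e, one_mul]
    exact hN
  -- combine the four pieces
  have hall := (Finset.eventually_all _).mpr hpieces
  filter_upwards [hall] with N hN
  have hcard : (({0, 1} ×ˢ {0, 1} : Finset (ℕ × ℕ))).card = 4 := by decide
  have hx : ∀ m : ℕ, ((⌊α * ((D * (m + h) + r : ℕ) : ℝ)⌋ * ⌊β * ((D * (m + h) + r : ℕ) : ℝ)⌋ * γ : ℝ) -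
      (⌊α * ((D * m + r : ℕ) : ℝ)⌋ * ⌊β * ((D * m + r : ℕ) : ℝ)⌋ * γ : ℝ)) =
      (⌊α * (((D * m + r : ℕ) + D * h : ℕ) : ℝ)⌋ * ⌊β * (((D * m + r : ℕ) + D * h : ℕ) : ℝ)⌋ * γ -
        ⌊α * ((D * m + r : ℕ) : ℝ)⌋ * ⌊β * ((D * m + r : ℕ) : ℝ)⌋ * γ : ℝ) := by
    intro m; rw [hshift m]
  simp_rw [hx]
  calc ‖∑ m ∈ range N, cexp (2 * π * I *
          ((⌊α * (((D * m + r : ℕ) + D * h : ℕ) : ℝ)⌋ * ⌊β * (((D * m + r : ℕ) + D * h : ℕ) : ℝ)⌋ * γ -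
            ⌊α * ((D * m + r : ℕ) : ℝ)⌋ * ⌊β * ((D * m + r : ℕ) : ℝ)⌋ * γ : ℝ) : ℂ))‖
      ≤ _ := norm_sum_e_corr_le_comp α β γ (fun m => D * m + r) (D * h) N
    _ ≤ ∑ p ∈ ({0, 1} ×ˢ {0, 1} : Finset (ℕ × ℕ)), (Bnd + η / 8) * N := Finset.sum_le_sum hN
    _ = 4 * ((Bnd + η / 8) * N) := by rw [Finset.sum_const, hcard, nsmul_eq_mul]; norm_num
    _ = η * N := by rw [hBndη]; ring

/-! ### Q. Both `α` and `β` rational -/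

/-- **Weyl's theorem for polynomials in Weyl-sum form**: if `p ∈ ℝ[X]` has degree `≥ 1` and
irrational leading coefficient then `Σ_{n<N} e(p(n)) = o(N)` (the tree's
`equidistributedModOne_polynomial` and Weyl's criterion). [cite: KuipersNiederreiter1974, Ch. 1, Thm 3.2] -/
theorem isLittleO_sum_e_polynomial {p : ℝ[X]} (hd : 1 ≤ p.natDegree)
    (hp : Irrational p.leadingCoeff) :
    (fun N : ℕ => ∑ n ∈ range N, cexp (2 * π * I * ((p.eval (n : ℝ) : ℝ) : ℂ))) =o[atTop]
      fun N : ℕ => (N : ℝ) := by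
  have h := (equidistributedModOne_polynomial hd hp).isLittleO_weylSum (h := 1) one_ne_zero
  refine h.congr' (Eventually.of_forall fun N => Finset.sum_congr rfl fun n _ => ?_)
    EventuallyEq.rfl
  simp


/-- **The rational case.** If `α = a/D`, `β = b/D` are positive rationals and `γ` is irrational,
the Weyl sums of `γ⌊αn⌋⌊βn⌋` are `o(N)`: along each residue class `n = Dm + r` the sequence is
a quadratic polynomial in `m` with irrational leading coefficient `γab`, equidistributed by Weyl's
theorem. [cite: KuipersNiederreiter1974, Ch. 1, Thm 3.2] -/
theorem isLittleO_floor_mul_floor_rat {α β γ : ℝ} {a b : ℤ} {D : ℕ} (hD : 0 < D)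
    (ha : 0 < a) (hb : 0 < b) (hα : α = a / D) (hβ : β = b / D) (hγ : Irrational γ) :
    (fun N : ℕ => ∑ n ∈ range N, cexp (2 * π * I * ((⌊α * n⌋ * ⌊β * n⌋ * γ : ℝ) : ℂ)))
      =o[atTop] fun N : ℕ => (N : ℝ) := by
  have hDR : (0 : ℝ) < D := by exact_mod_cast hD
  have hDne : (D : ℝ) ≠ 0 := hDR.ne'
  refine isLittleO_sum_range_of_residues (fun n => (norm_e _).le) hD fun r _ => ?_
  -- `⌊α (Dm + r)⌋ = a m + ⌊α r⌋`
  have hfl : ∀ (θ : ℝ) (t : ℤ), θ = t / D → ∀ m : ℕ,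
      (⌊θ * ((D * m + r : ℕ) : ℝ)⌋ : ℝ) = t * m + ⌊θ * r⌋ := by
    intro θ t hθ m
    have : θ * ((D * m + r : ℕ) : ℝ) = ((t * m : ℤ) : ℝ) + θ * r := by
      push_cast; rw [hθ]; field_simp
    rw [this, Int.floor_intCast_add]; push_cast; ring
  set ca : ℤ := ⌊α * r⌋ with hca
  set cb : ℤ := ⌊β * r⌋ with hcb
  set p : ℝ[X] := C (γ * a * b) * X ^ 2 + C (γ * (a * cb + b * ca)) * X + C (γ * ca * cb) with hp
  have hlead : γ * a * b ≠ 0 := by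
    refine mul_ne_zero (mul_ne_zero hγ.ne_zero ?_) ?_
    · exact_mod_cast ha.ne'
    · exact_mod_cast hb.ne'
  have hdeg : p.natDegree = 2 := by rw [hp]; exact natDegree_quadratic hlead
  have hlc : p.leadingCoeff = γ * a * b := by rw [hp]; exact leadingCoeff_quadratic hlead
  have hirr : Irrational p.leadingCoeff := by
    rw [hlc, mul_assoc, show (a : ℝ) * b = ((a * b : ℤ) : ℝ) by push_cast; ring]
    exact hγ.mul_intCast (mul_ne_zero ha.ne' hb.ne')
  have key := isLittleO_sum_e_polynomial (p := p) (by rw [hdeg]; norm_num) hirr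
  refine key.congr' (Eventually.of_forall fun M => Finset.sum_congr rfl fun m _ => ?_) EventuallyEq.rfl
  congr 2
  rw [hfl α a hα m, hfl β b hβ m, hp]
  simp only [eval_add, eval_mul, eval_C, eval_pow, eval_X]
  push_cast
  rw [← hca, ← hcb]
  ring

/-! ### R. The three cases combined -/

/-- A rational real number equals `num/den` of the rational. [folklore] -/
theorem eq_num_div_den_of_eq_ratCast {x : ℝ} {q : ℚ} (h : x = q) :
    x = (q.num : ℝ) / (q.den : ℕ) := by
  rw [h]; exact_mod_cast (Rat.num_div_den q).symm

/-- **Weyl sums of `γ⌊αn⌋⌊βn⌋` are `o(N)`** whenever `α, β > 0`, `γ` is irrational and the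
exceptional configuration `(α/β)² = c ∈ ℚ₊ ∧ γ ∈ ℚ + ℚ(α/β)` does not occur: the three cases
`dim_ℚ span{1, α, β} = 1, 2, 3` (`isLittleO_floor_mul_floor_rat`, `…_dep`, `…_indep`).
[cite: Haland1994, Prop. 1.2] -/
theorem isLittleO_floor_mul_floor {α β γ : ℝ} (hα : 0 < α) (hβ : 0 < β)
    (hγ : Irrational γ)
    (hbad : ∀ c : ℚ, 0 < c → (α / β) ^ 2 = c →
      γ ∈ Submodule.span ℚ ({1, α / β} : Set ℝ) → False)
    (trigApprox : ∀ (G : C(AddCircle (2 * Real.pi), ℂ)) {ε : ℝ}, 0 < ε →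
      ∃ (s : Finset ℤ) (c : ℤ → ℂ),
        ∀ t : ℝ, ‖G (t : AddCircle (2 * Real.pi)) - ∑ k ∈ s, c k * cexp (k * t * I)‖ ≤ ε) :
    (fun N : ℕ => ∑ n ∈ range N, cexp (2 * π * I * ((⌊α * n⌋ * ⌊β * n⌋ * γ : ℝ) : ℂ)))
      =o[atTop] fun N : ℕ => (N : ℝ) := by
  by_cases hind : ∀ k l j : ℤ, (k : ℝ) * α + l * β = j → k = 0 ∧ l = 0
  · exact isLittleO_floor_mul_floor_indep hα hβ hind hγ hbad trigApprox
  push Not at hind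
  obtain ⟨k, l, j, hrel, hkl⟩ := hind
  by_cases hrat : ∃ qa qb : ℚ, α = qa ∧ β = qb
  · -- both rational
    obtain ⟨qa, qb, hqa, hqb⟩ := hrat
    have hqa0 : 0 < qa := by exact_mod_cast (hqa ▸ hα : (0 : ℝ) < qa)
    have hqb0 : 0 < qb := by exact_mod_cast (hqb ▸ hβ : (0 : ℝ) < qb)
    set D : ℕ := qa.den * qb.den with hDdef
    have hD : 0 < D := Nat.mul_pos qa.den_pos qb.den_pos
    refine isLittleO_floor_mul_floor_rat (a := qa.num * qb.den) (b := qb.num * qa.den) hD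
      (mul_pos (Rat.num_pos.mpr hqa0) (by exact_mod_cast qb.den_pos))
      (mul_pos (Rat.num_pos.mpr hqb0) (by exact_mod_cast qa.den_pos)) ?_ ?_ hγ
    · rw [eq_num_div_den_of_eq_ratCast hqa, hDdef]
      have : (qa.den : ℝ) ≠ 0 := by exact_mod_cast qa.den_nz
      have : (qb.den : ℝ) ≠ 0 := by exact_mod_cast qb.den_nz
      push_cast; field_simp
    · rw [eq_num_div_den_of_eq_ratCast hqb, hDdef]
      have : (qa.den : ℝ) ≠ 0 := by exact_mod_cast qa.den_nz
      have : (qb.den : ℝ) ≠ 0 := by exact_mod_cast qb.den_nz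
      push_cast; field_simp
  · -- exactly one rational relation: the dependent parametrisation
    push Not at hrat
    by_cases hl : l = 0
    · -- `α = j/k ∈ ℚ`, `β ∉ ℚ`
      subst hl
      have hk : k ≠ 0 := fun h => hkl h rfl
      have hkR : (k : ℝ) ≠ 0 := by exact_mod_cast hk
      set qa : ℚ := (j : ℚ) / k with hqa
      have hαq : α = qa := by
        have h' : (k : ℝ) * α = j := by simpa using hrel
        rw [hqa]; push_cast; field_simp; linarith
      have hβirr : Irrational β := by
        rintro ⟨qb, hqb⟩
        exact hrat qa qb hαq hqb.symm
      refine isLittleO_floor_mul_floor_dep (ξ := β) (A := 0) (B := 1) (a₁ := qa.num) (b₁ := 0)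
        (D := qa.den) qa.den_pos hα hβ hβirr (by simp) ?_ ?_ hγ hbad trigApprox
      · rw [eq_num_div_den_of_eq_ratCast hαq]; push_cast; ring
      · push_cast; ring
    · by_cases hk : k = 0
      · -- `β = j/l ∈ ℚ`, `α ∉ ℚ`
        subst hk
        have hlR : (l : ℝ) ≠ 0 := by exact_mod_cast hl
        set qb : ℚ := (j : ℚ) / l with hqb
        have hβq : β = qb := by
          have h' : (l : ℝ) * β = j := by simpa using hrel
          rw [hqb]; push_cast; field_simp; linarith
        have hαirr : Irrational α := by
          rintro ⟨qa, hqa⟩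
          exact hrat qa qb hqa.symm hβq
        refine isLittleO_floor_mul_floor_dep (ξ := α) (A := 1) (B := 0) (a₁ := 0) (b₁ := qb.num)
          (D := qb.den) qb.den_pos hα hβ hαirr (by simp) ?_ ?_ hγ hbad trigApprox
        · push_cast; ring
        · rw [eq_num_div_den_of_eq_ratCast hβq]; push_cast; ring
      · -- `k, l ≠ 0`: `ξ = α/l`, `β = -kξ + j/l`
        have hlR : (l : ℝ) ≠ 0 := by exact_mod_cast hl
        have hαirr : Irrational α := by
          rintro ⟨qa, hqa⟩
          apply hrat qa (((j : ℚ) - k * qa) / l) hqa.symm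
          push_cast; field_simp; rw [hqa]; linarith
        set qb : ℚ := (j : ℚ) / l with hqb
        have hξ : Irrational (α / l) := by
          have := hαirr.div_intCast hl
          simpa using this
        refine isLittleO_floor_mul_floor_dep (ξ := α / l) (A := l) (B := -k) (a₁ := 0) (b₁ := qb.num)
          (D := qb.den) qb.den_pos hα hβ hξ (by simp [hl]) ?_ ?_ hγ hbad trigApprox
        · push_cast; field_simp; ring
        · have : ((qb.num : ℝ)) / (qb.den : ℕ) = (j : ℝ) / l := by
            rw [← eq_num_div_den_of_eq_ratCast (x := (j : ℝ) / l) (q := qb) (by rw [hqb]; push_cast; ring)]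
          rw [this]; push_cast; field_simp
          linear_combination hrel

/-! ### S. From Weyl sums to uniform distribution: the sufficiency half of Prop. 1.2 -/

/-- Passing from `Σ_{n<N}` to `Σ_{n=1}^{N}` in an `o(N)` statement for bounded terms. [folklore] -/
theorem isLittleO_sum_Icc_of_range {a : ℕ → ℂ}
    (h : (fun N : ℕ => ∑ n ∈ range N, a n) =o[atTop] fun N : ℕ => (N : ℝ)) :
    (fun N : ℕ => ∑ n ∈ Icc 1 N, a n) =o[atTop] fun N : ℕ => (N : ℝ) := by
  have hId : ∀ N : ℕ, ∑ n ∈ Icc 1 N, a n = ∑ n ∈ range (N + 1), a n - a 0 := by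
    intro N
    rw [Finset.range_eq_Ico, Finset.sum_eq_sum_Ico_succ_bot (Nat.succ_pos N)]
    have : Finset.Ico 1 (N + 1) = Finset.Icc 1 N := by
      ext n; simp
    rw [this]; ring
  simp_rw [hId]
  refine IsLittleO.sub ?_ ?_
  · have h1 : (fun N : ℕ => ∑ n ∈ range (N + 1), a n) =o[atTop] fun N : ℕ => ((N + 1 : ℕ) : ℝ) :=
      h.comp_tendsto (tendsto_add_atTop_nat 1)
    refine h1.trans_isBigO ?_
    refine IsBigO.of_bound 2 (eventually_atTop.mpr ⟨1, fun N hN => ?_⟩)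
    rw [Real.norm_natCast, Real.norm_natCast]; push_cast
    have : (1 : ℝ) ≤ N := by exact_mod_cast hN
    linarith
  · refine isLittleO_const_left.mpr (Or.inr ?_)
    exact tendsto_norm_atTop_atTop.comp tendsto_natCast_atTop_atTop

end HalandUD

open HalandUD in
/-- **Håland 1994, Proposition 1.2 — the sufficiency direction, for positive `α, β`.** If either
(i) `α/β ≠ √c` for every positive rational `c` and `γ` is irrational, or (ii) `α/β = √c` for some
positive rational `c` and `γ ∉ span_ℚ{1, √c}`, then `[αn][βn]γ` is uniformly distributed mod 1.
(Weyl's criterion; at frequency `k ≠ 0` the hypothesis is inherited by `kγ`, and the Weyl sums are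
`o(N)` by `isLittleO_floor_mul_floor`.) [cite: Haland1994, Prop. 1.2] -/
theorem Haland1994_prop_1_2_sufficiency {α β γ : ℝ} (hα : 0 < α) (hβ : 0 < β)
    (h : ((∀ c : ℚ, 0 < c → α / β ≠ Real.sqrt c) ∧ Irrational γ) ∨
      (∃ c : ℚ, 0 < c ∧ α / β = Real.sqrt c ∧
        γ ∉ Submodule.span ℚ ({1, Real.sqrt c} : Set ℝ))) :
    IsUDModOne fun n : ℕ => (⌊α * n⌋ : ℝ) * (⌊β * n⌋ : ℝ) * γ := by
  have trigApprox : ∀ (G : C(AddCircle (2 * Real.pi), ℂ)) {ε : ℝ}, 0 < ε →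
      ∃ (s : Finset ℤ) (c : ℤ → ℂ),
        ∀ t : ℝ, ‖G (t : AddCircle (2 * Real.pi)) - ∑ k ∈ s, c k * cexp (k * t * I)‖ ≤ ε :=
    fun G _ hε => WeylCircle.exists_trigPoly_approx G hε
  have hθ : 0 < α / β := div_pos hα hβ
  -- the working form of the hypothesis
  have hγ : Irrational γ := by
    rcases h with ⟨_, hγ⟩ | ⟨c, _, _, hγ⟩
    · exact hγ
    · rintro ⟨q, hq⟩
      apply hγ
      rw [← hq, Submodule.mem_span_pair]
      exact ⟨q, 0, by simp⟩
  have hbad : ∀ c : ℚ, 0 < c → (α / β) ^ 2 = c →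
      γ ∈ Submodule.span ℚ ({1, α / β} : Set ℝ) → False := by
    intro c hc hsq hmem
    have hsqrt : α / β = Real.sqrt c := by
      rw [← hsq, Real.sqrt_sq hθ.le]
    rcases h with ⟨hne, _⟩ | ⟨c', _, hc', hγ'⟩
    · exact hne c hc hsqrt
    · rw [hc'] at hmem; exact hγ' hmem
  refine FloorMultipleUD.isUniformlyDistributedModOne_of_isLittleO fun k hk => ?_
  -- the hypothesis passes to `kγ`
  have hγk : Irrational (γ * k) := hγ.mul_intCast hk
  have hbadk : ∀ c : ℚ, 0 < c → (α / β) ^ 2 = c →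
      γ * k ∈ Submodule.span ℚ ({1, α / β} : Set ℝ) → False := by
    intro c hc hsq hmem
    refine hbad c hc hsq ?_
    have : γ = (k : ℚ)⁻¹ • (γ * k) := by
      rw [Rat.smul_def]; push_cast; field_simp
    rw [this]
    exact Submodule.smul_mem _ _ hmem
  have key := isLittleO_floor_mul_floor hα hβ hγk hbadk trigApprox
  have key' := isLittleO_sum_Icc_of_range key
  refine key'.congr' (Eventually.of_forall fun N => Finset.sum_congr rfl fun n _ => ?_) EventuallyEq.rfl
  congr 1; push_cast; ring

end Literature.NumberTheory.DiophantineApproximation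

end
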